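import Literature.NumberTheory.Sieve.FriedlanderIwaniecPrimesSquarefree
import Literature.NumberTheory.Sieve.FriedlanderIwaniecPrimesInfinitude
import Literature.NumberTheory.Sieve.FriedlanderIwaniecPrimesProofs
import HarnessLib

/-!
# Friedlander–Iwaniec, *The polynomial `X² + Y⁴` captures its primes*: (4.7) from the printed architecture via the squarefree-supported sequence

Family `parity`, statement parity.S17 (`Literature.NumberTheory.Sieve.friedlanderIwaniecSum_isEquivalent`,
`Literature.NumberTheory.Sieve.setOf_prime_sq_add_pow_four_infinite`). Source: J. Friedlander, H. Iwaniec, Ann. of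
Math. (2) 148 (1998), 945–1040 [FriedlanderIwaniecAnnals1998], §§2–4.

## What this file proves

`Literature.NumberTheory.Sieve.FriedlanderIwaniecPrimes` reduces parity.S17 to FI's (4.7),
`FriedlanderIwaniec1998_primeSum_asymp`, and (4.7) to Proposition 2.1 (the asymptotic sieve for
primes, `FriedlanderIwaniec1998_prop21`, vendored AS PRINTED) applied to
`a_n = #{(a, c) ∈ ℤ² : a² + c⁴ = n}` — at the price of the §3 hypotheses (2.2), (2.7), (2.8) of
Proposition 2.1 for this sequence. But (2.8) as printed ("`A_d(x) ≪ d⁻¹ τ(d)⁸ A(x)` uniformly in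
`d ≤ x^{1/3}`") is FALSE for `a_n` (`FriedlanderIwaniec1998_hyp28_false`,
`FriedlanderIwaniecPrimesHyp28`), so that reduction is vacuous. Here Proposition 2.1 is applied
instead to the squarefree-supported sequence `a'_n = μ(n)² a_n` (`fiSieveSeqSq`,
`FriedlanderIwaniecPrimesSquarefree`), for which all of (2.1)–(2.15) are PROVED below from FI's
Proposition 3.5, Proposition 4.1 and (2.7) for `g`; since `a'_p = a_p` and `H' A'(x) ∼ H A(x)`
(`H' = H/P_∞`, `A' ∼ P_∞ A`), its conclusion is (4.7) for `a_n`. The end results: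

* `FriedlanderIwaniec1998_primeSum_asymp_of_sq_inputs :
    _prop21 → _prop35 → _prop41 → _hyp27 → FriedlanderIwaniec1998_primeSum_asymp`;
* `friedlanderIwaniecSum_isEquivalent_of_sq_inputs` (parity.S17, FI Theorem 1) and
  `setOf_prime_sq_add_pow_four_infinite_of_sq_inputs` (its qualitative clause) from the same four
  named facts — Proposition 2.1, Proposition 3.5, Proposition 4.1 (all as printed) and (2.7) for the
  density (3.16) (Mertens' theorem for `χ₄` with a prime-number-theorem error term). Everything else
  in FI's deduction of Theorem 1 is now a theorem of the tree ((2.2): `_hyp22_holds`; (4.2):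
  `_count_asymp_holds`; (4.8): `_densityConstant_holds`; and this file).

## The proof ((2.9) for `a'` is the work)

Write `T = {p ≤ x}`, `ℓ_L = ∏_{p ∈ L} p` for `L ⊆ T`, `P = P(⌊x⌋) = ∏_{p ≤ x} (1 - g(p²))`.
* Part A — (2.8) for squarefree moduli: `A_d(x) ≤ 2^{ω(d)} (2x^{1/4}+1)(2√x/d+1)` for squarefree
  `d` (`congrSum_le_of_squarefree`): for each `c`, the roots `a ∈ [-√x, √x]` of
  `a² ≡ -c⁴ (mod d)` inject into `{S ⊆ primes of d} × {blocks of length d}` by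
  `a ↦ ({p : p ∣ a - a₀}, ⌊(a+√x)/d⌋)`.
* Part B — inclusion–exclusion: `μ²(n) = Σ_{L ⊆ T, ℓ_L² ∣ n} (-1)^{|L|}`
  (`ite_squarefree_eq_sum`), so `A'_d(t) = Σ_{L ⊆ T} (-1)^{|L|} A_{lcm(d, ℓ_L²)}(t)`
  (`congrSumSq_eq_sum`); the moduli `lcm(d, ℓ_L²)` are cubefree, and the main terms form an EXACT
  finite Euler product: `Σ_{L ⊆ T} (-1)^{|L|} g(lcm(d, ℓ_L²)) = g'(d) P` (`sum_neg_one_pow_mul_fiDensity_lcm`,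
  by `Finset.prod_add`).
* Part C — truncating at `ℓ_L ≤ Λ`:
  `|r'_d(t)| ≤ (A(t) TG_d + RS_d(t) + ES_d(t)) + g'(d)(A(t) TG_1 + RS_1(t) + ES_1(t))`
  (`abs_remainderSq_le`) with `TG_d = Σ_{ℓ_L>Λ} g(lcm)`, `RS_d = Σ_{ℓ_L≤Λ} |r_{lcm}(t)|`,
  `ES_d = Σ_{ℓ_L>Λ} A_{lcm}(t)`; Rankin's trick with exponent `1/2` gives
  `Σ_d TG_d ≤ e^{6 Σ_n n^{-3/2}} Λ^{-1/2} Σ_d g(d)` (`sum_sum_big_fiDensity_lcm_le`).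
* Part D — `Σ_d RS_d ≤ τ_max² Σ_{b ≤ D₀Λ² cubefree} |r_b(t)|` (each `b` arises from `≤ τ(b)²` pairs;
  `sum_sum_small_abs_remainder_le`) — this is where Proposition 3.5 enters; and
  `Σ_d ES_d ≤ τ_max Σ_{Λ<ℓ≤√x sqfree} A_{ℓ²}(x)`, split at `Λ₁`: `A_{ℓ²} = g(ℓ²)A + r_{ℓ²}` on
  `(Λ, Λ₁]` (Prop. 3.5 again), Cauchy–Schwarz with (2.2) for `a` and
  `#{n ≤ x : ∃ ℓ > Λ₁, ℓ² ∣ n} ≤ x/Λ₁` on `(Λ₁, √x]` (`sum_large_congrSum_sq_le`).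
* Parts E–F — with `Λ = ⌊x^{1/100}⌋`, `Λ₁ = ⌊x^{103/300}⌋`, `ε = 1/1000` in Prop. 3.5 and
  `τ(n) ≪ n^{1/2000}`: for `t ≤ x`, `D₀ ≤ x^{69/100}`,
  `Σ_{d ≤ D₀ cubefree} |r'_d(t)| ≤ A(x) x^{-1/500}` and `|A'(t) - P A(t)| ≤ A(x) x^{-1/500}`
  (`levelSq_and_countSq`).
* Parts G–H — (2.1), (2.2), (2.4)–(2.8), (2.9) (`D = x^{17/25}`), (2.11) (`B' ≤ B`,
  `fiBilinearPi_sq_le`, and Prop. 4.1 with `η = 1/25`), (2.7) for `g'`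
  (`c' = c - Σ_p (g - g')(p)`), Proposition 2.1, and `|A'(x) - P_∞ A(x)| ≤ A(x)(x^{-1/500} + 3/⌊x⌋)`.

## References

* J. Friedlander, H. Iwaniec, *The polynomial `X² + Y⁴` captures its primes*, Ann. of Math. (2)
  148 (1998), 945–1040: §2, (2.1)–(2.17) and Proposition 2.1; §3, (3.16)–(3.19), Proposition 3.5
  and the paragraph following it; §4, (4.1)–(4.8), Proposition 4.1.
  [cite: FriedlanderIwaniecAnnals1998, §§2-4]
* J. Friedlander, H. Iwaniec, *Asymptotic sieve for primes*, Ann. of Math. (2) 148 (1998),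
  1041–1065, Theorem 1 (squarefree support, (1.16)). [cite: FriedlanderIwaniecASP1998, Theorem 1]
* G. Harman, *Prime-Detecting Sieves*, Princeton 2007, §12.9, Theorems 12.3–12.5.
  [cite: Harman2007, §12.9]

## Mathlib / tree

Tree: `FriedlanderIwaniecPrimesSquarefree` (all definitions: `fiDensitySq`, `fiSieveSeqSq`,
`fiCountSq`, `fiSqProd`, `fiSqConst`), `FriedlanderIwaniecPrimes` (`fiSieveSeq`, `fiDensity`,
`FI1998SieveHypotheses`, the named facts, `fiCount_bounds`, `ranges_eventually`,
`friedlanderIwaniecSum_isEquivalent_of_primeSum`), `FriedlanderIwaniecPrimesInfinitude`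
(`FriedlanderIwaniec1998_hyp22_holds`, `setOf_prime_sq_add_pow_four_infinite_of_primeSum`),
`FriedlanderIwaniecPrimesProofs` (`FriedlanderIwaniec1998_densityConstant_holds`), `DivisorBound`
(`exists_sigma_zero_le_mul_rpow`). Mathlib: `Finset.prod_add`, `Finset.prod_one_add`,
`Finset.sum_powerset_neg_one_pow_card`, `Finset.sum_comp`, `sq_sum_le_card_mul_sum_sq`,
`Nat.Ioc_filter_dvd_card_eq_div`, `sum_Ioc_inv_sq_le_sub`, `harmonic_le_one_add_log`,
`Real.summable_nat_rpow`, `Real.tsum_le_of_sum_range_le`, `isLittleO_log_rpow_rpow_atTop`.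
No definitions are introduced in this file.
-/

noncomputable section

open Filter Finset Real Asymptotics
open scoped Topology ArithmeticFunction.sigma ArithmeticFunction.Moebius ArithmeticFunction.omega

/-! ## Part A: the crude bound (2.8) for squarefree moduli -/

namespace Literature.NumberTheory.Sieve.FriedlanderIwaniecPrimesSquarefree

open FriedlanderIwaniecPrimes
open scoped ArithmeticFunction.sigma ArithmeticFunction.Moebius ArithmeticFunction.omega

/-- Fibrewise: `∑_{n ≤ x} a_n f(n) = ∑_{(a,c) ∈ ℤ², 1 ≤ a² + c⁴ ≤ x} f(a² + c⁴)`. [folklore] -/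
theorem sum_fiRepCount_mul (x : ℕ) (f : ℕ → ℝ) :
    ∑ n ∈ Icc 1 x, (fiRepCount n : ℝ) * f n = ∑ ac ∈ fiPoints x, f (fiQuartic ac) := by
  rw [← Finset.sum_fiberwise_of_maps_to (s := fiPoints x) (t := Icc 1 x) (g := fiQuartic)
    (fun ac hac => (mem_filter.mp hac).2)]
  refine Finset.sum_congr rfl fun n hn => ?_
  have hnx : n ≤ x := (mem_Icc.mp hn).2
  have hset : {ac ∈ fiPoints x | fiQuartic ac = n} =
      {ac ∈ fiBox x | ac.1 ^ 2 + ac.2 ^ 4 = (n : ℤ)} := by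
    ext ac
    simp only [fiPoints, mem_filter, fiQuartic_eq_iff]
    constructor
    · rintro ⟨⟨h1, -⟩, h2⟩; exact ⟨h1, h2⟩
    · rintro ⟨h1, h2⟩; refine ⟨⟨h1, ?_⟩, h2⟩; rwa [(fiQuartic_eq_iff ac n).mpr h2]
  rw [hset, Finset.sum_congr rfl (g := fun _ => f n), Finset.sum_const, nsmul_eq_mul,
    fiRepCount_eq_card hnx]
  intro ac hac
  rw [(fiQuartic_eq_iff ac n).mpr (mem_filter.mp hac).2]

/-- `A_d(x)` counted on the lattice points: `A_d(x) = #{(a,c) : 1 ≤ a² + c⁴ ≤ x, d ∣ a² + c⁴}`.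
[folklore] -/
theorem congrSum_eq_card (d : ℕ) (x : ℝ) :
    fiSieveSeq.congrSum d x = #{ac ∈ fiPoints ⌊x⌋₊ | d ∣ fiQuartic ac} := by
  rw [SieveSequence.congrSum, Finset.card_eq_sum_ones, Nat.cast_sum, Finset.sum_filter,
    Finset.sum_filter]
  push_cast
  have h := sum_fiRepCount_mul ⌊x⌋₊ (fun n => if d ∣ n then 1 else 0)
  simp only [mul_ite, mul_one, mul_zero] at h
  rw [← h]
  refine Finset.sum_congr ?_ fun n _ => rfl
  ext n; simp [Nat.one_le_iff_ne_zero, Nat.pos_iff_ne_zero]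

/-- All prime factors of a squarefree `d` divide `m` ⟹ `d ∣ m`. [folklore] -/
theorem dvd_of_forall_prime_dvd {d m : ℕ} (hd : Squarefree d)
    (h : ∀ p ∈ d.primeFactors, p ∣ m) : d ∣ m := by
  rw [← Nat.prod_primeFactors_of_squarefree hd]
  exact Finset.prod_primes_dvd m (fun p hp => (Nat.prime_of_mem_primeFactors hp).prime) h

/-- **Roots of `a² ≡ k` modulo a squarefree `d` in an interval.** For squarefree `d ≥ 1`, `k ∈ ℤ`
and `A ≥ 0`: `#{a ∈ [-A, A] : d ∣ a² - k} ≤ 2^{ω(d)} (2A/d + 1)`. Two roots `a, a'` with the same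
set `{p ∣ d : p ∣ a - a₀}` (for a fixed root `a₀`) are congruent modulo `d`, since for the other
primes `p ∣ d` one has `p ∣ a + a₀` and `p ∣ a' + a₀`. [folklore] -/
theorem card_sq_congr_le {d : ℕ} (hd : Squarefree d) (k : ℤ) (A : ℕ) :
    (#{a ∈ Icc (-(A : ℤ)) A | (d : ℤ) ∣ a ^ 2 - k} : ℝ) ≤
      2 ^ d.primeFactors.card * (2 * (A : ℝ) / d + 1) := by
  have hd0 : d ≠ 0 := hd.ne_zero
  have hdpos : (0 : ℤ) < d := by exact_mod_cast Nat.pos_of_ne_zero hd0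
  set S : Finset ℤ := {a ∈ Icc (-(A : ℤ)) A | (d : ℤ) ∣ a ^ 2 - k} with hS
  rcases S.eq_empty_or_nonempty with hSe | ⟨a₀, ha₀⟩
  · rw [hSe]; simp; positivity
  have ha₀' := (mem_filter.mp ha₀).2
  -- the block index `(a + A) / d ∈ [0, 2A/d]`
  set B : ℕ := (2 * A) / d with hB
  let φ : ℤ → Finset ℕ × ℕ := fun a =>
    (d.primeFactors.filter (fun p : ℕ => (p : ℤ) ∣ a - a₀), ((a + A) / d).toNat)
  have hmaps : ∀ a ∈ S, φ a ∈ d.primeFactors.powerset ×ˢ Finset.range (B + 1) := by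
    intro a ha
    have ha1 := (mem_Icc.mp (mem_filter.mp ha).1)
    simp only [φ, mem_product, mem_powerset, Finset.filter_subset, true_and, mem_range]
    have h0 : 0 ≤ a + A := by linarith [ha1.1]
    have h1 : (a + A) / d ≤ (2 * A : ℤ) / d := Int.ediv_le_ediv hdpos (by linarith [ha1.2])
    have h2 : ((2 * A : ℤ) / d) = ((2 * A / d : ℕ) : ℤ) := by push_cast; rfl
    have h3 : ((a + A) / d).toNat ≤ 2 * A / d := Int.toNat_le.mpr (h2 ▸ h1)
    omega
  have hinj : Set.InjOn φ S := by
    intro a ha a' ha' heq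
    simp only [φ, Prod.mk.injEq] at heq
    obtain ⟨hset, hblock⟩ := heq
    have ha1 := mem_filter.mp ha
    have ha1' := mem_filter.mp ha'
    -- every prime factor of `d` divides `a - a'`
    have hdvd : (d : ℤ) ∣ a - a' := by
      have key : ∀ p ∈ d.primeFactors, (p : ℤ) ∣ a - a' := by
        intro p hp
        have hpP : Prime (p : ℤ) := Nat.prime_iff_prime_int.mp (Nat.prime_of_mem_primeFactors hp)
        have hpd : (p : ℤ) ∣ (d : ℤ) := Int.natCast_dvd_natCast.mpr (Nat.dvd_of_mem_primeFactors hp)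
        -- `p ∣ a² - a₀² = (a - a₀)(a + a₀)` and the same for `a'`
        have hq : ∀ b : ℤ, (d : ℤ) ∣ b ^ 2 - k → (p : ℤ) ∣ b - a₀ ∨ (p : ℤ) ∣ b + a₀ := by
          intro b hb
          have : (p : ℤ) ∣ (b - a₀) * (b + a₀) := by
            have h1 : (p : ℤ) ∣ (b ^ 2 - k) - (a₀ ^ 2 - k) :=
              dvd_sub (hpd.trans hb) (hpd.trans ha₀')
            have h2 : (b ^ 2 - k) - (a₀ ^ 2 - k) = (b - a₀) * (b + a₀) := by ring
            rwa [h2] at h1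
          exact hpP.dvd_or_dvd this
        by_cases hpa : (p : ℤ) ∣ a - a₀
        · have hpa' : (p : ℤ) ∣ a' - a₀ := by
            have : p ∈ d.primeFactors.filter (fun p : ℕ => (p : ℤ) ∣ a' - a₀) := by
              rw [← hset]; exact mem_filter.mpr ⟨hp, hpa⟩
            exact (mem_filter.mp this).2
          have := dvd_sub hpa hpa'
          rwa [show a - a₀ - (a' - a₀) = a - a' by ring] at this
        · have hpa' : ¬(p : ℤ) ∣ a' - a₀ := by
            intro h
            have : p ∈ d.primeFactors.filter (fun p : ℕ => (p : ℤ) ∣ a - a₀) := by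
              rw [hset]; exact mem_filter.mpr ⟨hp, h⟩
            exact hpa (mem_filter.mp this).2
          have h1 := (hq a ha1.2).resolve_left hpa
          have h2 := (hq a' ha1'.2).resolve_left hpa'
          have := dvd_sub h1 h2
          rwa [show a + a₀ - (a' + a₀) = a - a' by ring] at this
      have hnat : d ∣ (a - a').natAbs :=
        dvd_of_forall_prime_dvd hd fun p hp => Int.natCast_dvd.mp (key p hp)
      exact Int.natCast_dvd.mpr hnat
    -- same block and congruent ⟹ equal
    obtain ⟨t, ht⟩ := hdvd
    have hA := (mem_Icc.mp ha1.1)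
    have hA' := (mem_Icc.mp ha1'.1)
    have h0 : 0 ≤ a + A := by linarith [hA.1]
    have h0' : 0 ≤ a' + A := by linarith [hA'.1]
    have hb : (a + A) / d = (a' + A) / d := by
      have h1 : (((a + A) / d).toNat : ℤ) = (((a' + A) / d).toNat : ℤ) := by exact_mod_cast hblock
      rwa [Int.toNat_of_nonneg (Int.ediv_nonneg h0 hdpos.le),
        Int.toNat_of_nonneg (Int.ediv_nonneg h0' hdpos.le)] at h1
    have ha_eq : a + A = (a' + A) + d * t := by linarith
    rw [ha_eq, Int.add_mul_ediv_left _ _ hdpos.ne'] at hb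
    have ht0 : t = 0 := by linarith
    rw [ht0, mul_zero] at ht
    linarith
  have hcard := Finset.card_le_card_of_injOn φ hmaps hinj
  rw [card_product, card_powerset, card_range] at hcard
  have h1 : (#S : ℝ) ≤ 2 ^ d.primeFactors.card * (B + 1 : ℕ) := by exact_mod_cast hcard
  refine h1.trans ?_
  gcongr
  push_cast
  gcongr
  -- `⌊2A/d⌋ ≤ 2A/d`
  rw [hB, le_div_iff₀ (by exact_mod_cast Nat.pos_of_ne_zero hd0)]
  have := Nat.div_mul_le_self (2 * A) d
  exact_mod_cast this

/-- **The crude bound for squarefree moduli**: for squarefree `d` and `x ≥ 0`,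
`A_d(x) ≤ 2^{ω(d)} (2 x^{1/4} + 1) (2 √x / d + 1)` (for each of the `≤ 2x^{1/4} + 1` values of
`c`, the `a` with `|a| ≤ √x`, `a² ≡ -c⁴ (mod d)`). This is the "elementary argument" alluded to
in FI §3 after Proposition 3.5, valid for squarefree (indeed cubefree) moduli.
[cite: FriedlanderIwaniecAnnals1998, §3, paragraph after Proposition 3.5] -/
theorem congrSum_le_of_squarefree {d : ℕ} (hd : Squarefree d) {x : ℝ} (hx : 0 ≤ x) :
    fiSieveSeq.congrSum d x ≤
      2 ^ d.primeFactors.card * (2 * x ^ (1 / 4 : ℝ) + 1) * (2 * x ^ (1 / 2 : ℝ) / d + 1) := by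
  rw [congrSum_eq_card]
  set X : ℕ := ⌊x⌋₊ with hX
  set A : ℕ := Nat.sqrt X with hA
  set C : ℕ := Nat.sqrt (Nat.sqrt X) with hC
  -- the points lie in `[-A, A] × [-C, C]`
  have hsub : {ac ∈ fiPoints X | d ∣ fiQuartic ac} ⊆
      ((Icc (-(A : ℤ)) A ×ˢ Icc (-(C : ℤ)) C).filter
        (fun ac : ℤ × ℤ => (d : ℤ) ∣ ac.1 ^ 2 - (-(ac.2 ^ 4)))) := by
    intro ⟨a, c⟩ hac
    simp only [fiPoints, mem_filter, mem_Icc] at hac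
    obtain ⟨⟨-, -, hq⟩, hdq⟩ := hac
    have hq' : a ^ 2 + c ^ 4 ≤ (X : ℤ) := by
      have := fiQuartic_cast (a, c); simp only at this
      rw [← this]; exact_mod_cast hq
    refine mem_filter.mpr ⟨mem_product.mpr ⟨?_, ?_⟩, ?_⟩
    · exact mem_Icc_sqrt_of_sq_le (by nlinarith [sq_nonneg (c ^ 2)])
    · exact mem_Icc_sqrt_sqrt_of_pow_four_le (by nlinarith [sq_nonneg a])
    · have : (d : ℤ) ∣ (fiQuartic (a, c) : ℤ) := Int.natCast_dvd_natCast.mpr hdq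
      rw [fiQuartic_cast] at this
      simpa using this
  have hcard := Finset.card_le_card hsub
  -- split over `c`
  have hsplit : #(((Icc (-(A : ℤ)) A ×ˢ Icc (-(C : ℤ)) C).filter
        (fun ac : ℤ × ℤ => (d : ℤ) ∣ ac.1 ^ 2 - (-(ac.2 ^ 4))))) =
      ∑ c ∈ Icc (-(C : ℤ)) C, #{a ∈ Icc (-(A : ℤ)) A | (d : ℤ) ∣ a ^ 2 - (-(c ^ 4))} := by
    rw [Finset.card_filter, Finset.sum_product_right]
    refine Finset.sum_congr rfl fun c _ => ?_
    rw [Finset.card_filter]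
  have h1 : (#{ac ∈ fiPoints X | d ∣ fiQuartic ac} : ℝ) ≤
      ∑ c ∈ Icc (-(C : ℤ)) C, (2 ^ d.primeFactors.card * (2 * (A : ℝ) / d + 1)) := by
    calc (#{ac ∈ fiPoints X | d ∣ fiQuartic ac} : ℝ)
        ≤ #(((Icc (-(A : ℤ)) A ×ˢ Icc (-(C : ℤ)) C).filter
            (fun ac : ℤ × ℤ => (d : ℤ) ∣ ac.1 ^ 2 - (-(ac.2 ^ 4))))) := by exact_mod_cast hcard
      _ = ∑ c ∈ Icc (-(C : ℤ)) C, (#{a ∈ Icc (-(A : ℤ)) A | (d : ℤ) ∣ a ^ 2 - (-(c ^ 4))} : ℝ) := by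
          rw [hsplit]; push_cast; rfl
      _ ≤ ∑ c ∈ Icc (-(C : ℤ)) C, (2 ^ d.primeFactors.card * (2 * (A : ℝ) / d + 1)) :=
          Finset.sum_le_sum fun c _ => card_sq_congr_le hd _ A
  rw [Finset.sum_const, nsmul_eq_mul, Int.card_Icc] at h1
  refine h1.trans ?_
  -- `#[-C, C] = 2C + 1 ≤ 2 x^{1/4} + 1` and `A ≤ x^{1/2}`
  have hXx : (X : ℝ) ≤ x := Nat.floor_le hx
  have hA2 : (A : ℝ) ≤ x ^ (1 / 2 : ℝ) := by
    have h := Nat.sqrt_le' X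
    have h' : ((A : ℝ)) ^ 2 ≤ x := by exact_mod_cast (show ((A ^ 2 : ℕ) : ℝ) ≤ x from
      (Nat.cast_le.mpr h).trans hXx)
    calc (A : ℝ) = ((A : ℝ) ^ 2) ^ (1 / 2 : ℝ) := by
          rw [← Real.sqrt_eq_rpow, Real.sqrt_sq (Nat.cast_nonneg _)]
      _ ≤ x ^ (1 / 2 : ℝ) := Real.rpow_le_rpow (by positivity) h' (by norm_num)
  have hC4 : (C : ℝ) ≤ x ^ (1 / 4 : ℝ) := by
    have h2 : C ^ 4 ≤ X := by
      calc C ^ 4 = (C * C) * (C * C) := by ring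
        _ ≤ Nat.sqrt X * Nat.sqrt X := Nat.mul_le_mul (Nat.sqrt_le _) (Nat.sqrt_le _)
        _ ≤ X := Nat.sqrt_le X
    have h' : ((C : ℝ)) ^ 4 ≤ x := by exact_mod_cast (show ((C ^ 4 : ℕ) : ℝ) ≤ x from
      (Nat.cast_le.mpr h2).trans hXx)
    calc (C : ℝ) = ((C : ℝ) ^ 4) ^ (1 / 4 : ℝ) := by
          rw [← Real.rpow_natCast, ← Real.rpow_mul (Nat.cast_nonneg _)]; norm_num
      _ ≤ x ^ (1 / 4 : ℝ) := Real.rpow_le_rpow (by positivity) h' (by norm_num)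
  have hcardC : (((C : ℤ) + 1 - -(C : ℤ)).toNat : ℝ) = 2 * C + 1 := by
    rw [show (C : ℤ) + 1 - -(C : ℤ) = ((2 * C + 1 : ℕ) : ℤ) by push_cast; ring, Int.toNat_natCast]
    push_cast; ring
  rw [hcardC]
  have hd0 : (0 : ℝ) < d := by exact_mod_cast Nat.pos_of_ne_zero hd.ne_zero
  calc (2 * (C : ℝ) + 1) * (2 ^ d.primeFactors.card * (2 * (A : ℝ) / d + 1))
      = 2 ^ d.primeFactors.card * (2 * (C : ℝ) + 1) * (2 * (A : ℝ) / d + 1) := by ring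
    _ ≤ 2 ^ d.primeFactors.card * (2 * x ^ (1 / 4 : ℝ) + 1) * (2 * x ^ (1 / 2 : ℝ) / d + 1) := by
        gcongr

/-- `2^{ω(d)} ≤ τ(d)`. [folklore] -/
theorem two_pow_card_primeFactors_le_sigma (d : ℕ) (hd : d ≠ 0) :
    (2 : ℝ) ^ d.primeFactors.card ≤ σ 0 d := by
  rw [ArithmeticFunction.sigma_zero_apply]
  suffices h : 2 ^ d.primeFactors.card ≤ #d.divisors by exact_mod_cast h
  rw [← Finset.card_powerset]
  have hinj : Set.InjOn (fun L : Finset ℕ => ∏ p ∈ L, p) ↑(d.primeFactors.powerset) := by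
    intro L hL L' hL' h
    have hLp : ∀ p ∈ L, p.Prime := fun p hp =>
      Nat.prime_of_mem_primeFactors (mem_powerset.mp hL hp)
    have hLp' : ∀ p ∈ L', p.Prime := fun p hp =>
      Nat.prime_of_mem_primeFactors (mem_powerset.mp hL' hp)
    have := congrArg Nat.primeFactors h
    simp only at this
    rwa [Nat.primeFactors_prod hLp, Nat.primeFactors_prod hLp'] at this
  have hmaps : ∀ L ∈ d.primeFactors.powerset, (∏ p ∈ L, p) ∈ d.divisors := by
    intro L hL
    rw [Nat.mem_divisors]
    refine ⟨?_, hd⟩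
    calc ∏ p ∈ L, p ∣ ∏ p ∈ d.primeFactors, p := Finset.prod_dvd_prod_of_subset _ _ _ (mem_powerset.mp hL)
      _ ∣ d := Nat.prod_primeFactors_dvd d
  exact Finset.card_le_card_of_injOn _ hmaps hinj

/-- **(2.8) for squarefree moduli, clean form**: for squarefree `d` with `1 ≤ d ≤ √x`, `x ≥ 1`:
`A_d(x) ≤ 9 τ(d) x^{3/4} / d`. [cite: FriedlanderIwaniecAnnals1998, §3, paragraph after Proposition 3.5] -/
theorem congrSum_le_sigma_mul {d : ℕ} (hd : Squarefree d) {x : ℝ} (hx : 1 ≤ x)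
    (hdx : (d : ℝ) ≤ x ^ (1 / 2 : ℝ)) :
    fiSieveSeq.congrSum d x ≤ 9 * (σ 0 d : ℝ) * x ^ (3 / 4 : ℝ) / d := by
  have hx0 : 0 < x := by linarith
  have hd0 : (0 : ℝ) < d := by exact_mod_cast Nat.pos_of_ne_zero hd.ne_zero
  have hd1 : (1 : ℝ) ≤ d := by exact_mod_cast Nat.pos_of_ne_zero hd.ne_zero
  refine (congrSum_le_of_squarefree hd hx0.le).trans ?_
  have h2 := two_pow_card_primeFactors_le_sigma d hd.ne_zero
  have hx4 : 1 ≤ x ^ (1 / 4 : ℝ) := Real.one_le_rpow hx (by norm_num)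
  have hx2d : 1 ≤ x ^ (1 / 2 : ℝ) / d := by rw [le_div_iff₀ hd0, one_mul]; exact hdx
  have e34 : x ^ (1 / 4 : ℝ) * x ^ (1 / 2 : ℝ) = x ^ (3 / 4 : ℝ) := by
    rw [← Real.rpow_add hx0]; norm_num
  calc 2 ^ d.primeFactors.card * (2 * x ^ (1 / 4 : ℝ) + 1) * (2 * x ^ (1 / 2 : ℝ) / d + 1)
      ≤ (σ 0 d : ℝ) * (3 * x ^ (1 / 4 : ℝ)) * (3 * (x ^ (1 / 2 : ℝ) / d)) := by
        gcongr
        · linarith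
        · rw [mul_div_assoc]; linarith
    _ = 9 * (σ 0 d : ℝ) * x ^ (3 / 4 : ℝ) / d := by
        rw [← e34]; ring

end Literature.NumberTheory.Sieve.FriedlanderIwaniecPrimesSquarefree

/-! ## Part B: inclusion–exclusion over square divisors -/

namespace Literature.NumberTheory.Sieve.FriedlanderIwaniecPrimesSquarefree

open FriedlanderIwaniecPrimes
open scoped ArithmeticFunction.sigma ArithmeticFunction.Moebius ArithmeticFunction.omega

/-! ### Products of sets of primes -/

/-- A product of distinct primes is squarefree. [folklore] -/
theorem squarefree_prod_of_primes {L : Finset ℕ} (hL : ∀ p ∈ L, p.Prime) :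
    Squarefree (∏ p ∈ L, p) := by
  classical
  induction L using Finset.induction_on with
  | empty => simp
  | insert q L hq ih =>
    rw [Finset.prod_insert hq]
    have hL' : ∀ p ∈ L, p.Prime := fun p hp => hL p (Finset.mem_insert_of_mem hp)
    have hqp : q.Prime := hL q (Finset.mem_insert_self q L)
    refine (Nat.squarefree_mul ?_).mpr ⟨hqp.squarefree, ih hL'⟩
    exact Nat.Coprime.prod_right fun p hp =>
      (Nat.coprime_primes hqp (hL' p hp)).mpr (fun h => hq (h ▸ hp))

/-- For distinct primes, `(∏_{p ∈ L} p)² ∣ n ↔ ∀ p ∈ L, p² ∣ n`. [folklore] -/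
theorem prod_sq_dvd_iff {L : Finset ℕ} (hL : ∀ p ∈ L, p.Prime) (n : ℕ) :
    (∏ p ∈ L, p) ^ 2 ∣ n ↔ ∀ p ∈ L, p ^ 2 ∣ n := by
  classical
  constructor
  · intro h p hp
    exact ((pow_dvd_pow_of_dvd (Finset.dvd_prod_of_mem _ hp) 2).trans h)
  · intro h
    induction L using Finset.induction_on with
    | empty => simp
    | insert q L hq ih =>
      rw [Finset.prod_insert hq, mul_pow]
      have hL' : ∀ p ∈ L, p.Prime := fun p hp => hL p (Finset.mem_insert_of_mem hp)
      have hqp : q.Prime := hL q (Finset.mem_insert_self q L)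
      have hcop : (q ^ 2).Coprime ((∏ p ∈ L, p) ^ 2) :=
        Nat.Coprime.pow 2 2 (Nat.Coprime.prod_right fun p hp =>
          (Nat.coprime_primes hqp (hL' p hp)).mpr (fun h' => hq (h' ▸ hp)))
      exact hcop.mul_dvd_of_dvd_of_dvd (h q (Finset.mem_insert_self q L))
        (ih hL' fun p hp => h p (Finset.mem_insert_of_mem hp))

/-- `lcm(d, ℓ²) ∣ n ↔ d ∣ n ∧ ∀ p ∈ L, p² ∣ n` (`ℓ = ∏ L`). [folklore] -/
theorem lcm_sq_dvd_iff (d : ℕ) {L : Finset ℕ} (hL : ∀ p ∈ L, p.Prime) (n : ℕ) :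
    Nat.lcm d ((∏ p ∈ L, p) ^ 2) ∣ n ↔ d ∣ n ∧ ∀ p ∈ L, p ^ 2 ∣ n := by
  rw [← prod_sq_dvd_iff hL]
  exact ⟨fun h => ⟨(Nat.dvd_lcm_left _ _).trans h, (Nat.dvd_lcm_right _ _).trans h⟩,
    fun h => Nat.lcm_dvd h.1 h.2⟩

/-! ### The squarefree indicator by inclusion–exclusion -/

/-- **`μ²` by inclusion–exclusion over a set of primes**: if `T` is a finite set of primes
containing every prime whose square divides `n`, then
`[n squarefree] = ∑_{L ⊆ T, ∀ p ∈ L: p² ∣ n} (-1)^{|L|}`. [folklore] -/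
theorem ite_squarefree_eq_sum {n : ℕ} {T : Finset ℕ} (hT : ∀ p ∈ T, p.Prime)
    (hT' : ∀ p : ℕ, p.Prime → p ^ 2 ∣ n → p ∈ T) :
    (if Squarefree n then (1 : ℝ) else 0) =
      ∑ L ∈ T.powerset with (∀ p ∈ L, p ^ 2 ∣ n), (-1 : ℝ) ^ #L := by
  have hset : (T.powerset.filter fun L => ∀ p ∈ L, p ^ 2 ∣ n) =
      (T.filter fun p => p ^ 2 ∣ n).powerset := by
    ext L
    simp only [Finset.mem_filter, Finset.mem_powerset, Finset.subset_iff]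
    constructor
    · rintro ⟨h1, h2⟩ p hp; exact ⟨h1 hp, h2 p hp⟩
    · intro h; exact ⟨fun p hp => (h hp).1, fun p hp => (h hp).2⟩
  rw [hset]
  have hZ := (Finset.sum_powerset_neg_one_pow_card (x := T.filter fun p => p ^ 2 ∣ n))
  have hR : ∑ L ∈ (T.filter fun p => p ^ 2 ∣ n).powerset, (-1 : ℝ) ^ #L =
      ((∑ L ∈ (T.filter fun p => p ^ 2 ∣ n).powerset, (-1 : ℤ) ^ #L : ℤ) : ℝ) := by push_cast; rfl
  rw [hR, hZ]
  have hiff : (T.filter fun p => p ^ 2 ∣ n) = ∅ ↔ Squarefree n := by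
    rw [Nat.squarefree_iff_prime_squarefree, Finset.filter_eq_empty_iff]
    constructor
    · intro h p hp hpn
      exact h (hT' p hp (by rwa [pow_two])) (by rwa [pow_two])
    · intro h p hp hpn
      exact h p (hT p hp) (by rwa [pow_two] at hpn)
  by_cases hs : Squarefree n
  · rw [if_pos hs, if_pos (hiff.mpr hs)]; simp
  · rw [if_neg hs, if_neg (fun h => hs (hiff.mp h))]; simp

/-- **Inclusion–exclusion for `A'_d`**: for `d ≥ 1` and `⌊t⌋ ≤ X`,
`A'_d(t) = ∑_{L ⊆ {p ≤ X}} (-1)^{|L|} A_{lcm(d, ℓ_L²)}(t)`, `ℓ_L = ∏_{p ∈ L} p`. [folklore] -/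
theorem congrSumSq_eq_sum (d : ℕ) {t : ℝ} {X : ℕ} (ht : ⌊t⌋₊ ≤ X) :
    fiSieveSeqSq.congrSum d t = ∑ L ∈ (Nat.primesLE X).powerset,
      (-1 : ℝ) ^ #L * fiSieveSeq.congrSum (Nat.lcm d ((∏ p ∈ L, p) ^ 2)) t := by
  set T := Nat.primesLE X with hT
  have hTp : ∀ p ∈ T, p.Prime := fun p hp => Nat.prime_of_mem_primesLE hp
  -- expand `a'_n`
  have h1 : fiSieveSeqSq.congrSum d t = ∑ n ∈ (Ioc 0 ⌊t⌋₊).filter (d ∣ ·),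
      (fiRepCount n : ℝ) * ∑ L ∈ T.powerset with (∀ p ∈ L, p ^ 2 ∣ n), (-1 : ℝ) ^ #L := by
    unfold SieveSequence.congrSum
    refine Finset.sum_congr rfl fun n hn => ?_
    show fiSieveSeqSq.a n = _
    have hn' := Finset.mem_filter.mp hn
    have hn0 : n ≠ 0 := (Finset.mem_Ioc.mp hn'.1).1.ne'
    have hnX : n ≤ X := (Finset.mem_Ioc.mp hn'.1).2.trans ht
    rw [fiSieveSeqSq_a, ← ite_squarefree_eq_sum hTp]
    · split_ifs <;> simp
    · intro p hp hpn
      rw [hT, Nat.mem_primesLE]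
      refine ⟨?_, hp⟩
      have : p ^ 2 ≤ n := Nat.le_of_dvd (Nat.pos_of_ne_zero hn0) hpn
      calc p ≤ p ^ 2 := Nat.le_self_pow two_ne_zero p
        _ ≤ X := this.trans hnX
  rw [h1]
  have h2 : ∀ n ∈ (Ioc 0 ⌊t⌋₊).filter (d ∣ ·),
      (fiRepCount n : ℝ) * ∑ L ∈ T.powerset with (∀ p ∈ L, p ^ 2 ∣ n), (-1 : ℝ) ^ #L =
        ∑ L ∈ T.powerset, (if (∀ p ∈ L, p ^ 2 ∣ n) then (fiRepCount n : ℝ) * (-1 : ℝ) ^ #L else 0) := by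
    intro n _
    rw [Finset.sum_filter, Finset.mul_sum]
    refine Finset.sum_congr rfl fun L _ => ?_
    split_ifs <;> simp
  rw [Finset.sum_congr rfl h2, Finset.sum_comm]
  refine Finset.sum_congr rfl fun L hL => ?_
  have hLp : ∀ p ∈ L, p.Prime := fun p hp => hTp p (Finset.mem_powerset.mp hL hp)
  rw [← Finset.sum_filter, Finset.filter_filter, SieveSequence.congrSum, Finset.mul_sum]
  have hset : (Ioc 0 ⌊t⌋₊).filter (fun n => d ∣ n ∧ ∀ p ∈ L, p ^ 2 ∣ n) =
      (Ioc 0 ⌊t⌋₊).filter (fun n => Nat.lcm d ((∏ p ∈ L, p) ^ 2) ∣ n) :=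
    Finset.filter_congr fun n _ => (lcm_sq_dvd_iff d hLp n).symm
  rw [hset]
  refine Finset.sum_congr rfl fun n _ => ?_
  change (fiRepCount n : ℝ) * _ = _ * (fiRepCount n : ℝ)
  ring

/-! ### The main term: an exact Euler product -/

/-- `lcm(d, ℓ_L²) = (∏_{p ∣ d, p ∉ L} p) · ∏_{p ∈ L} p²` for squarefree `d` and a set of primes `L`.
[folklore] -/
theorem lcm_sq_eq_prod {d : ℕ} (hd : Squarefree d) {L : Finset ℕ} (hL : ∀ p ∈ L, p.Prime) :
    Nat.lcm d ((∏ p ∈ L, p) ^ 2) = (∏ p ∈ d.primeFactors \ L, p) * ∏ p ∈ L, p ^ 2 := by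
  classical
  set D := d.primeFactors with hD
  have hsplit : d = (∏ p ∈ D \ L, p) * ∏ p ∈ D ∩ L, p := by
    rw [← Finset.prod_union (Finset.disjoint_sdiff_inter D L), Finset.sdiff_union_inter,
      Nat.prod_primeFactors_of_squarefree hd]
  have hcop : (∏ p ∈ D \ L, p).Coprime ((∏ p ∈ L, p) ^ 2) := by
    refine Nat.Coprime.pow_right 2 (Nat.Coprime.prod_left fun p hp => ?_)
    refine Nat.Coprime.prod_right fun q hq => ?_
    have hp' := Finset.mem_sdiff.mp hp
    exact (Nat.coprime_primes (Nat.prime_of_mem_primeFactors hp'.1) (hL q hq)).mpr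
      (fun h => hp'.2 (h ▸ hq))
  have hcop' : (∏ p ∈ D \ L, p).Coprime (∏ p ∈ D ∩ L, p) := by
    refine Nat.Coprime.prod_left fun p hp => Nat.Coprime.prod_right fun q hq => ?_
    have hp' := Finset.mem_sdiff.mp hp
    have hq' := Finset.mem_inter.mp hq
    exact (Nat.coprime_primes (Nat.prime_of_mem_primeFactors hp'.1)
      (Nat.prime_of_mem_primeFactors hq'.1)).mpr (fun h => hp'.2 (h ▸ hq'.2))
  have hdvd : (∏ p ∈ D ∩ L, p) ∣ (∏ p ∈ L, p) ^ 2 := by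
    calc (∏ p ∈ D ∩ L, p) ∣ ∏ p ∈ L, p := Finset.prod_dvd_prod_of_subset _ _ _ Finset.inter_subset_right
      _ ∣ (∏ p ∈ L, p) ^ 2 := dvd_pow_self _ two_ne_zero
  rw [Finset.prod_pow]
  conv_lhs => rw [hsplit]
  rw [← hcop'.lcm_eq_mul, Nat.lcm_assoc, Nat.lcm_eq_right hdvd, hcop.lcm_eq_mul]

/-- `g(lcm(d, ℓ_L²)) = ∏_{p ∣ d, p ∉ L} g(p) · ∏_{p ∈ L} g(p²)` for squarefree `d`, by
multiplicativity of `g` (3.16). [folklore] -/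
theorem fiDensity_lcm_sq {d : ℕ} (hd : Squarefree d) {L : Finset ℕ} (hL : ∀ p ∈ L, p.Prime) :
    fiDensity (Nat.lcm d ((∏ p ∈ L, p) ^ 2)) =
      (∏ p ∈ d.primeFactors \ L, fiDensity p) * ∏ p ∈ L, fiDensity (p ^ 2) := by
  classical
  rw [lcm_sq_eq_prod hd hL]
  have hcop : (∏ p ∈ d.primeFactors \ L, p).Coprime (∏ p ∈ L, p ^ 2) := by
    refine Nat.Coprime.prod_left fun p hp => Nat.Coprime.prod_right fun q hq => ?_
    have hp' := Finset.mem_sdiff.mp hp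
    exact Nat.Coprime.pow_right 2 ((Nat.coprime_primes (Nat.prime_of_mem_primeFactors hp'.1)
      (hL q hq)).mpr (fun h => hp'.2 (h ▸ hq)))
  rw [isMultiplicative_fiDensity.map_mul_of_coprime hcop,
    isMultiplicative_fiDensity.map_prod_of_prime _
      (fun p hp => Nat.prime_of_mem_primeFactors (Finset.mem_sdiff.mp hp).1),
    isMultiplicative_fiDensity.map_prod (fun p => p ^ 2)]
  intro p hp q hq hpq
  exact Nat.coprime_pow_primes 2 2 (hL p hp) (hL q hq) hpq

/-- `g'(p) (1 - g(p²)) = g(p) - g(p²)`. [folklore] -/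
theorem fiDensitySq_prime_mul {p : ℕ} (hp : p.Prime) :
    fiDensitySq p * (1 - fiDensity (p ^ 2)) = fiDensity p - fiDensity (p ^ 2) := by
  rw [fiDensitySq_prime hp, div_mul_cancel₀ _ (one_sub_fiDensity_sq_pos hp).ne']

/-- **The main term is an exact Euler product**: for squarefree `d` with all prime factors in the
finite set of primes `T`,
`∑_{L ⊆ T} (-1)^{|L|} g(lcm(d, ℓ_L²)) = g'(d) ∏_{p ∈ T} (1 - g(p²))`.
(Expand `∏_{p ∈ T} (u_p - g(p²))` with `u_p = g(p)` for `p ∣ d` and `u_p = 1` otherwise.)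
[folklore] -/
theorem sum_neg_one_pow_mul_fiDensity_lcm {d : ℕ} (hd : Squarefree d) {T : Finset ℕ}
    (hT : ∀ p ∈ T, p.Prime) (hdT : d.primeFactors ⊆ T) :
    ∑ L ∈ T.powerset, (-1 : ℝ) ^ #L * fiDensity (Nat.lcm d ((∏ p ∈ L, p) ^ 2)) =
      fiDensitySq d * ∏ p ∈ T, (1 - fiDensity (p ^ 2)) := by
  classical
  set D := d.primeFactors with hD
  set u : ℕ → ℝ := fun p => if p ∈ D then fiDensity p else 1 with hu
  set v : ℕ → ℝ := fun p => -fiDensity (p ^ 2) with hv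
  -- each term is `(∏_{L} v)(∏_{T \ L} u)`
  have hterm : ∀ L ∈ T.powerset, (-1 : ℝ) ^ #L * fiDensity (Nat.lcm d ((∏ p ∈ L, p) ^ 2)) =
      (∏ p ∈ L, v p) * ∏ p ∈ T \ L, u p := by
    intro L hL
    have hLT := Finset.mem_powerset.mp hL
    have hLp : ∀ p ∈ L, p.Prime := fun p hp => hT p (hLT hp)
    rw [fiDensity_lcm_sq hd hLp]
    have h1 : ∏ p ∈ T \ L, u p = ∏ p ∈ D \ L, fiDensity p := by
      rw [hu, Finset.prod_ite_mem]
      · congr 1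
        ext p
        simp only [Finset.mem_inter, Finset.mem_sdiff]
        constructor
        · rintro ⟨⟨-, h2⟩, h3⟩; exact ⟨h3, h2⟩
        · rintro ⟨h1, h2⟩; exact ⟨⟨hdT h1, h2⟩, h1⟩
    have h2 : ∏ p ∈ L, v p = (-1 : ℝ) ^ #L * ∏ p ∈ L, fiDensity (p ^ 2) := by
      rw [hv, Finset.prod_neg]
    rw [h1, h2]; ring
  rw [Finset.sum_congr rfl hterm, ← Finset.prod_add]
  -- `∏_{p ∈ T} (v_p + u_p) = ∏_{p ∈ D} (g(p) - g(p²)) ∏_{p ∈ T \ D} (1 - g(p²))`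
  rw [← Finset.prod_sdiff hdT]
  have hD1 : ∏ p ∈ D, (v p + u p) = ∏ p ∈ D, (fiDensitySq p * (1 - fiDensity (p ^ 2))) := by
    refine Finset.prod_congr rfl fun p hp => ?_
    rw [fiDensitySq_prime_mul (Nat.prime_of_mem_primeFactors hp), hu, hv]
    simp only [if_pos hp]; ring
  have hD2 : ∏ p ∈ T \ D, (v p + u p) = ∏ p ∈ T \ D, (1 - fiDensity (p ^ 2)) := by
    refine Finset.prod_congr rfl fun p hp => ?_
    rw [hu, hv]
    simp only [if_neg (Finset.mem_sdiff.mp hp).2]; ring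
  rw [hD1, hD2, Finset.prod_mul_distrib, fiDensitySq_eq_prod_of_squarefree hd, ← hD]
  rw [← Finset.prod_sdiff hdT (f := fun p => 1 - fiDensity (p ^ 2))]
  ring

/-! ### Cubefree moduli and sizes -/

/-- `lcm(d, ℓ_L²)` is cubefree for squarefree `d`. [folklore] -/
theorem isCubefree_lcm_sq {d : ℕ} (hd : Squarefree d) {L : Finset ℕ} (hL : ∀ p ∈ L, p.Prime) :
    IsCubefree (Nat.lcm d ((∏ p ∈ L, p) ^ 2)) := by
  classical
  intro p hp
  have hl0 : (∏ p ∈ L, p) ≠ 0 := Finset.prod_ne_zero_iff.mpr fun q hq => (hL q hq).ne_zero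
  rw [Nat.factorization_lcm hd.ne_zero (pow_ne_zero 2 hl0)]
  simp only [Finsupp.sup_apply, Nat.factorization_pow]
  refine sup_le ((hd.natFactorization_le_one p).trans one_le_two) ?_
  simp only [Finsupp.smul_apply, smul_eq_mul]
  have : (∏ p ∈ L, p).factorization p ≤ 1 := (squarefree_prod_of_primes hL).natFactorization_le_one p
  omega

/-- `lcm(d, ℓ²) ≤ d ℓ²`. [folklore] -/
theorem lcm_sq_le (d : ℕ) (L : Finset ℕ) :
    Nat.lcm d ((∏ p ∈ L, p) ^ 2) ≤ d * (∏ p ∈ L, p) ^ 2 ∨ d = 0 ∨ (∏ p ∈ L, p) = 0 := by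
  by_cases hd : d = 0
  · exact Or.inr (Or.inl hd)
  by_cases hl : (∏ p ∈ L, p) = 0
  · exact Or.inr (Or.inr hl)
  exact Or.inl (Nat.le_of_dvd (Nat.pos_of_ne_zero (mul_ne_zero hd (pow_ne_zero 2 hl)))
    (Nat.lcm_dvd_mul d _))

/-- `1 ≤ lcm(d, ℓ_L²) ≤ d ℓ_L²` for `d ≥ 1` and primes `L`. [folklore] -/
theorem lcm_sq_pos_le {d : ℕ} (hd : d ≠ 0) {L : Finset ℕ} (hL : ∀ p ∈ L, p.Prime) :
    1 ≤ Nat.lcm d ((∏ p ∈ L, p) ^ 2) ∧ Nat.lcm d ((∏ p ∈ L, p) ^ 2) ≤ d * (∏ p ∈ L, p) ^ 2 := by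
  have hl0 : (∏ p ∈ L, p) ≠ 0 := Finset.prod_ne_zero_iff.mpr fun q hq => (hL q hq).ne_zero
  refine ⟨Nat.pos_of_ne_zero (Nat.lcm_ne_zero hd (pow_ne_zero 2 hl0)), ?_⟩
  exact Nat.le_of_dvd (Nat.pos_of_ne_zero (mul_ne_zero hd (pow_ne_zero 2 hl0)))
    (Nat.lcm_dvd_mul d _)

end Literature.NumberTheory.Sieve.FriedlanderIwaniecPrimesSquarefree

/-! ## Part C: the remainder of the squarefree-supported sequence, pointwise decomposition -/

namespace Literature.NumberTheory.Sieve.FriedlanderIwaniecPrimesSquarefree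

open FriedlanderIwaniecPrimes
open scoped ArithmeticFunction.sigma ArithmeticFunction.Moebius ArithmeticFunction.omega

/-- `A(t) = fiCount t ≥ 0`. [folklore] -/
theorem fiCount_nonneg (t : ℝ) : 0 ≤ fiCount t := Finset.sum_nonneg fun _ _ => Nat.cast_nonneg _

/-- `A_q(t) ≥ 0`. [folklore] -/
theorem congrSum_nonneg (q : ℕ) (t : ℝ) : 0 ≤ fiSieveSeq.congrSum q t :=
  Finset.sum_nonneg fun _ _ => Nat.cast_nonneg _

/-- `A_q` is non-decreasing in `t`. [folklore] -/
theorem congrSum_mono (q : ℕ) {t x : ℝ} (htx : t ≤ x) :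
    fiSieveSeq.congrSum q t ≤ fiSieveSeq.congrSum q x := by
  refine Finset.sum_le_sum_of_subset_of_nonneg (Finset.filter_subset_filter _ ?_)
    fun _ _ _ => Nat.cast_nonneg _
  exact Finset.Ioc_subset_Ioc_right (Nat.floor_mono htx)

/-- `A` is non-decreasing. [folklore] -/
theorem fiCount_mono {t x : ℝ} (htx : t ≤ x) : fiCount t ≤ fiCount x := by
  have h := congrSum_mono 1 htx
  rwa [← fiSieveSeq_size_eq, ← fiSieveSeq_size_eq] at h

/-- **Pointwise decomposition.** For squarefree `d ≤ ⌊x⌋` and `t ≤ x`, with `T = {p ≤ ⌊x⌋}`,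
`P_T = ∏_{p ∈ T} (1 - g(p²))` and a truncation parameter `Λ`:
`|A'_d(t) - g'(d) P_T A(t)| ≤ A(t) Σ_{L ⊆ T, ℓ_L > Λ} g(lcm(d,ℓ_L²))`
`+ Σ_{L ⊆ T, ℓ_L ≤ Λ} |r_{lcm(d,ℓ_L²)}(t)| + Σ_{L ⊆ T, ℓ_L > Λ} A_{lcm(d,ℓ_L²)}(t)`.
[folklore] -/
theorem abs_congrSumSq_sub_main_le {d : ℕ} (hd : Squarefree d) {x t : ℝ} (hdx : d ≤ ⌊x⌋₊)
    (htx : t ≤ x) (Λ : ℕ) :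
    |fiSieveSeqSq.congrSum d t - fiDensitySq d * fiSqProd ⌊x⌋₊ * fiCount t| ≤
      fiCount t * ∑ L ∈ (Nat.primesLE ⌊x⌋₊).powerset with ¬(∏ p ∈ L, p) ≤ Λ,
          fiDensity (Nat.lcm d ((∏ p ∈ L, p) ^ 2)) +
      ∑ L ∈ (Nat.primesLE ⌊x⌋₊).powerset with (∏ p ∈ L, p) ≤ Λ,
          |fiSieveSeq.remainder (Nat.lcm d ((∏ p ∈ L, p) ^ 2)) t| +
      ∑ L ∈ (Nat.primesLE ⌊x⌋₊).powerset with ¬(∏ p ∈ L, p) ≤ Λ,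
          fiSieveSeq.congrSum (Nat.lcm d ((∏ p ∈ L, p) ^ 2)) t := by
  set X := ⌊x⌋₊ with hX
  set T := Nat.primesLE X with hT
  have hTp : ∀ p ∈ T, p.Prime := fun p hp => Nat.prime_of_mem_primesLE hp
  have hdT : d.primeFactors ⊆ T := fun p hp => by
    rw [hT, Nat.mem_primesLE]
    exact ⟨(Nat.le_of_mem_primeFactors hp).trans hdx, Nat.prime_of_mem_primeFactors hp⟩
  set s : Finset ℕ → ℝ := fun L => (-1 : ℝ) ^ #L with hs
  set m : Finset ℕ → ℕ := fun L => Nat.lcm d ((∏ p ∈ L, p) ^ 2) with hm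
  have hs1 : ∀ L, |s L| = 1 := fun L => by simp [hs]
  -- inclusion–exclusion and the split small/big
  have h1 := congrSumSq_eq_sum d (Nat.floor_mono htx : ⌊t⌋₊ ≤ X)
  rw [← Finset.sum_filter_add_sum_filter_not _ (fun L => (∏ p ∈ L, p) ≤ Λ)] at h1
  -- on the small part, `A_m = g(m) A(t) + r_m(t)`
  have hsmall : ∑ L ∈ T.powerset with (∏ p ∈ L, p) ≤ Λ, s L * fiSieveSeq.congrSum (m L) t =
      fiCount t * ∑ L ∈ T.powerset with (∏ p ∈ L, p) ≤ Λ, s L * fiDensity (m L) +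
        ∑ L ∈ T.powerset with (∏ p ∈ L, p) ≤ Λ, s L * fiSieveSeq.remainder (m L) t := by
    rw [Finset.mul_sum, ← Finset.sum_add_distrib]
    refine Finset.sum_congr rfl fun L _ => ?_
    rw [fiSieveSeq_remainder]; ring
  -- the full main sum is `g'(d) P_T`
  have hmain := sum_neg_one_pow_mul_fiDensity_lcm hd hTp hdT
  rw [← Finset.sum_filter_add_sum_filter_not _ (fun L => (∏ p ∈ L, p) ≤ Λ)] at hmain
  have hP : ∏ p ∈ T, (1 - fiDensity (p ^ 2)) = fiSqProd X := rfl
  -- assemble the identity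
  have hid : fiSieveSeqSq.congrSum d t - fiDensitySq d * fiSqProd X * fiCount t =
      -(fiCount t * ∑ L ∈ T.powerset with ¬(∏ p ∈ L, p) ≤ Λ, s L * fiDensity (m L)) +
      ∑ L ∈ T.powerset with (∏ p ∈ L, p) ≤ Λ, s L * fiSieveSeq.remainder (m L) t +
      ∑ L ∈ T.powerset with ¬(∏ p ∈ L, p) ≤ Λ, s L * fiSieveSeq.congrSum (m L) t := by
    rw [h1, hsmall, ← hP, ← hmain]; ring
  rw [hid]
  -- bound each piece by its absolute sum
  have hA := fiCount_nonneg t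
  refine (abs_add_le _ _).trans (add_le_add ((abs_add_le _ _).trans (add_le_add ?_ ?_)) ?_)
  · rw [abs_neg, abs_mul, abs_of_nonneg hA]
    refine mul_le_mul_of_nonneg_left ((Finset.abs_sum_le_sum_abs _ _).trans
      (Finset.sum_le_sum fun L hL => ?_)) hA
    rw [abs_mul, hs1, one_mul, abs_of_nonneg]
    -- `g ≥ 0` on cubefree moduli of this form
    have hLp : ∀ p ∈ L, p.Prime := fun p hp => hTp p (Finset.mem_powerset.mp (Finset.mem_filter.mp hL).1 hp)
    rw [fiDensity_lcm_sq hd hLp]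
    exact mul_nonneg (Finset.prod_nonneg fun p hp =>
        (fiDensity_hyp24 (Nat.prime_of_mem_primeFactors (Finset.mem_sdiff.mp hp).1)).1.trans
          (fiDensity_hyp24 (Nat.prime_of_mem_primeFactors (Finset.mem_sdiff.mp hp).1)).2.1)
      (Finset.prod_nonneg fun p hp => (fiDensity_hyp24 (hLp p hp)).1)
  · refine (Finset.abs_sum_le_sum_abs _ _).trans (Finset.sum_le_sum fun L _ => ?_)
    rw [abs_mul, hs1, one_mul]
  · refine (Finset.abs_sum_le_sum_abs _ _).trans (Finset.sum_le_sum fun L _ => ?_)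
    rw [abs_mul, hs1, one_mul, abs_of_nonneg (congrSum_nonneg _ _)]

/-- **Pointwise bound for `r'_d(t)`** (`d` squarefree, `d ≤ ⌊x⌋`, `t ≤ x`): with the three error
functionals `TG_d = Σ_{ℓ_L > Λ} g(lcm(d,ℓ_L²))`, `RS_d(t) = Σ_{ℓ_L ≤ Λ} |r_{lcm(d,ℓ_L²)}(t)|`,
`ES_d(t) = Σ_{ℓ_L > Λ} A_{lcm(d,ℓ_L²)}(t)`,
`|r'_d(t)| ≤ (A(t) TG_d + RS_d(t) + ES_d(t)) + g'(d) (A(t) TG_1 + RS_1(t) + ES_1(t))`. [folklore] -/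
theorem abs_remainderSq_le {d : ℕ} (hd : Squarefree d) {x t : ℝ} (hdx : d ≤ ⌊x⌋₊) (hx : 1 ≤ x)
    (htx : t ≤ x) (Λ : ℕ) :
    |fiSieveSeqSq.remainder d t| ≤
      (fiCount t * ∑ L ∈ (Nat.primesLE ⌊x⌋₊).powerset with ¬(∏ p ∈ L, p) ≤ Λ,
          fiDensity (Nat.lcm d ((∏ p ∈ L, p) ^ 2)) +
        ∑ L ∈ (Nat.primesLE ⌊x⌋₊).powerset with (∏ p ∈ L, p) ≤ Λ,
          |fiSieveSeq.remainder (Nat.lcm d ((∏ p ∈ L, p) ^ 2)) t| +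
        ∑ L ∈ (Nat.primesLE ⌊x⌋₊).powerset with ¬(∏ p ∈ L, p) ≤ Λ,
          fiSieveSeq.congrSum (Nat.lcm d ((∏ p ∈ L, p) ^ 2)) t) +
      fiDensitySq d *
        (fiCount t * ∑ L ∈ (Nat.primesLE ⌊x⌋₊).powerset with ¬(∏ p ∈ L, p) ≤ Λ,
            fiDensity (Nat.lcm 1 ((∏ p ∈ L, p) ^ 2)) +
          ∑ L ∈ (Nat.primesLE ⌊x⌋₊).powerset with (∏ p ∈ L, p) ≤ Λ,
            |fiSieveSeq.remainder (Nat.lcm 1 ((∏ p ∈ L, p) ^ 2)) t| +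
          ∑ L ∈ (Nat.primesLE ⌊x⌋₊).powerset with ¬(∏ p ∈ L, p) ≤ Λ,
            fiSieveSeq.congrSum (Nat.lcm 1 ((∏ p ∈ L, p) ^ 2)) t) := by
  have h1x : 1 ≤ ⌊x⌋₊ := Nat.le_floor (by simpa using hx)
  have hd' := abs_congrSumSq_sub_main_le hd hdx htx Λ
  have h1' := abs_congrSumSq_sub_main_le squarefree_one h1x htx Λ
  rw [isMultiplicative_fiDensitySq.map_one, one_mul] at h1'
  have hsize : fiSieveSeqSq.size t = fiSieveSeqSq.congrSum 1 t := fiSieveSeqSq_size_eq t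
  have hid : fiSieveSeqSq.remainder d t =
      (fiSieveSeqSq.congrSum d t - fiDensitySq d * fiSqProd ⌊x⌋₊ * fiCount t) -
        fiDensitySq d * (fiSieveSeqSq.congrSum 1 t - fiSqProd ⌊x⌋₊ * fiCount t) := by
    rw [SieveSequence.remainder, hsize]
    change _ - fiDensitySq d * _ = _
    ring
  rw [hid]
  refine (abs_sub _ _).trans (add_le_add hd' ?_)
  rw [abs_mul, abs_of_nonneg (fiDensitySq_nonneg d)]
  exact mul_le_mul_of_nonneg_left h1' (fiDensitySq_nonneg d)

/-! ### The density tail `TG`: Rankin's trick -/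

/-- For squarefree `d` and primes `L`: `g(lcm(d, ℓ_L²)) = g(∏_{p ∣ d, p ∉ L} p) · ∏_{p ∈ L} g(p²)`,
with `∏_{p ∣ d, p ∉ L} p` a squarefree divisor of `d`. [folklore] -/
theorem fiDensity_lcm_sq' {d : ℕ} (hd : Squarefree d) {L : Finset ℕ} (hL : ∀ p ∈ L, p.Prime) :
    fiDensity (Nat.lcm d ((∏ p ∈ L, p) ^ 2)) =
      fiDensity (∏ p ∈ d.primeFactors \ L, p) * ∏ p ∈ L, fiDensity (p ^ 2) := by
  rw [fiDensity_lcm_sq hd hL, isMultiplicative_fiDensity.map_prod_of_prime _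
    (fun p hp => Nat.prime_of_mem_primeFactors (Finset.mem_sdiff.mp hp).1)]

/-- `0 ≤ ∏_{p ∈ L} g(p²)`. [folklore] -/
theorem prod_fiDensity_sq_nonneg {L : Finset ℕ} (hL : ∀ p ∈ L, p.Prime) :
    0 ≤ ∏ p ∈ L, fiDensity (p ^ 2) :=
  Finset.prod_nonneg fun p hp => (fiDensity_hyp24 (hL p hp)).1

/-- `0 ≤ g(d)` for squarefree `d`. [folklore] -/
theorem fiDensity_squarefree_nonneg {d : ℕ} (hd : Squarefree d) : 0 ≤ fiDensity d := by
  rw [← isMultiplicative_fiDensity.prod_primeFactors hd]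
  exact Finset.prod_nonneg fun p hp =>
    (fiDensity_hyp24 (Nat.prime_of_mem_primeFactors hp)).1.trans
      (fiDensity_hyp24 (Nat.prime_of_mem_primeFactors hp)).2.1

/-- **Summing the density tail over `d`**: for a fixed set of primes `L` and the squarefree
`d ≤ D₀`, `Σ_d g(lcm(d, ℓ_L²)) ≤ 2^{|L|} (∏_{p ∈ L} g(p²)) Σ_{d' ≤ D₀ sqfree} g(d')`
(`d ↦ (d / (d, ℓ_L), d ∩ L)` is injective). [folklore] -/
theorem sum_fiDensity_lcm_sq_le (D₀ : ℕ) {L : Finset ℕ} (hL : ∀ p ∈ L, p.Prime) :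
    ∑ d ∈ (Icc 1 D₀).filter Squarefree, fiDensity (Nat.lcm d ((∏ p ∈ L, p) ^ 2)) ≤
      2 ^ #L * (∏ p ∈ L, fiDensity (p ^ 2)) *
        ∑ d ∈ (Icc 1 D₀).filter Squarefree, fiDensity d := by
  set 𝒟 := (Icc 1 D₀).filter Squarefree with h𝒟
  set ψ : ℕ → ℕ × Finset ℕ := fun d => (∏ p ∈ d.primeFactors \ L, p, d.primeFactors ∩ L) with hψ
  set G : ℕ × Finset ℕ → ℝ := fun y => fiDensity y.1 * ∏ p ∈ L, fiDensity (p ^ 2) with hG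
  have hsq : ∀ d ∈ 𝒟, Squarefree d := fun d hd => (Finset.mem_filter.mp hd).2
  -- rewrite the summand through `ψ`
  have h1 : ∑ d ∈ 𝒟, fiDensity (Nat.lcm d ((∏ p ∈ L, p) ^ 2)) = ∑ d ∈ 𝒟, G (ψ d) := by
    refine Finset.sum_congr rfl fun d hd => ?_
    rw [fiDensity_lcm_sq' (hsq d hd) hL]
  -- `ψ` is injective on `𝒟`
  have hinj : Set.InjOn ψ 𝒟 := by
    intro d hd d' hd' h
    simp only [hψ, Prod.mk.injEq] at h
    obtain ⟨h1, h2⟩ := h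
    have hpf : d.primeFactors = d'.primeFactors := by
      have e1 : d.primeFactors = (d.primeFactors \ L) ∪ (d.primeFactors ∩ L) :=
        (Finset.sdiff_union_inter _ _).symm
      have e2 : d'.primeFactors = (d'.primeFactors \ L) ∪ (d'.primeFactors ∩ L) :=
        (Finset.sdiff_union_inter _ _).symm
      have e3 : d.primeFactors \ L = d'.primeFactors \ L := by
        have := congrArg Nat.primeFactors h1
        rwa [Nat.primeFactors_prod (fun p hp => Nat.prime_of_mem_primeFactors (Finset.mem_sdiff.mp hp).1),
          Nat.primeFactors_prod (fun p hp => Nat.prime_of_mem_primeFactors (Finset.mem_sdiff.mp hp).1)]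
          at this
      rw [e1, e2, e3, h2]
    rw [← Nat.prod_primeFactors_of_squarefree (hsq d hd),
      ← Nat.prod_primeFactors_of_squarefree (hsq d' hd'), hpf]
  -- the image lies in `𝒟 × powerset L`
  have himg : 𝒟.image ψ ⊆ 𝒟 ×ˢ L.powerset := by
    intro y hy
    obtain ⟨d, hd, rfl⟩ := Finset.mem_image.mp hy
    have hdsq := hsq d hd
    have hd1 := (Finset.mem_Icc.mp (Finset.mem_filter.mp hd).1)
    simp only [hψ, Finset.mem_product, Finset.mem_powerset, Finset.inter_subset_right, and_true]
    refine Finset.mem_filter.mpr ⟨Finset.mem_Icc.mpr ⟨?_, ?_⟩, ?_⟩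
    · exact Finset.prod_pos fun p hp => (Nat.prime_of_mem_primeFactors (Finset.mem_sdiff.mp hp).1).pos
    · refine le_trans (Nat.le_of_dvd (by omega) ?_) hd1.2
      calc ∏ p ∈ d.primeFactors \ L, p ∣ ∏ p ∈ d.primeFactors, p :=
            Finset.prod_dvd_prod_of_subset _ _ _ Finset.sdiff_subset
        _ = d := Nat.prod_primeFactors_of_squarefree hdsq
    · exact squarefree_prod_of_primes fun p hp => Nat.prime_of_mem_primeFactors (Finset.mem_sdiff.mp hp).1
  have hGnn : ∀ y ∈ 𝒟 ×ˢ L.powerset, 0 ≤ G y := by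
    intro y hy
    have hy1 := (Finset.mem_product.mp hy).1
    exact mul_nonneg (fiDensity_squarefree_nonneg (hsq _ hy1)) (prod_fiDensity_sq_nonneg hL)
  rw [h1, ← Finset.sum_image hinj]
  refine (Finset.sum_le_sum_of_subset_of_nonneg himg fun y hy _ => hGnn y hy).trans ?_
  rw [Finset.sum_product, Finset.sum_comm]
  simp only [hG, Finset.sum_const, Finset.card_powerset, nsmul_eq_mul, Finset.mul_sum]
  refine le_of_eq (Finset.sum_congr rfl fun d _ => ?_)
  push_cast; ring

/-- The constant `C₀ = Σ_n n^{-3/2}` of Rankin's trick. [folklore] -/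
theorem summable_rpow_neg_three_halves : Summable (fun n : ℕ => (n : ℝ) ^ (-(3 / 2 : ℝ))) :=
  Real.summable_nat_rpow.mpr (by norm_num)

/-- `2 √p g(p²) ≤ 6 p^{-3/2}`. [folklore] -/
theorem two_sqrt_mul_fiDensity_sq_le {p : ℕ} (hp : p.Prime) :
    2 * Real.sqrt p * fiDensity (p ^ 2) ≤ 6 * (p : ℝ) ^ (-(3 / 2 : ℝ)) := by
  have hp0 : (0 : ℝ) < p := by exact_mod_cast hp.pos
  have h := (fiDensity_hyp2526 hp).2
  calc 2 * Real.sqrt p * fiDensity (p ^ 2) ≤ 2 * Real.sqrt p * (3 / (p : ℝ) ^ 2) := by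
        gcongr
    _ = 6 * (p : ℝ) ^ (-(3 / 2 : ℝ)) := by
        rw [Real.sqrt_eq_rpow, show (-(3 / 2 : ℝ)) = 1 / 2 - 2 by norm_num,
          Real.rpow_sub hp0, Real.rpow_two]
        ring

/-- **Rankin's trick for the density tail**:
`Σ_{L ⊆ T, ℓ_L > Λ} 2^{|L|} ∏_{p∈L} g(p²) ≤ Λ^{-1/2} ∏_{p ∈ T} (1 + 2√p g(p²)) ≤ exp(6 C₀) Λ^{-1/2}`
for any finite set of primes `T` and `Λ ≥ 1`. [folklore] -/
theorem sum_big_two_pow_mul_prod_le {T : Finset ℕ} (hT : ∀ p ∈ T, p.Prime) {Λ : ℕ} (hΛ : 1 ≤ Λ) :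
    ∑ L ∈ T.powerset with ¬(∏ p ∈ L, p) ≤ Λ, (2 : ℝ) ^ #L * ∏ p ∈ L, fiDensity (p ^ 2) ≤
      Real.exp (6 * ∑' n : ℕ, (n : ℝ) ^ (-(3 / 2 : ℝ))) / Real.sqrt Λ := by
  have hΛ0 : (0 : ℝ) < Λ := by exact_mod_cast hΛ
  have hsΛ : 0 < Real.sqrt Λ := Real.sqrt_pos.mpr hΛ0
  -- Rankin: insert the factor `√ℓ_L / √Λ ≥ 1`
  have h1 : ∑ L ∈ T.powerset with ¬(∏ p ∈ L, p) ≤ Λ, (2 : ℝ) ^ #L * ∏ p ∈ L, fiDensity (p ^ 2) ≤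
      ∑ L ∈ T.powerset with ¬(∏ p ∈ L, p) ≤ Λ,
        (∏ p ∈ L, (2 * Real.sqrt p * fiDensity (p ^ 2))) / Real.sqrt Λ := by
    refine Finset.sum_le_sum fun L hL => ?_
    have hL' := Finset.mem_filter.mp hL
    have hLp : ∀ p ∈ L, p.Prime := fun p hp => hT p (Finset.mem_powerset.mp hL'.1 hp)
    have hbig : (Λ : ℝ) ≤ (∏ p ∈ L, p : ℕ) := by exact_mod_cast (not_le.mp hL'.2).le
    have hprod : ∏ p ∈ L, (2 * Real.sqrt p * fiDensity (p ^ 2)) =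
        (2 : ℝ) ^ #L * (∏ p ∈ L, fiDensity (p ^ 2)) * Real.sqrt (∏ p ∈ L, p : ℕ) := by
      rw [Nat.cast_prod, Real.sqrt_prod _ (fun p _ => Nat.cast_nonneg p), Finset.prod_mul_distrib,
        Finset.prod_mul_distrib, Finset.prod_const]
      ring
    rw [hprod, le_div_iff₀ hsΛ]
    have hnn : 0 ≤ (2 : ℝ) ^ #L * ∏ p ∈ L, fiDensity (p ^ 2) :=
      mul_nonneg (by positivity) (prod_fiDensity_sq_nonneg hLp)
    exact mul_le_mul_of_nonneg_left (Real.sqrt_le_sqrt hbig) hnn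
  refine h1.trans ?_
  rw [← Finset.sum_div]
  refine div_le_div_of_nonneg_right ?_ hsΛ.le
  -- extend to all subsets and use `∏ (1 + u_p) = Σ_L ∏_{L} u_p`
  have hnn : ∀ L ∈ T.powerset, 0 ≤ ∏ p ∈ L, (2 * Real.sqrt p * fiDensity (p ^ 2)) := by
    intro L hL
    exact Finset.prod_nonneg fun p hp =>
      mul_nonneg (by positivity) (fiDensity_hyp24 (hT p (Finset.mem_powerset.mp hL hp))).1
  calc ∑ L ∈ T.powerset with ¬(∏ p ∈ L, p) ≤ Λ, ∏ p ∈ L, (2 * Real.sqrt p * fiDensity (p ^ 2))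
      ≤ ∑ L ∈ T.powerset, ∏ p ∈ L, (2 * Real.sqrt p * fiDensity (p ^ 2)) :=
        Finset.sum_le_sum_of_subset_of_nonneg (Finset.filter_subset _ _) fun L hL _ => hnn L hL
    _ = ∏ p ∈ T, (1 + 2 * Real.sqrt p * fiDensity (p ^ 2)) := (Finset.prod_one_add T).symm
    _ ≤ ∏ p ∈ T, Real.exp (2 * Real.sqrt p * fiDensity (p ^ 2)) := by
        refine Finset.prod_le_prod (fun p hp => ?_) fun p hp => ?_
        · linarith [mul_nonneg (by positivity : (0 : ℝ) ≤ 2 * Real.sqrt p) (fiDensity_hyp24 (hT p hp)).1]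
        · linarith [Real.add_one_le_exp (2 * Real.sqrt p * fiDensity (p ^ 2))]
    _ = Real.exp (∑ p ∈ T, 2 * Real.sqrt p * fiDensity (p ^ 2)) := (Real.exp_sum _ _).symm
    _ ≤ Real.exp (6 * ∑' n : ℕ, (n : ℝ) ^ (-(3 / 2 : ℝ))) := by
        refine Real.exp_le_exp.mpr ?_
        calc ∑ p ∈ T, 2 * Real.sqrt p * fiDensity (p ^ 2) ≤ ∑ p ∈ T, 6 * (p : ℝ) ^ (-(3 / 2 : ℝ)) :=
              Finset.sum_le_sum fun p hp => two_sqrt_mul_fiDensity_sq_le (hT p hp)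
          _ = 6 * ∑ p ∈ T, (p : ℝ) ^ (-(3 / 2 : ℝ)) := (Finset.mul_sum _ _ _).symm
          _ ≤ 6 * ∑' n : ℕ, (n : ℝ) ^ (-(3 / 2 : ℝ)) := by
              gcongr
              exact summable_rpow_neg_three_halves.sum_le_tsum T fun n _ => by positivity

/-- **The density tail summed over `d`**:
`Σ_{d ≤ D₀ sqfree} Σ_{L ⊆ T, ℓ_L > Λ} g(lcm(d, ℓ_L²)) ≤ exp(6 C₀) Λ^{-1/2} Σ_{d ≤ D₀ sqfree} g(d)`.
[folklore] -/
theorem sum_sum_big_fiDensity_lcm_le {T : Finset ℕ} (hT : ∀ p ∈ T, p.Prime) {Λ : ℕ} (hΛ : 1 ≤ Λ)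
    (D₀ : ℕ) :
    ∑ d ∈ (Icc 1 D₀).filter Squarefree, ∑ L ∈ T.powerset with ¬(∏ p ∈ L, p) ≤ Λ,
        fiDensity (Nat.lcm d ((∏ p ∈ L, p) ^ 2)) ≤
      Real.exp (6 * ∑' n : ℕ, (n : ℝ) ^ (-(3 / 2 : ℝ))) / Real.sqrt Λ *
        ∑ d ∈ (Icc 1 D₀).filter Squarefree, fiDensity d := by
  rw [Finset.sum_comm]
  have hG : 0 ≤ ∑ d ∈ (Icc 1 D₀).filter Squarefree, fiDensity d :=
    Finset.sum_nonneg fun d hd => fiDensity_squarefree_nonneg (Finset.mem_filter.mp hd).2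
  calc ∑ L ∈ T.powerset with ¬(∏ p ∈ L, p) ≤ Λ, ∑ d ∈ (Icc 1 D₀).filter Squarefree,
        fiDensity (Nat.lcm d ((∏ p ∈ L, p) ^ 2))
      ≤ ∑ L ∈ T.powerset with ¬(∏ p ∈ L, p) ≤ Λ, (2 ^ #L * (∏ p ∈ L, fiDensity (p ^ 2)) *
          ∑ d ∈ (Icc 1 D₀).filter Squarefree, fiDensity d) :=
        Finset.sum_le_sum fun L hL => sum_fiDensity_lcm_sq_le D₀
          fun p hp => hT p (Finset.mem_powerset.mp (Finset.mem_filter.mp hL).1 hp)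
    _ = (∑ L ∈ T.powerset with ¬(∏ p ∈ L, p) ≤ Λ, (2 : ℝ) ^ #L * ∏ p ∈ L, fiDensity (p ^ 2)) *
          ∑ d ∈ (Icc 1 D₀).filter Squarefree, fiDensity d := by rw [Finset.sum_mul]
    _ ≤ _ := mul_le_mul_of_nonneg_right (sum_big_two_pow_mul_prod_le hT hΛ) hG

end Literature.NumberTheory.Sieve.FriedlanderIwaniecPrimesSquarefree

/-! ## Part D: the remainder part `RS` and the large-square-divisor part `ES` -/

namespace Literature.NumberTheory.Sieve.FriedlanderIwaniecPrimesSquarefree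

open FriedlanderIwaniecPrimes
open scoped ArithmeticFunction.sigma ArithmeticFunction.Moebius ArithmeticFunction.omega

/-! ### `RS`: regrouping by the modulus `lcm(d, ℓ²)` -/

/-- The fibres of `(d, L) ↦ lcm(d, ℓ_L²)`: if `lcm(d, ℓ_L²) = b ≠ 0` then `d ∣ b` and
`L ⊆ primeFactors b`. [folklore] -/
theorem mem_divisors_prod_of_lcm_eq {d b : ℕ} {L : Finset ℕ} (hL : ∀ p ∈ L, p.Prime) (hb : b ≠ 0)
    (h : Nat.lcm d ((∏ p ∈ L, p) ^ 2) = b) : (d, L) ∈ b.divisors ×ˢ b.primeFactors.powerset := by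
  rw [Finset.mem_product, Nat.mem_divisors, Finset.mem_powerset]
  refine ⟨⟨h ▸ Nat.dvd_lcm_left _ _, hb⟩, fun p hp => ?_⟩
  rw [Nat.mem_primeFactors]
  refine ⟨hL p hp, ?_, hb⟩
  rw [← h]
  exact (Finset.dvd_prod_of_mem _ hp).trans ((dvd_pow_self _ two_ne_zero).trans (Nat.dvd_lcm_right _ _))

/-- `τ(b) · 2^{ω(b)} ≤ τ(b)²`. [folklore] -/
theorem card_divisors_mul_two_pow_le (b : ℕ) (hb : b ≠ 0) :
    ((#(b.divisors ×ˢ b.primeFactors.powerset) : ℕ) : ℝ) ≤ (σ 0 b : ℝ) ^ 2 := by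
  rw [Finset.card_product, Finset.card_powerset, Nat.cast_mul, sq, ← ArithmeticFunction.sigma_zero_apply]
  push_cast
  exact mul_le_mul_of_nonneg_left (two_pow_card_primeFactors_le_sigma b hb) (Nat.cast_nonneg _)

/-- **The `RS` part summed over `d`**: for `D₀ Λ² ≤ M` and a bound `τ(b) ≤ τB` on `b ≤ M`,
`Σ_{d ≤ D₀ sqfree} Σ_{L ⊆ T, ℓ_L ≤ Λ} |r_{lcm(d,ℓ_L²)}(t)| ≤ τB² Σ_{b ≤ M cubefree} |r_b(t)|`
(each cubefree `b` arises from at most `τ(b) 2^{ω(b)} ≤ τ(b)²` pairs). [folklore] -/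
theorem sum_sum_small_abs_remainder_le {T : Finset ℕ} (hT : ∀ p ∈ T, p.Prime) (t : ℝ)
    {D₀ Λ M : ℕ} (hM : D₀ * Λ ^ 2 ≤ M) {τB : ℝ} (hτB0 : 0 ≤ τB)
    (hτB : ∀ b : ℕ, 1 ≤ b → b ≤ M → (σ 0 b : ℝ) ≤ τB) :
    ∑ d ∈ (Icc 1 D₀).filter Squarefree, ∑ L ∈ T.powerset with (∏ p ∈ L, p) ≤ Λ,
        |fiSieveSeq.remainder (Nat.lcm d ((∏ p ∈ L, p) ^ 2)) t| ≤
      τB ^ 2 * ∑ b ∈ (Icc 1 M).filter IsCubefree, |fiSieveSeq.remainder b t| := by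
  set 𝒟 := (Icc 1 D₀).filter Squarefree with h𝒟
  set P := T.powerset.filter (fun L => (∏ p ∈ L, p) ≤ Λ) with hP
  set m : ℕ × Finset ℕ → ℕ := fun q => Nat.lcm q.1 ((∏ p ∈ q.2, p) ^ 2) with hm
  set f : ℕ → ℝ := fun b => |fiSieveSeq.remainder b t| with hf
  have hf0 : ∀ b, 0 ≤ f b := fun b => abs_nonneg _
  rw [← Finset.sum_product (s := 𝒟) (t := P) (f := fun q => f (m q))]
  rw [Finset.sum_comp f m]
  -- properties of a pair `q ∈ 𝒟 × P`
  have hq : ∀ q ∈ 𝒟 ×ˢ P, Squarefree q.1 ∧ 1 ≤ q.1 ∧ q.1 ≤ D₀ ∧ (∀ p ∈ q.2, p.Prime) ∧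
      (∏ p ∈ q.2, p) ≤ Λ := by
    intro q hq
    obtain ⟨h1, h2⟩ := Finset.mem_product.mp hq
    have h1' := Finset.mem_filter.mp h1
    have h2' := Finset.mem_filter.mp h2
    exact ⟨h1'.2, (Finset.mem_Icc.mp h1'.1).1, (Finset.mem_Icc.mp h1'.1).2,
      fun p hp => hT p (Finset.mem_powerset.mp h2'.1 hp), h2'.2⟩
  have himg : (𝒟 ×ˢ P).image m ⊆ (Icc 1 M).filter IsCubefree := by
    intro b hb
    obtain ⟨q, hq', rfl⟩ := Finset.mem_image.mp hb
    obtain ⟨hsq, h1, hD, hLp, hΛ⟩ := hq q hq'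
    have hb := lcm_sq_pos_le (by omega : q.1 ≠ 0) hLp
    refine Finset.mem_filter.mpr ⟨Finset.mem_Icc.mpr ⟨hb.1, hb.2.trans ?_⟩, isCubefree_lcm_sq hsq hLp⟩
    calc q.1 * (∏ p ∈ q.2, p) ^ 2 ≤ D₀ * Λ ^ 2 := Nat.mul_le_mul hD (Nat.pow_le_pow_left hΛ 2)
      _ ≤ M := hM
  -- fibre bound
  have hfib : ∀ b ∈ (𝒟 ×ˢ P).image m, ((#{q ∈ 𝒟 ×ˢ P | m q = b} : ℕ) : ℝ) ≤ τB ^ 2 := by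
    intro b hb
    have hb' := Finset.mem_filter.mp (himg hb)
    have hb1 := (Finset.mem_Icc.mp hb'.1)
    have hb0 : b ≠ 0 := by omega
    have hsub : {q ∈ 𝒟 ×ˢ P | m q = b} ⊆ b.divisors ×ˢ b.primeFactors.powerset := by
      intro q hq''
      have hq1 := Finset.mem_filter.mp hq''
      obtain ⟨-, -, -, hLp, -⟩ := hq q hq1.1
      exact mem_divisors_prod_of_lcm_eq hLp hb0 hq1.2
    calc ((#{q ∈ 𝒟 ×ˢ P | m q = b} : ℕ) : ℝ) ≤ ((#(b.divisors ×ˢ b.primeFactors.powerset) : ℕ) : ℝ) := by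
          exact_mod_cast Finset.card_le_card hsub
      _ ≤ (σ 0 b : ℝ) ^ 2 := card_divisors_mul_two_pow_le b hb0
      _ ≤ τB ^ 2 := by
          have := hτB b hb1.1 hb1.2
          have h0 : (0 : ℝ) ≤ (σ 0 b : ℝ) := Nat.cast_nonneg _
          nlinarith
  calc ∑ b ∈ (𝒟 ×ˢ P).image m, #{q ∈ 𝒟 ×ˢ P | m q = b} • f b
      ≤ ∑ b ∈ (𝒟 ×ˢ P).image m, τB ^ 2 * f b := by
        refine Finset.sum_le_sum fun b hb => ?_
        rw [nsmul_eq_mul]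
        exact mul_le_mul_of_nonneg_right (hfib b hb) (hf0 b)
    _ ≤ ∑ b ∈ (Icc 1 M).filter IsCubefree, τB ^ 2 * f b :=
        Finset.sum_le_sum_of_subset_of_nonneg himg fun b _ _ => mul_nonneg (sq_nonneg _) (hf0 b)
    _ = τB ^ 2 * ∑ b ∈ (Icc 1 M).filter IsCubefree, |fiSieveSeq.remainder b t| := by
        rw [← Finset.mul_sum]

/-! ### `ES`: moduli with a large square divisor -/

/-- `A_q(t) = 0` for `q > ⌊t⌋`. [folklore] -/
theorem congrSum_eq_zero_of_lt {q : ℕ} {t : ℝ} (h : ⌊t⌋₊ < q) : fiSieveSeq.congrSum q t = 0 := by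
  refine Finset.sum_eq_zero fun n hn => ?_
  exfalso
  have hn' := Finset.mem_filter.mp hn
  have h1 := Finset.mem_Ioc.mp hn'.1
  exact absurd (Nat.le_of_dvd h1.1 hn'.2) (by omega)

/-- The number of `d ∈ 𝒟` with `d ∣ n` is at most `τ(n)` (`n ≥ 1`). [folklore] -/
theorem card_filter_dvd_le_sigma (𝒟 : Finset ℕ) {n : ℕ} (hn : n ≠ 0) :
    #{d ∈ 𝒟 | d ∣ n} ≤ σ 0 n := by
  rw [ArithmeticFunction.sigma_zero_apply]
  refine Finset.card_le_card_of_injOn id (fun d hd => ?_) (Set.injOn_id _)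
  exact Nat.mem_divisors.mpr ⟨(Finset.mem_filter.mp hd).2, hn⟩

/-- **`ES`, first step**: for a set of primes `L`,
`Σ_{d ∈ 𝒟} A_{lcm(d, ℓ_L²)}(t) ≤ τB · A_{ℓ_L²}(t)` when `τ(n) ≤ τB` for `n ≤ ⌊t⌋`. [folklore] -/
theorem sum_congrSum_lcm_le (𝒟 : Finset ℕ) (L : Finset ℕ) (t : ℝ)
    {τB : ℝ} (hτB : ∀ n : ℕ, 1 ≤ n → n ≤ ⌊t⌋₊ → (σ 0 n : ℝ) ≤ τB) :
    ∑ d ∈ 𝒟, fiSieveSeq.congrSum (Nat.lcm d ((∏ p ∈ L, p) ^ 2)) t ≤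
      τB * fiSieveSeq.congrSum ((∏ p ∈ L, p) ^ 2) t := by
  simp only [SieveSequence.congrSum, Finset.sum_filter]
  rw [Finset.sum_comm, Finset.mul_sum]
  refine Finset.sum_le_sum fun n hn => ?_
  have hn1 := Finset.mem_Ioc.mp hn
  have hn0 : n ≠ 0 := by omega
  have ha : (0 : ℝ) ≤ fiSieveSeq.a n := Nat.cast_nonneg _
  by_cases hl : (∏ p ∈ L, p) ^ 2 ∣ n
  · rw [if_pos hl]
    -- `Σ_d [lcm ∣ n] a_n ≤ a_n #{d ∈ 𝒟 : d ∣ n} ≤ τB a_n`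
    calc ∑ d ∈ 𝒟, (if Nat.lcm d ((∏ p ∈ L, p) ^ 2) ∣ n then fiSieveSeq.a n else 0)
        ≤ ∑ d ∈ 𝒟, (if d ∣ n then fiSieveSeq.a n else 0) := by
          refine Finset.sum_le_sum fun d _ => ?_
          by_cases h1 : Nat.lcm d ((∏ p ∈ L, p) ^ 2) ∣ n
          · rw [if_pos h1, if_pos ((Nat.dvd_lcm_left _ _).trans h1)]
          · rw [if_neg h1]; split_ifs <;> simp [ha]
      _ = #{d ∈ 𝒟 | d ∣ n} * fiSieveSeq.a n := by
          rw [← Finset.sum_filter, Finset.sum_const, nsmul_eq_mul]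
      _ ≤ τB * fiSieveSeq.a n := by
          refine mul_le_mul_of_nonneg_right ?_ ha
          calc ((#{d ∈ 𝒟 | d ∣ n} : ℕ) : ℝ) ≤ (σ 0 n : ℝ) := by
                exact_mod_cast card_filter_dvd_le_sigma 𝒟 hn0
            _ ≤ τB := hτB n hn1.1 hn1.2
  · rw [if_neg hl, mul_zero]
    refine (Finset.sum_eq_zero fun d _ => ?_).le
    rw [if_neg (fun h => hl ((Nat.dvd_lcm_right _ _).trans h))]

/-- **`ES`, second step**: only `Λ < ℓ_L ≤ √⌊x⌋` contribute, and `L ↦ ℓ_L` is injective: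
`Σ_{L ⊆ T, ℓ_L > Λ} A_{ℓ_L²}(x) ≤ Σ_{Λ < ℓ ≤ √⌊x⌋, ℓ sqfree} A_{ℓ²}(x)`. [folklore] -/
theorem sum_big_congrSum_sq_le {T : Finset ℕ} (hT : ∀ p ∈ T, p.Prime) (Λ : ℕ) (x : ℝ) :
    ∑ L ∈ T.powerset with ¬(∏ p ∈ L, p) ≤ Λ, fiSieveSeq.congrSum ((∏ p ∈ L, p) ^ 2) x ≤
      ∑ l ∈ (Ioc Λ (Nat.sqrt ⌊x⌋₊)).filter Squarefree, fiSieveSeq.congrSum (l ^ 2) x := by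
  set X := ⌊x⌋₊ with hX
  set P := T.powerset.filter (fun L => ¬(∏ p ∈ L, p) ≤ Λ) with hP
  -- drop the `L` with `ℓ_L² > X`
  rw [← Finset.sum_filter_add_sum_filter_not P (fun L => (∏ p ∈ L, p) ^ 2 ≤ X)]
  have hzero : ∑ L ∈ P with ¬(∏ p ∈ L, p) ^ 2 ≤ X, fiSieveSeq.congrSum ((∏ p ∈ L, p) ^ 2) x = 0 :=
    Finset.sum_eq_zero fun L hL => congrSum_eq_zero_of_lt (not_le.mp (Finset.mem_filter.mp hL).2)
  rw [hzero, add_zero]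
  -- reindex by `ℓ = ∏ L`
  have hinj : Set.InjOn (fun L : Finset ℕ => ∏ p ∈ L, p) ↑(P.filter fun L => (∏ p ∈ L, p) ^ 2 ≤ X) := by
    intro L hL L' hL' h
    have hLp : ∀ p ∈ L, p.Prime := fun p hp =>
      hT p (Finset.mem_powerset.mp (Finset.mem_filter.mp (Finset.mem_filter.mp hL).1).1 hp)
    have hLp' : ∀ p ∈ L', p.Prime := fun p hp =>
      hT p (Finset.mem_powerset.mp (Finset.mem_filter.mp (Finset.mem_filter.mp hL').1).1 hp)
    have := congrArg Nat.primeFactors h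
    simp only at this
    rwa [Nat.primeFactors_prod hLp, Nat.primeFactors_prod hLp'] at this
  rw [← Finset.sum_image (f := fun l => fiSieveSeq.congrSum (l ^ 2) x)
    (g := fun L : Finset ℕ => ∏ p ∈ L, p) hinj]
  refine Finset.sum_le_sum_of_subset_of_nonneg ?_ fun l _ _ => congrSum_nonneg _ _
  intro l hl
  obtain ⟨L, hL, rfl⟩ := Finset.mem_image.mp hl
  have hL1 := Finset.mem_filter.mp hL
  have hL2 := Finset.mem_filter.mp hL1.1
  have hLp : ∀ p ∈ L, p.Prime := fun p hp => hT p (Finset.mem_powerset.mp hL2.1 hp)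
  refine Finset.mem_filter.mpr ⟨Finset.mem_Ioc.mpr ⟨not_le.mp hL2.2, Nat.le_sqrt'.mpr hL1.2⟩,
    squarefree_prod_of_primes hLp⟩

/-- `g(ℓ²) = ∏_{p ∣ ℓ} g(p²)` for squarefree `ℓ`. [folklore] -/
theorem fiDensity_sq_eq_prod_of_squarefree {l : ℕ} (hl : Squarefree l) :
    fiDensity (l ^ 2) = ∏ p ∈ l.primeFactors, fiDensity (p ^ 2) := by
  conv_lhs => rw [← Nat.prod_primeFactors_of_squarefree hl, ← Finset.prod_pow]
  exact isMultiplicative_fiDensity.map_prod (fun p => p ^ 2) _ fun p hp q hq hpq =>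
    Nat.coprime_pow_primes 2 2 (Nat.prime_of_mem_primeFactors hp) (Nat.prime_of_mem_primeFactors hq) hpq

/-- `0 ≤ g(ℓ²)` for squarefree `ℓ`. [folklore] -/
theorem fiDensity_sq_nonneg_of_squarefree {l : ℕ} (hl : Squarefree l) : 0 ≤ fiDensity (l ^ 2) := by
  rw [fiDensity_sq_eq_prod_of_squarefree hl]
  exact Finset.prod_nonneg fun p hp => (fiDensity_hyp24 (Nat.prime_of_mem_primeFactors hp)).1

/-- `g(ℓ²) ≤ τ(ℓ)² / ℓ²` for squarefree `ℓ` (as `g(p²) ≤ 3/p² ≤ 4/p²`). [folklore] -/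
theorem fiDensity_sq_le_of_squarefree {l : ℕ} (hl : Squarefree l) :
    fiDensity (l ^ 2) ≤ (σ 0 l : ℝ) ^ 2 / (l : ℝ) ^ 2 := by
  have hl0 := hl.ne_zero
  rw [fiDensity_sq_eq_prod_of_squarefree hl]
  have h2 : ∏ p ∈ l.primeFactors, fiDensity (p ^ 2) ≤ ∏ p ∈ l.primeFactors, (4 / (p : ℝ) ^ 2) :=
    Finset.prod_le_prod (fun p hp => (fiDensity_hyp24 (Nat.prime_of_mem_primeFactors hp)).1)
      fun p hp => ((fiDensity_hyp2526 (Nat.prime_of_mem_primeFactors hp)).2).trans (by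
        gcongr; norm_num)
  refine h2.trans ?_
  rw [Finset.prod_div_distrib, Finset.prod_const, Finset.prod_pow, ← Nat.cast_prod,
    Nat.prod_primeFactors_of_squarefree hl]
  gcongr
  rw [show (4 : ℝ) = 2 ^ 2 by norm_num, ← pow_mul, mul_comm, pow_mul]
  gcongr
  exact two_pow_card_primeFactors_le_sigma l hl0

/-- **`ES`, middle range** `Λ < ℓ ≤ Λ₁`: `A_{ℓ²}(x) = g(ℓ²) A(x) + r_{ℓ²}(x)` gives
`Σ_{Λ<ℓ≤Λ₁ sqfree} A_{ℓ²}(x) ≤ A(x) τB²/Λ + Σ_{b ≤ Λ₁² cubefree} |r_b(x)|`. [folklore] -/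
theorem sum_mid_congrSum_sq_le (x : ℝ) {Λ Λ₁ : ℕ} (hΛ : 1 ≤ Λ) {τB : ℝ}
    (hτB : ∀ l : ℕ, 1 ≤ l → l ≤ Λ₁ → (σ 0 l : ℝ) ≤ τB) :
    ∑ l ∈ (Ioc Λ Λ₁).filter Squarefree, fiSieveSeq.congrSum (l ^ 2) x ≤
      fiCount x * (τB ^ 2 / Λ) + ∑ b ∈ (Icc 1 (Λ₁ ^ 2)).filter IsCubefree, |fiSieveSeq.remainder b x| := by
  have hA := fiCount_nonneg x
  have hstep : ∀ l ∈ (Ioc Λ Λ₁).filter Squarefree, fiSieveSeq.congrSum (l ^ 2) x ≤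
      fiCount x * (τB ^ 2 * ((l : ℝ) ^ 2)⁻¹) + |fiSieveSeq.remainder (l ^ 2) x| := by
    intro l hl
    have hl' := Finset.mem_filter.mp hl
    have hl1 := Finset.mem_Ioc.mp hl'.1
    have hr : fiSieveSeq.congrSum (l ^ 2) x = fiDensity (l ^ 2) * fiCount x + fiSieveSeq.remainder (l ^ 2) x := by
      rw [fiSieveSeq_remainder]; ring
    rw [hr]
    refine add_le_add ?_ (le_abs_self _)
    rw [mul_comm]
    refine mul_le_mul_of_nonneg_left ((fiDensity_sq_le_of_squarefree hl'.2).trans ?_) hA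
    rw [div_eq_mul_inv]
    have hσ := hτB l (by omega) hl1.2
    have h0 : (0 : ℝ) ≤ (σ 0 l : ℝ) := Nat.cast_nonneg _
    gcongr
  refine (Finset.sum_le_sum hstep).trans ?_
  rw [Finset.sum_add_distrib, ← Finset.mul_sum, ← Finset.mul_sum]
  refine add_le_add ?_ ?_
  · rw [div_eq_mul_inv]
    refine mul_le_mul_of_nonneg_left (mul_le_mul_of_nonneg_left ?_ (sq_nonneg _)) hA
    rcases le_or_gt Λ Λ₁ with h | h
    · calc ∑ l ∈ (Ioc Λ Λ₁).filter Squarefree, ((l : ℝ) ^ 2)⁻¹ ≤ ∑ l ∈ Ioc Λ Λ₁, ((l : ℝ) ^ 2)⁻¹ :=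
            Finset.sum_le_sum_of_subset_of_nonneg (Finset.filter_subset _ _) fun l _ _ => by positivity
        _ ≤ (Λ : ℝ)⁻¹ - (Λ₁ : ℝ)⁻¹ := sum_Ioc_inv_sq_le_sub (by omega) h
        _ ≤ (Λ : ℝ)⁻¹ := sub_le_self _ (by positivity)
    · rw [Finset.Ioc_eq_empty (by omega), Finset.filter_empty, Finset.sum_empty]; positivity
  · -- `ℓ ↦ ℓ²` is injective and lands in the cubefree `b ≤ Λ₁²`
    have hinj : Set.InjOn (fun l : ℕ => l ^ 2) ↑((Ioc Λ Λ₁).filter Squarefree) :=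
      fun l _ l' _ h => Nat.pow_left_injective two_ne_zero h
    rw [← Finset.sum_image (f := fun b => |fiSieveSeq.remainder b x|) (g := fun l : ℕ => l ^ 2) hinj]
    refine Finset.sum_le_sum_of_subset_of_nonneg ?_ fun b _ _ => abs_nonneg _
    intro b hb
    obtain ⟨l, hl, rfl⟩ := Finset.mem_image.mp hb
    have hl' := Finset.mem_filter.mp hl
    have hl1 := Finset.mem_Ioc.mp hl'.1
    refine Finset.mem_filter.mpr ⟨Finset.mem_Icc.mpr ⟨Nat.one_le_pow _ _ (by omega),
      Nat.pow_le_pow_left hl1.2 2⟩, ?_⟩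
    have := isCubefree_lcm_sq squarefree_one (L := l.primeFactors) fun p hp => Nat.prime_of_mem_primeFactors hp
    rwa [Nat.prod_primeFactors_of_squarefree hl'.2, Nat.lcm_one_left] at this

/-- **`ES`, large range** `ℓ > Λ₁` (Cauchy–Schwarz): with `X = ⌊x⌋`,
`Σ_{Λ₁<ℓ≤√X sqfree} A_{ℓ²}(x) ≤ τB √(X/Λ₁) (Σ_{n ≤ X} a_n²)^{1/2}` (`τ(n) ≤ τB` for `n ≤ X`,
`Λ₁ ≥ 1`): the `n ≤ X` with a square divisor `ℓ² > Λ₁²` are at most `X/Λ₁` in number. [folklore] -/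
theorem sum_large_congrSum_sq_le (x : ℝ) {Λ₁ : ℕ} (hΛ₁ : 1 ≤ Λ₁) {τB : ℝ} (hτB0 : 0 ≤ τB)
    (hτB : ∀ n : ℕ, 1 ≤ n → n ≤ ⌊x⌋₊ → (σ 0 n : ℝ) ≤ τB) :
    ∑ l ∈ (Ioc Λ₁ (Nat.sqrt ⌊x⌋₊)).filter Squarefree, fiSieveSeq.congrSum (l ^ 2) x ≤
      τB * Real.sqrt (⌊x⌋₊ / Λ₁) * Real.sqrt (∑ n ∈ Icc 1 ⌊x⌋₊, (fiRepCount n : ℝ) ^ 2) := by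
  set X := ⌊x⌋₊ with hX
  set R := (Ioc Λ₁ (Nat.sqrt X)).filter Squarefree with hR
  set Bad := (Ioc 0 X).filter (fun n => ∃ l ∈ R, l ^ 2 ∣ n) with hBad
  -- swap the sums
  have h1 : ∑ l ∈ R, fiSieveSeq.congrSum (l ^ 2) x =
      ∑ n ∈ Ioc 0 X, (#{l ∈ R | l ^ 2 ∣ n} : ℝ) * (fiRepCount n : ℝ) := by
    simp only [SieveSequence.congrSum, Finset.sum_filter]
    rw [Finset.sum_comm]
    refine Finset.sum_congr rfl fun n _ => ?_
    rw [← Finset.sum_filter, Finset.sum_const, nsmul_eq_mul]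
    rfl
  -- bound the multiplicity by `τB` and restrict to `Bad`
  have h2 : ∑ n ∈ Ioc 0 X, (#{l ∈ R | l ^ 2 ∣ n} : ℝ) * (fiRepCount n : ℝ) ≤
      τB * ∑ n ∈ Bad, (fiRepCount n : ℝ) := by
    rw [Finset.mul_sum, hBad, Finset.sum_filter]
    refine Finset.sum_le_sum fun n hn => ?_
    have hn1 := Finset.mem_Ioc.mp hn
    by_cases hex : ∃ l ∈ R, l ^ 2 ∣ n
    · rw [if_pos hex]
      refine mul_le_mul_of_nonneg_right ?_ (Nat.cast_nonneg _)
      calc (#{l ∈ R | l ^ 2 ∣ n} : ℝ) ≤ (σ 0 n : ℝ) := by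
            have : #{l ∈ R | l ^ 2 ∣ n} ≤ σ 0 n := by
              rw [ArithmeticFunction.sigma_zero_apply]
              refine Finset.card_le_card_of_injOn id (fun l hl => ?_) (Set.injOn_id _)
              exact Nat.mem_divisors.mpr ⟨(dvd_pow_self l two_ne_zero).trans (Finset.mem_filter.mp hl).2,
                by omega⟩
            exact_mod_cast this
        _ ≤ τB := hτB n hn1.1 hn1.2
    · rw [if_neg hex]
      have : #{l ∈ R | l ^ 2 ∣ n} = 0 :=
        Finset.card_eq_zero.mpr (Finset.filter_eq_empty_iff.mpr fun l hl h => hex ⟨l, hl, h⟩)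
      rw [this]; simp
  -- Cauchy–Schwarz on `Bad`
  have h3 : ∑ n ∈ Bad, (fiRepCount n : ℝ) ≤
      Real.sqrt (#Bad) * Real.sqrt (∑ n ∈ Icc 1 X, (fiRepCount n : ℝ) ^ 2) := by
    have hcs := sq_sum_le_card_mul_sum_sq (s := Bad) (f := fun n => (fiRepCount n : ℝ))
    have hsub : ∑ n ∈ Bad, (fiRepCount n : ℝ) ^ 2 ≤ ∑ n ∈ Icc 1 X, (fiRepCount n : ℝ) ^ 2 := by
      refine Finset.sum_le_sum_of_subset_of_nonneg (fun n hn => ?_) fun n _ _ => sq_nonneg _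
      have := Finset.mem_Ioc.mp (Finset.mem_filter.mp hn).1
      exact Finset.mem_Icc.mpr ⟨this.1, this.2⟩
    have hnn : 0 ≤ ∑ n ∈ Bad, (fiRepCount n : ℝ) := Finset.sum_nonneg fun _ _ => Nat.cast_nonneg _
    rw [← Real.sqrt_mul (Nat.cast_nonneg _)]
    refine Real.le_sqrt_of_sq_le ?_
    exact hcs.trans (mul_le_mul_of_nonneg_left hsub (Nat.cast_nonneg _))
  -- `#Bad ≤ X / Λ₁`
  have h4 : (#Bad : ℝ) ≤ X / Λ₁ := by
    have hU : Bad ⊆ R.biUnion (fun l => (Ioc 0 X).filter (fun n => l ^ 2 ∣ n)) := by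
      intro n hn
      have hn' := Finset.mem_filter.mp hn
      obtain ⟨l, hl, hln⟩ := hn'.2
      exact Finset.mem_biUnion.mpr ⟨l, hl, Finset.mem_filter.mpr ⟨hn'.1, hln⟩⟩
    have hc := (Finset.card_le_card hU).trans Finset.card_biUnion_le
    have hc' : (#Bad : ℝ) ≤ ∑ l ∈ R, ((X / l ^ 2 : ℕ) : ℝ) := by
      have : #Bad ≤ ∑ l ∈ R, X / l ^ 2 := by
        refine hc.trans (le_of_eq (Finset.sum_congr rfl fun l _ => Nat.Ioc_filter_dvd_card_eq_div X (l ^ 2)))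
      exact_mod_cast this
    refine hc'.trans ?_
    have hΛ0 : (0 : ℝ) < Λ₁ := by exact_mod_cast hΛ₁
    calc ∑ l ∈ R, ((X / l ^ 2 : ℕ) : ℝ) ≤ ∑ l ∈ R, (X : ℝ) * ((l : ℝ) ^ 2)⁻¹ := by
          refine Finset.sum_le_sum fun l hl => ?_
          have hl1 := Finset.mem_Ioc.mp (Finset.mem_filter.mp hl).1
          have hlpos : (0 : ℝ) < l := by exact_mod_cast (show 0 < l by omega)
          have hl0 : (0 : ℝ) < (l : ℝ) ^ 2 := by positivity
          rw [← div_eq_mul_inv, le_div_iff₀ hl0]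
          exact_mod_cast Nat.div_mul_le_self X (l ^ 2)
      _ ≤ ∑ l ∈ Ioc Λ₁ (Nat.sqrt X), (X : ℝ) * ((l : ℝ) ^ 2)⁻¹ :=
          Finset.sum_le_sum_of_subset_of_nonneg (Finset.filter_subset _ _) fun l _ _ => by positivity
      _ = (X : ℝ) * ∑ l ∈ Ioc Λ₁ (Nat.sqrt X), ((l : ℝ) ^ 2)⁻¹ := (Finset.mul_sum _ _ _).symm
      _ ≤ (X : ℝ) * (Λ₁ : ℝ)⁻¹ := by
          refine mul_le_mul_of_nonneg_left ?_ (Nat.cast_nonneg _)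
          rcases le_or_gt Λ₁ (Nat.sqrt X) with h | h
          · have := sum_Ioc_inv_sq_le_sub (α := ℝ) (by omega : Λ₁ ≠ 0) h
            have h0 : (0 : ℝ) ≤ (Nat.sqrt X : ℝ)⁻¹ := by positivity
            linarith
          · rw [Finset.Ioc_eq_empty (by omega), Finset.sum_empty]; positivity
      _ = X / Λ₁ := (div_eq_mul_inv _ _).symm
  calc ∑ l ∈ R, fiSieveSeq.congrSum (l ^ 2) x
      = ∑ n ∈ Ioc 0 X, (#{l ∈ R | l ^ 2 ∣ n} : ℝ) * (fiRepCount n : ℝ) := h1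
    _ ≤ τB * ∑ n ∈ Bad, (fiRepCount n : ℝ) := h2
    _ ≤ τB * (Real.sqrt (#Bad) * Real.sqrt (∑ n ∈ Icc 1 X, (fiRepCount n : ℝ) ^ 2)) :=
        mul_le_mul_of_nonneg_left h3 hτB0
    _ ≤ τB * (Real.sqrt (X / Λ₁) * Real.sqrt (∑ n ∈ Icc 1 X, (fiRepCount n : ℝ) ^ 2)) := by
        gcongr
    _ = _ := by ring

end Literature.NumberTheory.Sieve.FriedlanderIwaniecPrimesSquarefree

/-! ## Part E: the level-of-distribution sum for `a'`, raw form -/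

namespace Literature.NumberTheory.Sieve.FriedlanderIwaniecPrimesSquarefree

open FriedlanderIwaniecPrimes
open scoped ArithmeticFunction.sigma ArithmeticFunction.Moebius ArithmeticFunction.omega

/-- `Σ_{d ∈ 𝒟} g'(d) ≤ Σ_{d ∈ 𝒟} g(d)` over squarefree `d`. [folklore] -/
theorem sum_fiDensitySq_le_sum_fiDensity (D₀ : ℕ) :
    ∑ d ∈ (Icc 1 D₀).filter Squarefree, fiDensitySq d ≤
      ∑ d ∈ (Icc 1 D₀).filter Squarefree, fiDensity d :=
  Finset.sum_le_sum fun _ hd => (fiDensitySq_squarefree_nonneg_le (Finset.mem_filter.mp hd).2).2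

/-- `g(d) ≤ τ(d)/d` for squarefree `d` (`g(p) ≤ 2/p`). [folklore] -/
theorem fiDensity_le_sigma_div {d : ℕ} (hd : Squarefree d) : fiDensity d ≤ (σ 0 d : ℝ) / d := by
  have hd0 := hd.ne_zero
  rw [← isMultiplicative_fiDensity.prod_primeFactors hd]
  calc ∏ p ∈ d.primeFactors, fiDensity p ≤ ∏ p ∈ d.primeFactors, (2 / (p : ℝ)) :=
        Finset.prod_le_prod (fun p hp => (fiDensity_hyp24 (Nat.prime_of_mem_primeFactors hp)).1.trans
          (fiDensity_hyp24 (Nat.prime_of_mem_primeFactors hp)).2.1)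
          fun p hp => (fiDensity_hyp2526 (Nat.prime_of_mem_primeFactors hp)).1
    _ = 2 ^ #d.primeFactors / d := by
        rw [Finset.prod_div_distrib, Finset.prod_const, ← Nat.cast_prod,
          Nat.prod_primeFactors_of_squarefree hd]
    _ ≤ (σ 0 d : ℝ) / d := by
        gcongr
        exact two_pow_card_primeFactors_le_sigma d hd0

/-- `G = Σ_{d ≤ D₀ sqfree} g(d) ≤ τB (1 + log D₀)` when `τ(d) ≤ τB` on `[1, D₀]`. [folklore] -/
theorem sum_fiDensity_le (D₀ : ℕ) {τB : ℝ} (hτB0 : 0 ≤ τB)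
    (hτB : ∀ d : ℕ, 1 ≤ d → d ≤ D₀ → (σ 0 d : ℝ) ≤ τB) :
    ∑ d ∈ (Icc 1 D₀).filter Squarefree, fiDensity d ≤ τB * (1 + Real.log D₀) := by
  rcases Nat.eq_zero_or_pos D₀ with rfl | hD
  · simpa using hτB0
  calc ∑ d ∈ (Icc 1 D₀).filter Squarefree, fiDensity d
      ≤ ∑ d ∈ (Icc 1 D₀).filter Squarefree, τB * (d : ℝ)⁻¹ := by
        refine Finset.sum_le_sum fun d hd => ?_
        have hd' := Finset.mem_filter.mp hd
        have hd1 := Finset.mem_Icc.mp hd'.1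
        refine (fiDensity_le_sigma_div hd'.2).trans ?_
        rw [div_eq_mul_inv]
        exact mul_le_mul_of_nonneg_right (hτB d hd1.1 hd1.2) (by positivity)
    _ ≤ ∑ d ∈ Icc 1 D₀, τB * (d : ℝ)⁻¹ :=
        Finset.sum_le_sum_of_subset_of_nonneg (Finset.filter_subset _ _) fun _ _ _ => by positivity
    _ = τB * ∑ d ∈ Icc 1 D₀, (d : ℝ)⁻¹ := (Finset.mul_sum _ _ _).symm
    _ = τB * (harmonic D₀ : ℝ) := by
        congr 1
        rw [harmonic_eq_sum_Icc]; push_cast; rfl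
    _ ≤ τB * (1 + Real.log D₀) := mul_le_mul_of_nonneg_left (harmonic_le_one_add_log D₀) hτB0

/-- **The level sum for `a'`, raw form.** For `x ≥ 1`, `t ≤ x`, `1 ≤ D₀ ≤ ⌊x⌋`, truncation
parameters `Λ, Λ₁ ≥ 1` and bounds `τX, τM, τ₁` for `τ` on `[1, ⌊x⌋]`, `[1, D₀Λ²]`, `[1, Λ₁]`:
`Σ_{d ≤ D₀ cubefree} |r'_d(t)| ≤ (1 + G) · { A(x) e^{6C₀} Λ^{-1/2} G + τM² Σ_{b ≤ D₀Λ² cubefree} |r_b(t)|`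
`+ τX [ A(x) τ₁²/Λ + Σ_{b ≤ Λ₁² cubefree} |r_b(x)| + τX √(⌊x⌋/Λ₁) (Σ_{n≤x} a_n²)^{1/2} ] }`,
`G = Σ_{d ≤ D₀ sqfree} g(d)`. [folklore] -/
theorem levelSum_le_raw {x t : ℝ} (hx : 1 ≤ x) (htx : t ≤ x) {D₀ Λ Λ₁ : ℕ} (hD₀ : 1 ≤ D₀)
    (hD₀x : D₀ ≤ ⌊x⌋₊) (hΛ : 1 ≤ Λ) (hΛ₁ : 1 ≤ Λ₁) {τX τM τ₁ : ℝ} (hτX0 : 0 ≤ τX) (hτM0 : 0 ≤ τM)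
    (hτX : ∀ n : ℕ, 1 ≤ n → n ≤ ⌊x⌋₊ → (σ 0 n : ℝ) ≤ τX)
    (hτM : ∀ b : ℕ, 1 ≤ b → b ≤ D₀ * Λ ^ 2 → (σ 0 b : ℝ) ≤ τM)
    (hτ₁ : ∀ l : ℕ, 1 ≤ l → l ≤ Λ₁ → (σ 0 l : ℝ) ≤ τ₁) :
    ∑ d ∈ (Icc 1 D₀).filter IsCubefree, |fiSieveSeqSq.remainder d t| ≤
      (1 + ∑ d ∈ (Icc 1 D₀).filter Squarefree, fiDensity d) *
        (fiCount x * (Real.exp (6 * ∑' n : ℕ, (n : ℝ) ^ (-(3 / 2 : ℝ))) / Real.sqrt Λ *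
            ∑ d ∈ (Icc 1 D₀).filter Squarefree, fiDensity d) +
          τM ^ 2 * ∑ b ∈ (Icc 1 (D₀ * Λ ^ 2)).filter IsCubefree, |fiSieveSeq.remainder b t| +
          τX * (fiCount x * (τ₁ ^ 2 / Λ) +
            ∑ b ∈ (Icc 1 (Λ₁ ^ 2)).filter IsCubefree, |fiSieveSeq.remainder b x| +
            τX * Real.sqrt (⌊x⌋₊ / Λ₁) * Real.sqrt (∑ n ∈ Icc 1 ⌊x⌋₊, (fiRepCount n : ℝ) ^ 2))) := by
  set X := ⌊x⌋₊ with hX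
  set T := Nat.primesLE X with hT
  have hTp : ∀ p ∈ T, p.Prime := fun p hp => Nat.prime_of_mem_primesLE hp
  set 𝒟 := (Icc 1 D₀).filter Squarefree with h𝒟
  set Pb := T.powerset.filter (fun L => ¬(∏ p ∈ L, p) ≤ Λ) with hPb
  set Ps := T.powerset.filter (fun L => (∏ p ∈ L, p) ≤ Λ) with hPs
  set G := ∑ d ∈ 𝒟, fiDensity d with hG
  -- the three error functionals
  set TG : ℕ → ℝ := fun d => ∑ L ∈ Pb, fiDensity (Nat.lcm d ((∏ p ∈ L, p) ^ 2)) with hTG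
  set RS : ℕ → ℝ := fun d => ∑ L ∈ Ps, |fiSieveSeq.remainder (Nat.lcm d ((∏ p ∈ L, p) ^ 2)) t| with hRS
  set ES : ℕ → ℝ := fun d => ∑ L ∈ Pb, fiSieveSeq.congrSum (Nat.lcm d ((∏ p ∈ L, p) ^ 2)) t with hES
  set Pd : ℕ → ℝ := fun d => fiCount t * TG d + RS d + ES d with hPd
  have hAt := fiCount_nonneg t
  have hAx := fiCount_nonneg x
  have hAtx := fiCount_mono htx
  have h1𝒟 : (1 : ℕ) ∈ 𝒟 := Finset.mem_filter.mpr ⟨Finset.mem_Icc.mpr ⟨le_rfl, hD₀⟩, squarefree_one⟩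
  have hTG0 : ∀ d ∈ 𝒟, 0 ≤ TG d := by
    intro d hd
    refine Finset.sum_nonneg fun L hL => ?_
    have hLp : ∀ p ∈ L, p.Prime := fun p hp => hTp p (Finset.mem_powerset.mp (Finset.mem_filter.mp hL).1 hp)
    rw [fiDensity_lcm_sq' (Finset.mem_filter.mp hd).2 hLp]
    exact mul_nonneg (fiDensity_squarefree_nonneg (squarefree_prod_of_primes fun p hp =>
      Nat.prime_of_mem_primeFactors (Finset.mem_sdiff.mp hp).1)) (prod_fiDensity_sq_nonneg hLp)
  have hRS0 : ∀ d, 0 ≤ RS d := fun d => Finset.sum_nonneg fun _ _ => abs_nonneg _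
  have hES0 : ∀ d, 0 ≤ ES d := fun d => Finset.sum_nonneg fun _ _ => congrSum_nonneg _ _
  have hPd0 : ∀ d ∈ 𝒟, 0 ≤ Pd d := fun d hd =>
    add_nonneg (add_nonneg (mul_nonneg hAt (hTG0 d hd)) (hRS0 d)) (hES0 d)
  have hG0 : 0 ≤ G := Finset.sum_nonneg fun d hd => fiDensity_squarefree_nonneg (Finset.mem_filter.mp hd).2
  -- Step 1: only squarefree moduli contribute
  have hstep1 : ∑ d ∈ (Icc 1 D₀).filter IsCubefree, |fiSieveSeqSq.remainder d t| ≤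
      ∑ d ∈ 𝒟, |fiSieveSeqSq.remainder d t| := by
    calc ∑ d ∈ (Icc 1 D₀).filter IsCubefree, |fiSieveSeqSq.remainder d t|
        ≤ ∑ d ∈ Icc 1 D₀, |fiSieveSeqSq.remainder d t| :=
          Finset.sum_le_sum_of_subset_of_nonneg (Finset.filter_subset _ _) fun _ _ _ => abs_nonneg _
      _ = ∑ d ∈ 𝒟, |fiSieveSeqSq.remainder d t| := by
          rw [h𝒟, Finset.sum_filter_of_ne]
          intro d _ hne
          by_contra hns
          exact hne (by rw [fiSieveSeqSq_remainder_eq_zero hns]; simp)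
  -- Step 2: the pointwise bound, summed
  have hstep2 : ∑ d ∈ 𝒟, |fiSieveSeqSq.remainder d t| ≤
      ∑ d ∈ 𝒟, (Pd d + fiDensitySq d * Pd 1) := by
    refine Finset.sum_le_sum fun d hd => ?_
    have hd' := Finset.mem_filter.mp hd
    have hdX : d ≤ X := (Finset.mem_Icc.mp hd'.1).2.trans hD₀x
    exact abs_remainderSq_le hd'.2 hdX hx htx Λ
  -- Step 3: `Σ_d (P_d + g'(d) P_1) ≤ (1 + G) Σ_d P_d`
  have hstep3 : ∑ d ∈ 𝒟, (Pd d + fiDensitySq d * Pd 1) ≤ (1 + G) * ∑ d ∈ 𝒟, Pd d := by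
    rw [Finset.sum_add_distrib, ← Finset.sum_mul, add_mul, one_mul]
    refine add_le_add le_rfl ?_
    have hP1 : Pd 1 ≤ ∑ d ∈ 𝒟, Pd d := Finset.single_le_sum hPd0 h1𝒟
    have hG' : ∑ d ∈ 𝒟, fiDensitySq d ≤ G := sum_fiDensitySq_le_sum_fiDensity D₀
    have hG'0 : 0 ≤ ∑ d ∈ 𝒟, fiDensitySq d := Finset.sum_nonneg fun d _ => fiDensitySq_nonneg d
    exact mul_le_mul hG' hP1 (hPd0 1 h1𝒟) hG0
  -- Step 4: the three aggregate bounds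
  have hsumP : ∑ d ∈ 𝒟, Pd d = fiCount t * ∑ d ∈ 𝒟, TG d + ∑ d ∈ 𝒟, RS d + ∑ d ∈ 𝒟, ES d := by
    simp only [hPd, Finset.sum_add_distrib, Finset.mul_sum]
  -- (i) density tail
  have hi : fiCount t * ∑ d ∈ 𝒟, TG d ≤
      fiCount x * (Real.exp (6 * ∑' n : ℕ, (n : ℝ) ^ (-(3 / 2 : ℝ))) / Real.sqrt Λ * G) := by
    refine mul_le_mul hAtx (sum_sum_big_fiDensity_lcm_le hTp hΛ D₀) (Finset.sum_nonneg hTG0) hAx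
  -- (ii) remainders
  have hii : ∑ d ∈ 𝒟, RS d ≤ τM ^ 2 * ∑ b ∈ (Icc 1 (D₀ * Λ ^ 2)).filter IsCubefree,
      |fiSieveSeq.remainder b t| :=
    sum_sum_small_abs_remainder_le hTp t le_rfl hτM0 hτM
  -- (iii) large square divisors
  have htX : ⌊t⌋₊ ≤ X := Nat.floor_mono htx
  have hiii : ∑ d ∈ 𝒟, ES d ≤ τX * (fiCount x * (τ₁ ^ 2 / Λ) +
      ∑ b ∈ (Icc 1 (Λ₁ ^ 2)).filter IsCubefree, |fiSieveSeq.remainder b x| +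
      τX * Real.sqrt (X / Λ₁) * Real.sqrt (∑ n ∈ Icc 1 X, (fiRepCount n : ℝ) ^ 2)) := by
    have hτt : ∀ n : ℕ, 1 ≤ n → n ≤ ⌊t⌋₊ → (σ 0 n : ℝ) ≤ τX := fun n h1 h2 => hτX n h1 (h2.trans htX)
    calc ∑ d ∈ 𝒟, ES d = ∑ L ∈ Pb, ∑ d ∈ 𝒟, fiSieveSeq.congrSum (Nat.lcm d ((∏ p ∈ L, p) ^ 2)) t := by
          rw [Finset.sum_comm]
      _ ≤ ∑ L ∈ Pb, τX * fiSieveSeq.congrSum ((∏ p ∈ L, p) ^ 2) t :=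
          Finset.sum_le_sum fun L _ => sum_congrSum_lcm_le 𝒟 L t hτt
      _ ≤ ∑ L ∈ Pb, τX * fiSieveSeq.congrSum ((∏ p ∈ L, p) ^ 2) x :=
          Finset.sum_le_sum fun L _ => mul_le_mul_of_nonneg_left (congrSum_mono _ htx) hτX0
      _ = τX * ∑ L ∈ Pb, fiSieveSeq.congrSum ((∏ p ∈ L, p) ^ 2) x := (Finset.mul_sum _ _ _).symm
      _ ≤ τX * ∑ l ∈ (Ioc Λ (Nat.sqrt X)).filter Squarefree, fiSieveSeq.congrSum (l ^ 2) x :=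
          mul_le_mul_of_nonneg_left (sum_big_congrSum_sq_le hTp Λ x) hτX0
      _ ≤ τX * (∑ l ∈ (Ioc Λ Λ₁).filter Squarefree, fiSieveSeq.congrSum (l ^ 2) x +
            ∑ l ∈ (Ioc Λ₁ (Nat.sqrt X)).filter Squarefree, fiSieveSeq.congrSum (l ^ 2) x) := by
          refine mul_le_mul_of_nonneg_left ?_ hτX0
          have hsub : (Ioc Λ (Nat.sqrt X)).filter Squarefree ⊆
              (Ioc Λ Λ₁).filter Squarefree ∪ (Ioc Λ₁ (Nat.sqrt X)).filter Squarefree := by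
            intro l hl
            have hl' := Finset.mem_filter.mp hl
            have hl1 := Finset.mem_Ioc.mp hl'.1
            rw [Finset.mem_union, Finset.mem_filter, Finset.mem_filter, Finset.mem_Ioc, Finset.mem_Ioc]
            by_cases h : l ≤ Λ₁
            · exact Or.inl ⟨⟨hl1.1, h⟩, hl'.2⟩
            · exact Or.inr ⟨⟨not_le.mp h, hl1.2⟩, hl'.2⟩
          have hdisj : Disjoint ((Ioc Λ Λ₁).filter Squarefree) ((Ioc Λ₁ (Nat.sqrt X)).filter Squarefree) := by
            rw [Finset.disjoint_left]
            intro l h1 h2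
            have a := (Finset.mem_Ioc.mp (Finset.mem_filter.mp h1).1).2
            have b := (Finset.mem_Ioc.mp (Finset.mem_filter.mp h2).1).1
            omega
          calc ∑ l ∈ (Ioc Λ (Nat.sqrt X)).filter Squarefree, fiSieveSeq.congrSum (l ^ 2) x
              ≤ ∑ l ∈ (Ioc Λ Λ₁).filter Squarefree ∪ (Ioc Λ₁ (Nat.sqrt X)).filter Squarefree,
                  fiSieveSeq.congrSum (l ^ 2) x :=
                Finset.sum_le_sum_of_subset_of_nonneg hsub fun _ _ _ => congrSum_nonneg _ _
            _ = _ := Finset.sum_union hdisj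
      _ ≤ _ := by
          refine mul_le_mul_of_nonneg_left ?_ hτX0
          have hm := sum_mid_congrSum_sq_le x hΛ hτ₁
          have hl := sum_large_congrSum_sq_le x hΛ₁ hτX0 hτX
          linarith
  -- assemble
  have hS : ∑ d ∈ 𝒟, Pd d ≤ fiCount x * (Real.exp (6 * ∑' n : ℕ, (n : ℝ) ^ (-(3 / 2 : ℝ))) /
      Real.sqrt Λ * G) + τM ^ 2 * ∑ b ∈ (Icc 1 (D₀ * Λ ^ 2)).filter IsCubefree,
      |fiSieveSeq.remainder b t| + τX * (fiCount x * (τ₁ ^ 2 / Λ) +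
      ∑ b ∈ (Icc 1 (Λ₁ ^ 2)).filter IsCubefree, |fiSieveSeq.remainder b x| +
      τX * Real.sqrt (X / Λ₁) * Real.sqrt (∑ n ∈ Icc 1 X, (fiRepCount n : ℝ) ^ 2)) := by
    rw [hsumP]; linarith
  have h1G : 0 ≤ 1 + G := by linarith
  calc ∑ d ∈ (Icc 1 D₀).filter IsCubefree, |fiSieveSeqSq.remainder d t|
      ≤ ∑ d ∈ 𝒟, |fiSieveSeqSq.remainder d t| := hstep1
    _ ≤ ∑ d ∈ 𝒟, (Pd d + fiDensitySq d * Pd 1) := hstep2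
    _ ≤ (1 + G) * ∑ d ∈ 𝒟, Pd d := hstep3
    _ ≤ _ := mul_le_mul_of_nonneg_left hS h1G

/-- **`A'(t)` against `P A(t)`, raw form** (the case `d = 1` of the decomposition): for `x ≥ 1`,
`t ≤ x`, `Λ, Λ₁ ≥ 1`,
`|A'(t) - P(⌊x⌋) A(t)| ≤ A(x) e^{6C₀} Λ^{-1/2} + τM² Σ_{b ≤ Λ²} |r_b(t)|`
`+ τX [A(x) τ₁²/Λ + Σ_{b ≤ Λ₁²} |r_b(x)| + τX √(⌊x⌋/Λ₁) (Σ a_n²)^{1/2}]`. [folklore] -/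
theorem abs_fiCountSq_sub_le_raw {x t : ℝ} (hx : 1 ≤ x) (htx : t ≤ x) {Λ Λ₁ : ℕ}
    (hΛ : 1 ≤ Λ) (hΛ₁ : 1 ≤ Λ₁) {τX τM τ₁ : ℝ} (hτX0 : 0 ≤ τX) (hτM0 : 0 ≤ τM)
    (hτX : ∀ n : ℕ, 1 ≤ n → n ≤ ⌊x⌋₊ → (σ 0 n : ℝ) ≤ τX)
    (hτM : ∀ b : ℕ, 1 ≤ b → b ≤ Λ ^ 2 → (σ 0 b : ℝ) ≤ τM)
    (hτ₁ : ∀ l : ℕ, 1 ≤ l → l ≤ Λ₁ → (σ 0 l : ℝ) ≤ τ₁) :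
    |fiCountSq t - fiSqProd ⌊x⌋₊ * fiCount t| ≤
      fiCount x * (Real.exp (6 * ∑' n : ℕ, (n : ℝ) ^ (-(3 / 2 : ℝ))) / Real.sqrt Λ) +
        τM ^ 2 * ∑ b ∈ (Icc 1 (Λ ^ 2)).filter IsCubefree, |fiSieveSeq.remainder b t| +
        τX * (fiCount x * (τ₁ ^ 2 / Λ) +
          ∑ b ∈ (Icc 1 (Λ₁ ^ 2)).filter IsCubefree, |fiSieveSeq.remainder b x| +
          τX * Real.sqrt (⌊x⌋₊ / Λ₁) * Real.sqrt (∑ n ∈ Icc 1 ⌊x⌋₊, (fiRepCount n : ℝ) ^ 2)) := by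
  set X := ⌊x⌋₊ with hX
  set T := Nat.primesLE X with hT
  have hTp : ∀ p ∈ T, p.Prime := fun p hp => Nat.prime_of_mem_primesLE hp
  have h1X : 1 ≤ X := Nat.le_floor (by simpa using hx)
  have hAt := fiCount_nonneg t
  have hAx := fiCount_nonneg x
  have hAtx := fiCount_mono htx
  have htX : ⌊t⌋₊ ≤ X := Nat.floor_mono htx
  -- `d = 1` in the pointwise decomposition
  have h := abs_congrSumSq_sub_main_le squarefree_one h1X htx Λ
  rw [isMultiplicative_fiDensitySq.map_one, one_mul, ← fiSieveSeqSq_size_eq] at h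
  simp only [Nat.lcm_one_left] at h
  change |fiCountSq t - _| ≤ _ at h
  refine h.trans (add_le_add (add_le_add ?_ ?_) ?_)
  · -- density tail with `𝒟 = {1}`
    have h1 := sum_sum_big_fiDensity_lcm_le hTp hΛ 1
    have h𝒟 : (Icc 1 1).filter Squarefree = {1} := by
      ext d; simp only [Finset.mem_filter, Finset.mem_Icc, Finset.mem_singleton]
      constructor
      · rintro ⟨⟨h1, h2⟩, -⟩; omega
      · rintro rfl; exact ⟨⟨le_rfl, le_rfl⟩, squarefree_one⟩
    rw [h𝒟, Finset.sum_singleton, Finset.sum_singleton, isMultiplicative_fiDensity.map_one, mul_one] at h1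
    simp only [Nat.lcm_one_left] at h1
    exact mul_le_mul hAtx h1 (Finset.sum_nonneg fun L hL => fiDensity_sq_nonneg_of_squarefree
      (squarefree_prod_of_primes fun p hp =>
        hTp p (Finset.mem_powerset.mp (Finset.mem_filter.mp hL).1 hp))) hAx
  · -- remainders with `𝒟 = {1}`, `D₀ = 1`
    have h2 := sum_sum_small_abs_remainder_le hTp t (D₀ := 1) (Λ := Λ) (M := Λ ^ 2) (by omega) hτM0 hτM
    have h𝒟 : (Icc 1 1).filter Squarefree = {1} := by
      ext d; simp only [Finset.mem_filter, Finset.mem_Icc, Finset.mem_singleton]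
      constructor
      · rintro ⟨⟨h1, h2⟩, -⟩; omega
      · rintro rfl; exact ⟨⟨le_rfl, le_rfl⟩, squarefree_one⟩
    rw [h𝒟, Finset.sum_singleton] at h2
    simpa only [Nat.lcm_one_left] using h2
  · -- large square divisors with `𝒟 = {1}`
    have hτt : ∀ n : ℕ, 1 ≤ n → n ≤ ⌊t⌋₊ → (σ 0 n : ℝ) ≤ τX := fun n h1 h2 => hτX n h1 (h2.trans htX)
    calc ∑ L ∈ T.powerset with ¬(∏ p ∈ L, p) ≤ Λ, fiSieveSeq.congrSum ((∏ p ∈ L, p) ^ 2) t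
        ≤ ∑ L ∈ T.powerset with ¬(∏ p ∈ L, p) ≤ Λ, fiSieveSeq.congrSum ((∏ p ∈ L, p) ^ 2) x :=
          Finset.sum_le_sum fun L _ => congrSum_mono _ htx
      _ ≤ ∑ l ∈ (Ioc Λ (Nat.sqrt X)).filter Squarefree, fiSieveSeq.congrSum (l ^ 2) x :=
          sum_big_congrSum_sq_le hTp Λ x
      _ ≤ ∑ l ∈ (Ioc Λ Λ₁).filter Squarefree, fiSieveSeq.congrSum (l ^ 2) x +
            ∑ l ∈ (Ioc Λ₁ (Nat.sqrt X)).filter Squarefree, fiSieveSeq.congrSum (l ^ 2) x := by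
          have hsub : (Ioc Λ (Nat.sqrt X)).filter Squarefree ⊆
              (Ioc Λ Λ₁).filter Squarefree ∪ (Ioc Λ₁ (Nat.sqrt X)).filter Squarefree := by
            intro l hl
            have hl' := Finset.mem_filter.mp hl
            have hl1 := Finset.mem_Ioc.mp hl'.1
            rw [Finset.mem_union, Finset.mem_filter, Finset.mem_filter, Finset.mem_Ioc, Finset.mem_Ioc]
            by_cases h : l ≤ Λ₁
            · exact Or.inl ⟨⟨hl1.1, h⟩, hl'.2⟩
            · exact Or.inr ⟨⟨not_le.mp h, hl1.2⟩, hl'.2⟩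
          have hdisj : Disjoint ((Ioc Λ Λ₁).filter Squarefree) ((Ioc Λ₁ (Nat.sqrt X)).filter Squarefree) := by
            rw [Finset.disjoint_left]
            intro l h1 h2
            have a := (Finset.mem_Ioc.mp (Finset.mem_filter.mp h1).1).2
            have b := (Finset.mem_Ioc.mp (Finset.mem_filter.mp h2).1).1
            omega
          calc ∑ l ∈ (Ioc Λ (Nat.sqrt X)).filter Squarefree, fiSieveSeq.congrSum (l ^ 2) x
              ≤ ∑ l ∈ (Ioc Λ Λ₁).filter Squarefree ∪ (Ioc Λ₁ (Nat.sqrt X)).filter Squarefree,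
                  fiSieveSeq.congrSum (l ^ 2) x :=
                Finset.sum_le_sum_of_subset_of_nonneg hsub fun _ _ _ => congrSum_nonneg _ _
            _ = _ := Finset.sum_union hdisj
      _ ≤ (fiCount x * (τ₁ ^ 2 / Λ) + ∑ b ∈ (Icc 1 (Λ₁ ^ 2)).filter IsCubefree, |fiSieveSeq.remainder b x|) +
            τX * Real.sqrt (X / Λ₁) * Real.sqrt (∑ n ∈ Icc 1 X, (fiRepCount n : ℝ) ^ 2) :=
          add_le_add (sum_mid_congrSum_sq_le x hΛ hτ₁) (sum_large_congrSum_sq_le x hΛ₁ hτX0 hτX)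
      _ ≤ _ := by
          -- multiply by `τX ≥ 1`? No: we only have `τX ≥ 0`; instead use `τ(1) = 1 ≤ τX`.
          have hτ1 : (1 : ℝ) ≤ τX := by
            have := hτX 1 le_rfl h1X
            simpa [ArithmeticFunction.sigma_zero_apply] using this
          have hin : 0 ≤ fiCount x * (τ₁ ^ 2 / Λ) + ∑ b ∈ (Icc 1 (Λ₁ ^ 2)).filter IsCubefree,
              |fiSieveSeq.remainder b x| + τX * Real.sqrt (X / Λ₁) *
              Real.sqrt (∑ n ∈ Icc 1 X, (fiRepCount n : ℝ) ^ 2) := by positivity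
          nlinarith

end Literature.NumberTheory.Sieve.FriedlanderIwaniecPrimesSquarefree

/-! ## Part F: choice of parameters and the level of distribution of `a'` -/

namespace Literature.NumberTheory.Sieve.FriedlanderIwaniecPrimesSquarefree

open FriedlanderIwaniecPrimes
open scoped ArithmeticFunction.sigma ArithmeticFunction.Moebius ArithmeticFunction.omega

/-- Integer parts of large reals: `1 ≤ ⌊y⌋`, `⌊y⌋ ≤ y`, `y/2 ≤ ⌊y⌋` for `y ≥ 2`. [folklore] -/
theorem floor_facts {y : ℝ} (hy : 2 ≤ y) :
    1 ≤ ⌊y⌋₊ ∧ (⌊y⌋₊ : ℝ) ≤ y ∧ y / 2 ≤ (⌊y⌋₊ : ℝ) := by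
  refine ⟨Nat.le_floor (by norm_num; linarith), Nat.floor_le (by linarith), ?_⟩
  have := Nat.lt_floor_add_one y
  linarith

/-- Eventual numerical facts used to absorb constants: for `a > 0` and any `K`,
eventually `K ≤ x^a`. [folklore] -/
theorem eventually_const_le_rpow {a : ℝ} (ha : 0 < a) (K : ℝ) : ∀ᶠ x : ℝ in atTop, K ≤ x ^ a :=
  (tendsto_rpow_atTop ha).eventually_ge_atTop K

/-- Eventually `1 + log x ≤ x^a` (`a > 0`). [folklore] -/
theorem eventually_one_add_log_le_rpow {a : ℝ} (ha : 0 < a) :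
    ∀ᶠ x : ℝ in atTop, 1 + Real.log x ≤ x ^ a := by
  have h1 : ∀ᶠ x : ℝ in atTop, ‖Real.log x‖ ≤ 1 / 2 * ‖x ^ a‖ :=
    (isLittleO_log_rpow_atTop ha).def (by norm_num)
  filter_upwards [h1, eventually_const_le_rpow ha 2, eventually_ge_atTop 1] with x h hx2 hx1
  rw [Real.norm_eq_abs, Real.norm_eq_abs, abs_of_nonneg (Real.log_nonneg hx1),
    abs_of_nonneg (by positivity)] at h
  linarith

/-- **Level of distribution of `a'` and the size of `A'`** (the analytic core). Assuming FI's
Proposition 3.5 (`FriedlanderIwaniec1998_prop35`), for all large `x`: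
(a) for all `t ≤ x` and `1 ≤ D₀ ≤ x^{69/100}`,
`Σ_{d ≤ D₀ cubefree} |r'_d(t)| ≤ A(x) x^{-1/500}`;
(b) for all `t ≤ x`, `|A'(t) - P(⌊x⌋) A(t)| ≤ A(x) x^{-1/500}`.
Parameters: `Λ = ⌊x^{1/100}⌋`, `Λ₁ = ⌊x^{103/300}⌋`, `ε = 1/1000` in Prop. 3.5, `τ(n) ≤ C n^{1/2000}`
(`DivisorBound`), (2.2) for `a` (`FriedlanderIwaniec1998_hyp22_holds`) and (4.2)
(`FriedlanderIwaniec1998_count_asymp_holds`).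
[cite: FriedlanderIwaniecAnnals1998, Proposition 3.5 and §3 (2.9) for the squarefree-supported sequence] -/
theorem levelSq_and_countSq (h35 : FriedlanderIwaniec1998_prop35) :
    ∀ᶠ x : ℝ in atTop,
      (∀ t : ℝ, t ≤ x → ∀ D₀ : ℕ, 1 ≤ D₀ → (D₀ : ℝ) ≤ x ^ (69 / 100 : ℝ) →
        ∑ d ∈ (Icc 1 D₀).filter IsCubefree, |fiSieveSeqSq.remainder d t| ≤
          fiCount x * x ^ (-(1 / 500 : ℝ))) ∧
      (∀ t : ℝ, t ≤ x → |fiCountSq t - fiSqProd ⌊x⌋₊ * fiCount t| ≤ fiCount x * x ^ (-(1 / 500 : ℝ))) := by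
  -- constants
  obtain ⟨K₀, hK₀⟩ := h35 (1 / 1000) (by norm_num)
  set K : ℝ := max K₀ 1 with hK
  have hK1 : 1 ≤ K := le_max_right _ _
  have hK0 : 0 ≤ K := zero_le_one.trans hK1
  obtain ⟨c, hc, h22⟩ := FriedlanderIwaniec1998_hyp22_holds
  obtain ⟨C, hC1, hC⟩ := exists_sigma_zero_le_mul_rpow (ε := 1 / 2000) (by norm_num)
  have hC0 : 0 ≤ C := zero_le_one.trans hC1
  have hκ := friedlanderIwaniecKappa_pos
  set E₀ : ℝ := Real.exp (6 * ∑' n : ℕ, (n : ℝ) ^ (-(3 / 2 : ℝ))) with hE₀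
  have hE₀0 : 0 < E₀ := Real.exp_pos _
  have hb := fiCount_bounds FriedlanderIwaniec1998_count_asymp_holds
  filter_upwards [hK₀, h22, hb, eventually_ge_atTop (4 : ℝ),
    eventually_const_le_rpow (show (0 : ℝ) < 1 / 100 by norm_num) 2,
    eventually_one_add_log_le_rpow (show (0 : ℝ) < 1 / 2000 by norm_num),
    eventually_const_le_rpow (show (0 : ℝ) < 1 / 1000 by norm_num) (10 * Real.sqrt 2 * C ^ 2 * E₀),
    eventually_const_le_rpow (show (0 : ℝ) < 1 / 200 by norm_num) (5 * C ^ 3 * K / friedlanderIwaniecKappa),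
    eventually_const_le_rpow (show (0 : ℝ) < 11 / 2000 by norm_num) (20 * C ^ 4),
    eventually_const_le_rpow (show (0 : ℝ) < 17 / 1500 by norm_num) (5 * C ^ 2 * K / friedlanderIwaniecKappa),
    eventually_const_le_rpow (show (0 : ℝ) < 1 / 1000 by norm_num) (10 * Real.sqrt 2 * C ^ 3 / c)]
    with x hKx h22x hbx hx4 hx100 hlogx hn3 hn4 hn5 hn6 hn7
  -- basic quantities
  have hx1 : (1 : ℝ) ≤ x := by linarith
  have hx0 : 0 < x := by linarith
  set X := ⌊x⌋₊ with hX
  have hXx : (X : ℝ) ≤ x := Nat.floor_le hx0.le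
  have h1X : 1 ≤ X := Nat.le_floor (by simpa using hx1)
  set u : ℝ := x ^ (1 / 2000 : ℝ) with hu
  have hu1 : 1 ≤ u := Real.one_le_rpow hx1 (by norm_num)
  have hu0 : 0 < u := by linarith
  -- the divisor bound on `[1, x]`
  set τ : ℝ := C * u with hτ
  have hτ1 : 1 ≤ τ := one_le_mul_of_one_le_of_one_le hC1 hu1
  have hτu1 : 1 ≤ τ * u := one_le_mul_of_one_le_of_one_le hτ1 hu1
  have hτ0 : 0 ≤ τ := by linarith
  have hτb : ∀ n : ℕ, 1 ≤ n → (n : ℝ) ≤ x → (σ 0 n : ℝ) ≤ τ := by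
    intro n hn hnx
    refine (hC n).trans (mul_le_mul_of_nonneg_left ?_ hC0)
    exact Real.rpow_le_rpow (Nat.cast_nonneg _) hnx (by norm_num)
  -- parameters
  obtain ⟨hΛ1, hΛle, hΛge⟩ := floor_facts hx100
  set Λ := ⌊x ^ (1 / 100 : ℝ)⌋₊ with hΛ
  have hx103 : (2 : ℝ) ≤ x ^ (103 / 300 : ℝ) :=
    hx100.trans (Real.rpow_le_rpow_of_exponent_le hx1 (by norm_num))
  obtain ⟨hΛ₁1, hΛ₁le, hΛ₁ge⟩ := floor_facts hx103
  set Λ₁ := ⌊x ^ (103 / 300 : ℝ)⌋₊ with hΛ₁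
  have hΛpos : (0 : ℝ) < Λ := by exact_mod_cast hΛ1
  have hΛ₁pos : (0 : ℝ) < Λ₁ := by exact_mod_cast hΛ₁1
  -- powers of `x` as powers of `u`
  have hxu : ∀ r : ℝ, x ^ r = u ^ (2000 * r) := fun r => by
    rw [hu, ← Real.rpow_mul hx0.le]; congr 1; ring
  have hA := hbx.1
  have hA' := hbx.2
  have hAx0 : 0 < fiCount x := lt_of_lt_of_le (by positivity) hA
  -- `τ`-bounds in the three ranges
  have hτX : ∀ n : ℕ, 1 ≤ n → n ≤ X → (σ 0 n : ℝ) ≤ τ := fun n hn hnX =>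
    hτb n hn ((Nat.cast_le.mpr hnX).trans hXx)
  have hτ₁ : ∀ l : ℕ, 1 ≤ l → l ≤ Λ₁ → (σ 0 l : ℝ) ≤ τ := fun l hl hlΛ =>
    hτb l hl (((Nat.cast_le.mpr hlΛ).trans hΛ₁le).trans
      (Real.rpow_le_self_of_one_le hx1 (by norm_num)))
  -- `√(Σ a_n²) ≤ A(x) / (c x^{1/3})`
  have hsq : Real.sqrt (∑ n ∈ Icc 1 X, (fiRepCount n : ℝ) ^ 2) ≤ fiCount x / (c * x ^ (1 / 3 : ℝ)) := by
    rw [le_div_iff₀ (by positivity)]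
    calc Real.sqrt (∑ n ∈ Icc 1 X, (fiRepCount n : ℝ) ^ 2) * (c * x ^ (1 / 3 : ℝ))
        = c * x ^ (1 / 3 : ℝ) * Real.sqrt (∑ n ∈ Icc 1 ⌊x⌋₊, (fiRepCount n : ℝ) ^ 2) := by rw [hX]; ring
      _ ≤ fiCount x := h22x
  -- `1 + log x ≤ u`, `G ≤ τ u`, `1 + G ≤ 2 τ u`
  have hG : ∀ D₀ : ℕ, (D₀ : ℝ) ≤ x → ∑ d ∈ (Icc 1 D₀).filter Squarefree, fiDensity d ≤ τ * u := by
    intro D₀ hD₀x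
    have hτD : ∀ d : ℕ, 1 ≤ d → d ≤ D₀ → (σ 0 d : ℝ) ≤ τ := fun d hd hdD =>
      hτb d hd ((Nat.cast_le.mpr hdD).trans hD₀x)
    refine (sum_fiDensity_le D₀ hτ0 hτD).trans (mul_le_mul_of_nonneg_left ?_ hτ0)
    rcases Nat.eq_zero_or_pos D₀ with h0 | hpos
    · rw [h0]; simp; linarith
    · have : Real.log D₀ ≤ Real.log x := Real.log_le_log (by exact_mod_cast hpos) hD₀x
      linarith
  -- common small factors
  have hsqrtΛ : 1 / Real.sqrt Λ ≤ Real.sqrt 2 * u ^ (-(10 : ℝ)) := by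
    -- `Λ ≥ x^{1/100}/2 = u^20/2`
    have h1 : u ^ (20 : ℝ) / 2 ≤ Λ := by rw [← show x ^ (1 / 100 : ℝ) = u ^ (20 : ℝ) by rw [hxu]; norm_num]; exact hΛge
    have h2 : Real.sqrt (u ^ (20 : ℝ) / 2) ≤ Real.sqrt Λ := Real.sqrt_le_sqrt h1
    have h3 : Real.sqrt (u ^ (20 : ℝ) / 2) = u ^ (10 : ℝ) / Real.sqrt 2 := by
      rw [Real.sqrt_div' _ zero_le_two, Real.sqrt_eq_rpow, ← Real.rpow_mul hu0.le]; norm_num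
    rw [h3] at h2
    have hs2 : 0 < Real.sqrt 2 := by positivity
    have hu10 : 0 < u ^ (10 : ℝ) := by positivity
    rw [div_le_iff₀ (Real.sqrt_pos.mpr hΛpos), Real.rpow_neg hu0.le]
    calc 1 = Real.sqrt 2 * (u ^ (10 : ℝ))⁻¹ * (u ^ (10 : ℝ) / Real.sqrt 2) := by field_simp
      _ ≤ Real.sqrt 2 * (u ^ (10 : ℝ))⁻¹ * Real.sqrt Λ := by gcongr
  have hinvΛ : 1 / (Λ : ℝ) ≤ 2 * u ^ (-(20 : ℝ)) := by
    have h1 : u ^ (20 : ℝ) / 2 ≤ Λ := by rw [← show x ^ (1 / 100 : ℝ) = u ^ (20 : ℝ) by rw [hxu]; norm_num]; exact hΛge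
    have hu20 : 0 < u ^ (20 : ℝ) := by positivity
    rw [div_le_iff₀ hΛpos, Real.rpow_neg hu0.le]
    calc 1 = 2 * (u ^ (20 : ℝ))⁻¹ * (u ^ (20 : ℝ) / 2) := by field_simp
      _ ≤ 2 * (u ^ (20 : ℝ))⁻¹ * Λ := by gcongr
  have hXΛ₁ : Real.sqrt (X / Λ₁) ≤ Real.sqrt 2 * u ^ ((1970 : ℝ) / 3) := by
    -- `X/Λ₁ ≤ x / (x^{103/300}/2) = 2 x^{197/300} = 2 u^{3940/3}`
    have h1 : (X : ℝ) / Λ₁ ≤ 2 * u ^ ((3940 : ℝ) / 3) := by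
      rw [div_le_iff₀ hΛ₁pos]
      have h2 : x = u ^ ((3940 : ℝ) / 3) * x ^ (103 / 300 : ℝ) := by
        rw [hxu (103 / 300), ← Real.rpow_add hu0]
        rw [show ((3940 : ℝ) / 3 + 2000 * (103 / 300)) = 2000 * 1 by norm_num, ← hxu, Real.rpow_one]
      calc (X : ℝ) ≤ x := hXx
        _ = u ^ ((3940 : ℝ) / 3) * x ^ (103 / 300 : ℝ) := h2
        _ ≤ u ^ ((3940 : ℝ) / 3) * (2 * Λ₁) := by gcongr; linarith
        _ = 2 * u ^ ((3940 : ℝ) / 3) * Λ₁ := by ring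
    calc Real.sqrt (X / Λ₁) ≤ Real.sqrt (2 * u ^ ((3940 : ℝ) / 3)) := Real.sqrt_le_sqrt h1
      _ = Real.sqrt 2 * Real.sqrt (u ^ ((3940 : ℝ) / 3)) := Real.sqrt_mul' 2 (by positivity)
      _ = Real.sqrt 2 * u ^ ((1970 : ℝ) / 3) := by
          rw [Real.sqrt_eq_rpow (u ^ _), ← Real.rpow_mul hu0.le]; norm_num
  -- integer powers of `u`
  have hu4 : u ^ (-(4 : ℝ)) = (u ^ 4)⁻¹ := by rw [Real.rpow_neg hu0.le]; norm_cast
  have hu10 : u ^ (-(10 : ℝ)) = (u ^ 10)⁻¹ := by rw [Real.rpow_neg hu0.le]; norm_cast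
  have hu20 : u ^ (-(20 : ℝ)) = (u ^ 20)⁻¹ := by rw [Real.rpow_neg hu0.le]; norm_cast
  have hx500 : x ^ (-(1 / 500 : ℝ)) = (u ^ 4)⁻¹ := by
    rw [← hu4, hxu]; norm_num
  have hx1000 : x ^ (1 / 1000 : ℝ) = u ^ 2 := by rw [hxu]; norm_num
  have hx11 : x ^ (11 / 2000 : ℝ) = u ^ 11 := by rw [hxu]; norm_num
  rw [hx1000] at hn3 hn7
  rw [hx11] at hn5
  rw [hu10] at hsqrtΛ
  rw [hu20] at hinvΛ
  -- the five majorants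
  obtain ⟨e, he⟩ : ∃ e : ℝ, e = 9 / 16 + 1 / 1000 := ⟨_, rfl⟩
  obtain ⟨A, hAdef⟩ : ∃ A : ℝ, A = fiCount x := ⟨_, rfl⟩
  have hApos : 0 < A := hAdef ▸ hAx0
  obtain ⟨B1, hB1⟩ : ∃ B1 : ℝ, B1 = A * (E₀ * (Real.sqrt 2 * (u ^ 10)⁻¹) * (τ * u)) := ⟨_, rfl⟩
  obtain ⟨B2, hB2⟩ : ∃ B2 : ℝ, B2 = τ ^ 2 * (K * x ^ (71 / 400 : ℝ) * x ^ e) := ⟨_, rfl⟩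
  obtain ⟨B3, hB3⟩ : ∃ B3 : ℝ, B3 = A * (τ ^ 2 * (2 * (u ^ 20)⁻¹)) := ⟨_, rfl⟩
  obtain ⟨B4, hB4⟩ : ∃ B4 : ℝ, B4 = K * x ^ (103 / 600 : ℝ) * x ^ e := ⟨_, rfl⟩
  obtain ⟨B5, hB5⟩ : ∃ B5 : ℝ, B5 = τ * (Real.sqrt 2 * (u ^ 10)⁻¹) * (A / c) := ⟨_, rfl⟩
  have hxe0 : 0 < x ^ e := Real.rpow_pos_of_pos hx0 _
  have hA34 : 2 * friedlanderIwaniecKappa * x ^ (3 / 4 : ℝ) ≤ A := hAdef ▸ hA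
  -- key inequalities: each majorant, times `2 τ u`, is at most `A u⁻⁴ / 5`
  have key1 : 2 * τ * u * B1 ≤ A * (u ^ 4)⁻¹ / 5 := by
    rw [hB1, hτ]
    have hf : 10 * Real.sqrt 2 * C ^ 2 * E₀ / u ^ 2 ≤ 1 := by
      rw [div_le_one (by positivity)]; exact hn3
    have heq : 2 * (C * u) * u * (A * (E₀ * (Real.sqrt 2 * (u ^ 10)⁻¹) * (C * u * u))) =
        (A * (u ^ 4)⁻¹ / 5) * (10 * Real.sqrt 2 * C ^ 2 * E₀ / u ^ 2) := by
      field_simp; ring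
    rw [heq]
    exact mul_le_of_le_one_right (by positivity) hf
  have key3 : 2 * τ * u * (τ * B3) ≤ A * (u ^ 4)⁻¹ / 5 := by
    rw [hB3, hτ]
    have hf : 20 * C ^ 4 / u ^ 11 ≤ 1 := by rw [div_le_one (by positivity)]; exact hn5
    have heq : 2 * (C * u) * u * (C * u * (A * ((C * u) ^ 2 * (2 * (u ^ 20)⁻¹)))) =
        (A * (u ^ 4)⁻¹ / 5) * (20 * C ^ 4 / u ^ 11) := by
      field_simp; ring
    rw [heq]
    exact mul_le_of_le_one_right (by positivity) hf
  have key5 : 2 * τ * u * (τ * B5) ≤ A * (u ^ 4)⁻¹ / 5 := by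
    rw [hB5, hτ]
    have hf : 10 * Real.sqrt 2 * C ^ 3 / c / u ^ 2 ≤ 1 := by
      rw [div_le_one (by positivity)]; exact hn7
    have heq : 2 * (C * u) * u * (C * u * (C * u * (Real.sqrt 2 * (u ^ 10)⁻¹) * (A / c))) =
        (A * (u ^ 4)⁻¹ / 5) * (10 * Real.sqrt 2 * C ^ 3 / c / u ^ 2) := by
      field_simp; ring
    rw [heq]
    exact mul_le_of_le_one_right (by positivity) hf
  -- for `key2`, `key4` compare powers of `x`
  have hu4x : (u ^ 4)⁻¹ = x ^ (-(1 / 500 : ℝ)) := hx500.symm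
  have hτu : 2 * τ * u = 2 * C * x ^ (1 / 1000 : ℝ) := by rw [hτ, hx1000]; ring
  have key2 : 2 * τ * u * B2 ≤ A * (u ^ 4)⁻¹ / 5 := by
    rw [hB2, hu4x, hτu, hτ, mul_pow, ← hx1000]
    -- `LHS = 2 C³ K x^{1/1000 + 1/1000 + 71/400 + e}` and `1/1000+1/1000+71/400+e + 1/200 = 3/4 - 1/500`
    have hlhs : 2 * C * x ^ (1 / 1000 : ℝ) * (C ^ 2 * x ^ (1 / 1000 : ℝ) * (K * x ^ (71 / 400 : ℝ) * x ^ e)) =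
        2 * C ^ 3 * K * x ^ (743 / 1000 : ℝ) := by
      have : x ^ (1 / 1000 : ℝ) * x ^ (1 / 1000 : ℝ) * x ^ (71 / 400 : ℝ) * x ^ e = x ^ (743 / 1000 : ℝ) := by
        rw [← Real.rpow_add hx0, ← Real.rpow_add hx0, ← Real.rpow_add hx0, he]; norm_num
      rw [← this]; ring
    rw [hlhs]
    have hrhs : 2 * friedlanderIwaniecKappa * x ^ (3 / 4 : ℝ) * x ^ (-(1 / 500 : ℝ)) / 5 ≤
        A * x ^ (-(1 / 500 : ℝ)) / 5 := by gcongr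
    refine le_trans ?_ hrhs
    have h5 : 5 * C ^ 3 * K ≤ friedlanderIwaniecKappa * x ^ (1 / 200 : ℝ) := by
      rw [div_le_iff₀ hκ] at hn4; linarith
    have hsplit : x ^ (3 / 4 : ℝ) * x ^ (-(1 / 500 : ℝ)) = x ^ (1 / 200 : ℝ) * x ^ (743 / 1000 : ℝ) := by
      rw [← Real.rpow_add hx0, ← Real.rpow_add hx0]; norm_num
    have hx743 : 0 < x ^ (743 / 1000 : ℝ) := Real.rpow_pos_of_pos hx0 _
    calc 2 * C ^ 3 * K * x ^ (743 / 1000 : ℝ) = (2 / 5) * (5 * C ^ 3 * K) * x ^ (743 / 1000 : ℝ) := by ring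
      _ ≤ (2 / 5) * (friedlanderIwaniecKappa * x ^ (1 / 200 : ℝ)) * x ^ (743 / 1000 : ℝ) := by gcongr
      _ = 2 * friedlanderIwaniecKappa * x ^ (3 / 4 : ℝ) * x ^ (-(1 / 500 : ℝ)) / 5 := by
          rw [mul_assoc (2 * friedlanderIwaniecKappa), hsplit]; ring
  have key4 : 2 * τ * u * (τ * B4) ≤ A * (u ^ 4)⁻¹ / 5 := by
    rw [hB4, hu4x, hτu, hτ, hu]
    have hlhs : 2 * C * x ^ (1 / 1000 : ℝ) * (C * x ^ (1 / 2000 : ℝ) * (K * x ^ (103 / 600 : ℝ) * x ^ e)) =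
        2 * C ^ 2 * K * x ^ (4420 / 6000 : ℝ) := by
      have : x ^ (1 / 1000 : ℝ) * x ^ (1 / 2000 : ℝ) * x ^ (103 / 600 : ℝ) * x ^ e = x ^ (4420 / 6000 : ℝ) := by
        rw [← Real.rpow_add hx0, ← Real.rpow_add hx0, ← Real.rpow_add hx0, he]; norm_num
      rw [← this]; ring
    rw [hlhs]
    have hrhs : 2 * friedlanderIwaniecKappa * x ^ (3 / 4 : ℝ) * x ^ (-(1 / 500 : ℝ)) / 5 ≤
        A * x ^ (-(1 / 500 : ℝ)) / 5 := by gcongr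
    refine le_trans ?_ hrhs
    have h5 : 5 * C ^ 2 * K ≤ friedlanderIwaniecKappa * x ^ (17 / 1500 : ℝ) := by
      rw [div_le_iff₀ hκ] at hn6; linarith
    have hsplit : x ^ (3 / 4 : ℝ) * x ^ (-(1 / 500 : ℝ)) = x ^ (17 / 1500 : ℝ) * x ^ (4420 / 6000 : ℝ) := by
      rw [← Real.rpow_add hx0, ← Real.rpow_add hx0]; norm_num
    have hx4420 : 0 < x ^ (4420 / 6000 : ℝ) := Real.rpow_pos_of_pos hx0 _
    calc 2 * C ^ 2 * K * x ^ (4420 / 6000 : ℝ) = (2 / 5) * (5 * C ^ 2 * K) * x ^ (4420 / 6000 : ℝ) := by ring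
      _ ≤ (2 / 5) * (friedlanderIwaniecKappa * x ^ (17 / 1500 : ℝ)) * x ^ (4420 / 6000 : ℝ) := by gcongr
      _ = 2 * friedlanderIwaniecKappa * x ^ (3 / 4 : ℝ) * x ^ (-(1 / 500 : ℝ)) / 5 := by
          rw [mul_assoc (2 * friedlanderIwaniecKappa), hsplit]; ring
  have hkeys : 2 * τ * u * (B1 + B2 + τ * (B3 + B4 + B5)) ≤ A * x ^ (-(1 / 500 : ℝ)) := by
    rw [← hu4x]
    have : 2 * τ * u * (B1 + B2 + τ * (B3 + B4 + B5)) =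
        2 * τ * u * B1 + 2 * τ * u * B2 + 2 * τ * u * (τ * B3) + 2 * τ * u * (τ * B4) +
          2 * τ * u * (τ * B5) := by ring
    rw [this]; linarith only [key1, key2, key3, key4, key5]
  -- nonnegativity of the majorants
  have hB1n : 0 ≤ B1 := by rw [hB1]; positivity
  have hB2n : 0 ≤ B2 := by rw [hB2]; positivity
  have hB3n : 0 ≤ B3 := by rw [hB3]; positivity
  have hB4n : 0 ≤ B4 := by rw [hB4]; positivity
  have hB5n : 0 ≤ B5 := by rw [hB5]; positivity
  -- common estimates for the two parts
  -- remainders at a level `N ≤ x^{71/100}`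
  have hR : ∀ (N : ℕ) (s : ℝ), 1 ≤ N → (N : ℝ) ≤ x ^ (71 / 100 : ℝ) → s ≤ x →
      ∑ b ∈ (Icc 1 N).filter IsCubefree, |fiSieveSeq.remainder b s| ≤
        K * x ^ (71 / 400 : ℝ) * x ^ e := by
    intro N s hN1 hNx hs
    have h := hKx (N : ℝ) (by exact_mod_cast hN1) s hs
    rw [Nat.floor_natCast] at h
    refine h.trans ?_
    have hN4 : (N : ℝ) ^ (1 / 4 : ℝ) ≤ x ^ (71 / 400 : ℝ) := by
      calc (N : ℝ) ^ (1 / 4 : ℝ) ≤ (x ^ (71 / 100 : ℝ)) ^ (1 / 4 : ℝ) :=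
            Real.rpow_le_rpow (Nat.cast_nonneg _) hNx (by norm_num)
        _ = x ^ (71 / 400 : ℝ) := by rw [← Real.rpow_mul hx0.le]; norm_num
    rw [he]
    calc K₀ * (N : ℝ) ^ (1 / 4 : ℝ) * x ^ (9 / 16 + 1 / 1000 : ℝ)
        ≤ K * (N : ℝ) ^ (1 / 4 : ℝ) * x ^ (9 / 16 + 1 / 1000 : ℝ) := by
          gcongr; exact le_max_left _ _
      _ ≤ K * x ^ (71 / 400 : ℝ) * x ^ (9 / 16 + 1 / 1000 : ℝ) := by gcongr
  have hΛ₁sq : ((Λ₁ ^ 2 : ℕ) : ℝ) ≤ x ^ (71 / 100 : ℝ) := by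
    push_cast
    calc (Λ₁ : ℝ) ^ 2 ≤ (x ^ (103 / 300 : ℝ)) ^ 2 := by gcongr
      _ = x ^ (206 / 300 : ℝ) := by rw [← Real.rpow_natCast, ← Real.rpow_mul hx0.le]; norm_num
      _ ≤ x ^ (71 / 100 : ℝ) := Real.rpow_le_rpow_of_exponent_le hx1 (by norm_num)
  have hΛsq : ((Λ ^ 2 : ℕ) : ℝ) ≤ x ^ (71 / 100 : ℝ) := by
    push_cast
    calc (Λ : ℝ) ^ 2 ≤ (x ^ (1 / 100 : ℝ)) ^ 2 := by gcongr
      _ = x ^ (2 / 100 : ℝ) := by rw [← Real.rpow_natCast, ← Real.rpow_mul hx0.le]; norm_num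
      _ ≤ x ^ (71 / 100 : ℝ) := Real.rpow_le_rpow_of_exponent_le hx1 (by norm_num)
  -- `R(Λ₁², x) ≤ B4` (indeed `≤ K x^{103/600} x^e`)
  have hR4 : ∑ b ∈ (Icc 1 (Λ₁ ^ 2)).filter IsCubefree, |fiSieveSeq.remainder b x| ≤ B4 := by
    have h := hKx ((Λ₁ ^ 2 : ℕ) : ℝ) (by exact_mod_cast Nat.one_le_pow _ _ hΛ₁1) x le_rfl
    rw [Nat.floor_natCast] at h
    refine h.trans ?_
    have hN4 : ((Λ₁ ^ 2 : ℕ) : ℝ) ^ (1 / 4 : ℝ) ≤ x ^ (103 / 600 : ℝ) := by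
      push_cast
      calc ((Λ₁ : ℝ) ^ 2) ^ (1 / 4 : ℝ) ≤ ((x ^ (103 / 300 : ℝ)) ^ 2) ^ (1 / 4 : ℝ) := by gcongr
        _ = x ^ (103 / 600 : ℝ) := by
            rw [← Real.rpow_natCast, ← Real.rpow_mul hx0.le, ← Real.rpow_mul hx0.le]; norm_num
    rw [hB4, he]
    calc K₀ * ((Λ₁ ^ 2 : ℕ) : ℝ) ^ (1 / 4 : ℝ) * x ^ (9 / 16 + 1 / 1000 : ℝ)
        ≤ K * ((Λ₁ ^ 2 : ℕ) : ℝ) ^ (1 / 4 : ℝ) * x ^ (9 / 16 + 1 / 1000 : ℝ) := by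
          gcongr; exact le_max_left _ _
      _ ≤ K * x ^ (103 / 600 : ℝ) * x ^ (9 / 16 + 1 / 1000 : ℝ) := by gcongr
  -- `T3 ≤ B3` and `T5 ≤ B5`
  rw [← hAdef] at hsq
  have hT3 : A * (τ ^ 2 / Λ) ≤ B3 := by
    rw [hB3, div_eq_mul_one_div]
    exact mul_le_mul_of_nonneg_left (mul_le_mul_of_nonneg_left hinvΛ (sq_nonneg _)) hApos.le
  have hT5 : τ * Real.sqrt (X / Λ₁) * Real.sqrt (∑ n ∈ Icc 1 X, (fiRepCount n : ℝ) ^ 2) ≤ B5 := by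
    rw [hB5]
    have h1 : Real.sqrt (X / Λ₁) * Real.sqrt (∑ n ∈ Icc 1 X, (fiRepCount n : ℝ) ^ 2) ≤
        (Real.sqrt 2 * u ^ ((1970 : ℝ) / 3)) * (A / (c * x ^ (1 / 3 : ℝ))) :=
      mul_le_mul hXΛ₁ hsq (Real.sqrt_nonneg _) (by positivity)
    have h2 : (Real.sqrt 2 * u ^ ((1970 : ℝ) / 3)) * (A / (c * x ^ (1 / 3 : ℝ))) =
        (Real.sqrt 2 * (u ^ 10)⁻¹) * (A / c) := by
      rw [hxu (1 / 3), ← hu10]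
      have : u ^ ((1970 : ℝ) / 3) / u ^ (2000 * (1 / 3) : ℝ) = u ^ (-(10 : ℝ)) := by
        rw [← Real.rpow_sub hu0]; norm_num
      rw [← this]; field_simp
    calc τ * Real.sqrt (X / Λ₁) * Real.sqrt (∑ n ∈ Icc 1 X, (fiRepCount n : ℝ) ^ 2)
        = τ * (Real.sqrt (X / Λ₁) * Real.sqrt (∑ n ∈ Icc 1 X, (fiRepCount n : ℝ) ^ 2)) := by ring
      _ ≤ τ * ((Real.sqrt 2 * (u ^ 10)⁻¹) * (A / c)) := mul_le_mul_of_nonneg_left (h1.trans_eq h2) hτ0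
      _ = _ := by ring
  refine ⟨fun t htx D₀ hD₀1 hD₀x69 => ?_, fun t htx => ?_⟩
  · -- (a) the level sum
    have hD₀x : (D₀ : ℝ) ≤ x := hD₀x69.trans (Real.rpow_le_self_of_one_le hx1 (by norm_num))
    have hD₀X : D₀ ≤ X := Nat.le_floor hD₀x
    have hM1 : 1 ≤ D₀ * Λ ^ 2 := Nat.one_le_iff_ne_zero.mpr (mul_ne_zero (by omega) (pow_ne_zero 2 (by omega)))
    have hMx : ((D₀ * Λ ^ 2 : ℕ) : ℝ) ≤ x ^ (71 / 100 : ℝ) := by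
      push_cast
      calc (D₀ : ℝ) * (Λ : ℝ) ^ 2 ≤ x ^ (69 / 100 : ℝ) * (x ^ (1 / 100 : ℝ)) ^ 2 := by gcongr
        _ = x ^ (71 / 100 : ℝ) := by
            rw [← Real.rpow_natCast, ← Real.rpow_mul hx0.le, ← Real.rpow_add hx0]; norm_num
    have hMx' : ((D₀ * Λ ^ 2 : ℕ) : ℝ) ≤ x := hMx.trans (Real.rpow_le_self_of_one_le hx1 (by norm_num))
    have hτM : ∀ b : ℕ, 1 ≤ b → b ≤ D₀ * Λ ^ 2 → (σ 0 b : ℝ) ≤ τ := fun b hb hbM =>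
      hτb b hb ((Nat.cast_le.mpr hbM).trans hMx')
    have hraw := levelSum_le_raw hx1 htx hD₀1 hD₀X hΛ1 hΛ₁1 hτ0 hτ0 hτX hτM hτ₁
    rw [← hAdef] at hraw
    have hG0 : 0 ≤ ∑ d ∈ (Icc 1 D₀).filter Squarefree, fiDensity d :=
      Finset.sum_nonneg fun d hd => fiDensity_squarefree_nonneg (Finset.mem_filter.mp hd).2
    have hGle : ∑ d ∈ (Icc 1 D₀).filter Squarefree, fiDensity d ≤ τ * u := hG D₀ hD₀x
    have h1G : 1 + ∑ d ∈ (Icc 1 D₀).filter Squarefree, fiDensity d ≤ 2 * τ * u := by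
      linarith only [hGle, hτu1]
    -- the pieces
    have hT1 : A * (E₀ / Real.sqrt Λ * ∑ d ∈ (Icc 1 D₀).filter Squarefree, fiDensity d) ≤ B1 := by
      rw [hB1, div_eq_mul_one_div]
      refine mul_le_mul_of_nonneg_left ?_ hApos.le
      exact mul_le_mul (mul_le_mul_of_nonneg_left hsqrtΛ hE₀0.le) hGle hG0 (by positivity)
    have hT2 : τ ^ 2 * ∑ b ∈ (Icc 1 (D₀ * Λ ^ 2)).filter IsCubefree, |fiSieveSeq.remainder b t| ≤ B2 := by
      rw [hB2]
      exact mul_le_mul_of_nonneg_left (hR _ t hM1 hMx htx) (sq_nonneg _)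
    have hinner : A * (E₀ / Real.sqrt Λ * ∑ d ∈ (Icc 1 D₀).filter Squarefree, fiDensity d) +
        τ ^ 2 * ∑ b ∈ (Icc 1 (D₀ * Λ ^ 2)).filter IsCubefree, |fiSieveSeq.remainder b t| +
        τ * (A * (τ ^ 2 / Λ) + ∑ b ∈ (Icc 1 (Λ₁ ^ 2)).filter IsCubefree, |fiSieveSeq.remainder b x| +
          τ * Real.sqrt (X / Λ₁) * Real.sqrt (∑ n ∈ Icc 1 X, (fiRepCount n : ℝ) ^ 2)) ≤
        B1 + B2 + τ * (B3 + B4 + B5) := by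
      have := mul_le_mul_of_nonneg_left (add_le_add (add_le_add hT3 hR4) hT5) hτ0
      linarith only [this, hT1, hT2]
    have hinner0 : 0 ≤ B1 + B2 + τ * (B3 + B4 + B5) := by positivity
    refine hraw.trans ?_
    rw [hAdef] at hkeys
    refine le_trans (mul_le_mul_of_nonneg_left hinner (by linarith only [hG0])) ?_
    exact (mul_le_mul_of_nonneg_right h1G hinner0).trans hkeys
  · -- (b) `A'(t)` against `P A(t)`
    have hτM : ∀ b : ℕ, 1 ≤ b → b ≤ Λ ^ 2 → (σ 0 b : ℝ) ≤ τ := fun b hb hbM =>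
      hτb b hb ((Nat.cast_le.mpr hbM).trans (hΛsq.trans (Real.rpow_le_self_of_one_le hx1 (by norm_num))))
    have hraw := abs_fiCountSq_sub_le_raw hx1 htx hΛ1 hΛ₁1 hτ0 hτ0 hτX hτM hτ₁
    have hT1 : A * (E₀ / Real.sqrt Λ) ≤ B1 := by
      rw [hB1, div_eq_mul_one_div]
      refine mul_le_mul_of_nonneg_left ?_ hApos.le
      calc E₀ * (1 / Real.sqrt Λ) ≤ E₀ * (Real.sqrt 2 * (u ^ 10)⁻¹) := mul_le_mul_of_nonneg_left hsqrtΛ hE₀0.le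
        _ = E₀ * (Real.sqrt 2 * (u ^ 10)⁻¹) * 1 := (mul_one _).symm
        _ ≤ E₀ * (Real.sqrt 2 * (u ^ 10)⁻¹) * (τ * u) :=
            mul_le_mul_of_nonneg_left hτu1 (by positivity)
    have hT2 : τ ^ 2 * ∑ b ∈ (Icc 1 (Λ ^ 2)).filter IsCubefree, |fiSieveSeq.remainder b t| ≤ B2 := by
      rw [hB2]
      exact mul_le_mul_of_nonneg_left (hR _ t (Nat.one_le_pow _ _ hΛ1) hΛsq htx) (sq_nonneg _)
    have hinner : A * (E₀ / Real.sqrt Λ) +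
        τ ^ 2 * ∑ b ∈ (Icc 1 (Λ ^ 2)).filter IsCubefree, |fiSieveSeq.remainder b t| +
        τ * (A * (τ ^ 2 / Λ) + ∑ b ∈ (Icc 1 (Λ₁ ^ 2)).filter IsCubefree, |fiSieveSeq.remainder b x| +
          τ * Real.sqrt (X / Λ₁) * Real.sqrt (∑ n ∈ Icc 1 X, (fiRepCount n : ℝ) ^ 2)) ≤
        B1 + B2 + τ * (B3 + B4 + B5) := by
      have := mul_le_mul_of_nonneg_left (add_le_add (add_le_add hT3 hR4) hT5) hτ0
      linarith only [this, hT1, hT2]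
    have hinner0 : 0 ≤ B1 + B2 + τ * (B3 + B4 + B5) := by positivity
    have h12 : (1 : ℝ) ≤ 2 * τ * u := by linarith only [hτu1]
    rw [← hAdef] at hraw
    refine hraw.trans (hinner.trans ?_)
    rw [hAdef] at hkeys
    calc B1 + B2 + τ * (B3 + B4 + B5) = 1 * (B1 + B2 + τ * (B3 + B4 + B5)) := (one_mul _).symm
      _ ≤ (2 * τ * u) * (B1 + B2 + τ * (B3 + B4 + B5)) := mul_le_mul_of_nonneg_right h12 hinner0
      _ ≤ fiCount x * x ^ (-(1 / 500 : ℝ)) := hkeys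

end Literature.NumberTheory.Sieve.FriedlanderIwaniecPrimesSquarefree

/-! ## Part G: the hypotheses of Proposition 2.1 for `a'` -/

namespace Literature.NumberTheory.Sieve.FriedlanderIwaniecPrimesSquarefree

open FriedlanderIwaniecPrimes
open scoped ArithmeticFunction.sigma ArithmeticFunction.Moebius ArithmeticFunction.omega

/-! ### (2.7) for `g'` -/

/-- `(log y)^{10} ≤ 10^{10} y` for `y ≥ 1`. [folklore] -/
theorem log_pow_ten_le {y : ℝ} (hy : 1 ≤ y) : Real.log y ^ 10 ≤ 10 ^ 10 * y := by
  have h := Real.log_le_rpow_div (by linarith : (0 : ℝ) ≤ y) (by norm_num : (0 : ℝ) < 1 / 10)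
  have hlog : 0 ≤ Real.log y := Real.log_nonneg hy
  have hy0 : 0 < y := by linarith
  calc Real.log y ^ 10 ≤ (y ^ (1 / 10 : ℝ) / (1 / 10)) ^ 10 := by gcongr
    _ = 10 ^ 10 * (y ^ (1 / 10 : ℝ)) ^ 10 := by ring
    _ = 10 ^ 10 * y := by
        rw [← Real.rpow_natCast (y ^ (1 / 10 : ℝ)) 10, ← Real.rpow_mul hy0.le]; norm_num

/-- **(2.7) for `g'`** from (2.7) for `g` (`FriedlanderIwaniec1998_hyp27`): since
`0 ≤ g(p) - g'(p) ≤ 3/p²`, `Σ_{p ≤ y} g'(p) = log log y + c' + O((log y)^{-10})` with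
`c' = c - Σ_p (g(p) - g'(p))`. [cite: FriedlanderIwaniecAnnals1998, (2.7)] -/
theorem hyp27_sq (h27 : FriedlanderIwaniec1998_hyp27) :
    ∃ c K : ℝ, ∀ y : ℝ, 2 ≤ y →
      |(∑ p ∈ Nat.primesLE ⌊y⌋₊, fiDensitySq p) - (Real.log (Real.log y) + c)| ≤
        K / Real.log y ^ 10 := by
  obtain ⟨c, K, h⟩ := h27
  set δ : ℕ → ℝ := fun n => if n.Prime then fiDensity n - fiDensitySq n else 0 with hδ
  have hδ0 : ∀ n, 0 ≤ δ n := by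
    intro n; simp only [hδ]; split_ifs with hp
    · linarith [fiDensitySq_prime_le hp]
    · exact le_rfl
  have hδle : ∀ n, δ n ≤ 3 * ((n : ℝ) ^ 2)⁻¹ := by
    intro n; simp only [hδ]; split_ifs with hp
    · calc fiDensity n - fiDensitySq n ≤ fiDensity (n ^ 2) := fiDensity_prime_sub_fiDensitySq_le hp
        _ ≤ 3 / (n : ℝ) ^ 2 := (fiDensity_hyp2526 hp).2
        _ = 3 * ((n : ℝ) ^ 2)⁻¹ := div_eq_mul_inv _ _
    · positivity
  have hsum : Summable δ :=
    Summable.of_nonneg_of_le hδ0 hδle ((Real.summable_nat_pow_inv.mpr one_lt_two).mul_left 3)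
  set Δ := ∑' n, δ n with hΔ
  refine ⟨c - Δ, K + 6 * 10 ^ 10, fun y hy => ?_⟩
  obtain ⟨hy1, hyle, hyge⟩ := floor_facts hy
  set N := ⌊y⌋₊ + 1 with hN
  have hlog0 : 0 < Real.log y := Real.log_pos (by linarith)
  -- `Σ_{p ≤ y} g'(p) = Σ_{p ≤ y} g(p) - Σ_{n < N} δ(n)`
  have hsplit : ∑ p ∈ Nat.primesLE ⌊y⌋₊, fiDensitySq p =
      ∑ p ∈ Nat.primesLE ⌊y⌋₊, fiDensity p - ∑ n ∈ Finset.range N, δ n := by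
    rw [Nat.primesLE, Nat.primesBelow, Finset.sum_filter, Finset.sum_filter, ← Finset.sum_sub_distrib]
    refine Finset.sum_congr rfl fun n _ => ?_
    simp only [hδ]; split_ifs <;> ring
  -- the tail
  have htail : Δ - ∑ n ∈ Finset.range N, δ n = ∑' n, δ (n + N) := by
    rw [hΔ, ← hsum.sum_add_tsum_nat_add N]; ring
  have htail0 : 0 ≤ ∑' n, δ (n + N) := tsum_nonneg fun n => hδ0 _
  have htail1 : ∑' n, δ (n + N) ≤ 3 / ⌊y⌋₊ := by
    refine Real.tsum_le_of_sum_range_le (fun n => hδ0 _) fun n => ?_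
    calc ∑ i ∈ Finset.range n, δ (i + N) ≤ ∑ i ∈ Finset.range n, 3 * (((i + N : ℕ) : ℝ) ^ 2)⁻¹ :=
          Finset.sum_le_sum fun i _ => hδle _
      _ = 3 * ∑ k ∈ Finset.Ico N (N + n), ((k : ℝ) ^ 2)⁻¹ := by
          rw [Finset.mul_sum, Finset.sum_Ico_eq_sum_range]
          simp only [add_tsub_cancel_left]
          refine Finset.sum_congr rfl fun i _ => ?_
          rw [add_comm i N]
      _ = 3 * ∑ k ∈ Finset.Ioc ⌊y⌋₊ (⌊y⌋₊ + n), ((k : ℝ) ^ 2)⁻¹ := by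
          congr 1
          refine Finset.sum_congr ?_ fun _ _ => rfl
          ext k; simp only [hN, Finset.mem_Ico, Finset.mem_Ioc]; omega
      _ ≤ 3 * ((⌊y⌋₊ : ℝ)⁻¹ - ((⌊y⌋₊ + n : ℕ) : ℝ)⁻¹) := by
          gcongr
          exact sum_Ioc_inv_sq_le_sub (by omega) (Nat.le_add_right _ _)
      _ ≤ 3 / ⌊y⌋₊ := by
          rw [div_eq_mul_inv]
          have : (0 : ℝ) ≤ ((⌊y⌋₊ + n : ℕ) : ℝ)⁻¹ := by positivity
          linarith
  -- `3/⌊y⌋ ≤ 6/y ≤ 6·10¹⁰ / (log y)^10`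
  have htail2 : ∑' n, δ (n + N) ≤ 6 * 10 ^ 10 / Real.log y ^ 10 := by
    refine htail1.trans ?_
    have hfl : (0 : ℝ) < ⌊y⌋₊ := by exact_mod_cast hy1
    rw [div_le_div_iff₀ hfl (pow_pos hlog0 10)]
    have := log_pow_ten_le (by linarith : (1 : ℝ) ≤ y)
    nlinarith
  -- assemble
  have hmain := h y hy
  rw [hsplit]
  have heq : ∑ p ∈ Nat.primesLE ⌊y⌋₊, fiDensity p - ∑ n ∈ Finset.range N, δ n -
      (Real.log (Real.log y) + (c - Δ)) =
      (∑ p ∈ Nat.primesLE ⌊y⌋₊, fiDensity p - (Real.log (Real.log y) + c)) + ∑' n, δ (n + N) := by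
    rw [← htail]; ring
  rw [heq, add_div]
  exact (abs_add_le _ _).trans (add_le_add hmain (by rwa [abs_of_nonneg htail0]))

/-! ### The size of `A'` -/

/-- **`A'(x) ≍ A(x)`**: assuming Proposition 3.5, for large `x`,
`e^{-7} A(x) ≤ A'(x) ≤ A(x)`, together with (4.2): `2κ x^{3/4} ≤ A(x) ≤ 6κ x^{3/4}`. [folklore] -/
theorem fiCountSq_bounds (h35 : FriedlanderIwaniec1998_prop35) :
    ∀ᶠ x : ℝ in atTop, Real.exp (-7) * fiCount x ≤ fiCountSq x ∧ fiCountSq x ≤ fiCount x ∧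
      2 * friedlanderIwaniecKappa * x ^ (3 / 4 : ℝ) ≤ fiCount x ∧
      fiCount x ≤ 6 * friedlanderIwaniecKappa * x ^ (3 / 4 : ℝ) := by
  have hε : ∀ᶠ x : ℝ in atTop, x ^ (-(1 / 500 : ℝ)) ≤ Real.exp (-6) - Real.exp (-7) := by
    have ht := tendsto_rpow_neg_atTop (show (0 : ℝ) < 1 / 500 by norm_num)
    have hpos : 0 < Real.exp (-6) - Real.exp (-7) := by
      have := Real.exp_lt_exp.mpr (show (-7 : ℝ) < -6 by norm_num); linarith
    exact (ht.eventually (ge_mem_nhds hpos)).mono fun x hx => by simpa using hx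
  filter_upwards [levelSq_and_countSq h35, fiCount_bounds FriedlanderIwaniec1998_count_asymp_holds, hε,
    eventually_ge_atTop (1 : ℝ)] with x hx hb hεx hx1
  refine ⟨?_, fiCountSq_le_fiCount x, hb.1, hb.2⟩
  have h := (abs_le.mp (hx.2 x le_rfl)).1
  have hP := exp_neg_six_le_fiSqProd ⌊x⌋₊
  have hA := fiCount_nonneg x
  have h1 : Real.exp (-6) * fiCount x ≤ fiSqProd ⌊x⌋₊ * fiCount x := mul_le_mul_of_nonneg_right hP hA
  have h2 : fiCount x * x ^ (-(1 / 500 : ℝ)) ≤ fiCount x * (Real.exp (-6) - Real.exp (-7)) :=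
    mul_le_mul_of_nonneg_left hεx hA
  nlinarith

/-! ### (2.1), (2.2), (2.8) for `a'` -/

/-- **(2.1) for `a'`**: `A'(x) ≫ A'(√x)(log x)²`. [cite: FriedlanderIwaniecAnnals1998, (2.1)] -/
theorem hyp21_sq (h35 : FriedlanderIwaniec1998_prop35) :
    ∃ c : ℝ, 0 < c ∧ ∀ᶠ x : ℝ in atTop,
      c * fiSieveSeqSq.size (Real.sqrt x) * Real.log x ^ 2 ≤ fiSieveSeqSq.size x := by
  refine ⟨1, one_pos, ?_⟩
  have hκ := friedlanderIwaniecKappa_pos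
  have hb := fiCountSq_bounds h35
  have hb' := (tendsto_rpow_atTop (by norm_num : (0 : ℝ) < 1 / 2)).eventually
    (fiCount_bounds FriedlanderIwaniec1998_count_asymp_holds)
  have hlog : ∀ᶠ x : ℝ in atTop, ‖Real.log x ^ 2‖ ≤ Real.exp (-7) / 3 * ‖x ^ (3 / 8 : ℝ)‖ := by
    refine ((isLittleO_log_rpow_rpow_atTop (s := 3 / 8) 2 (by norm_num)).congr_left
      fun x => ?_).def (by positivity)
    exact Real.rpow_two _
  filter_upwards [hb, hb', hlog, eventually_gt_atTop 0] with x h1 h2 h3 hx0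
  change 1 * fiCountSq (Real.sqrt x) * Real.log x ^ 2 ≤ fiCountSq x
  rw [Real.norm_eq_abs, Real.norm_eq_abs, abs_of_nonneg (by positivity),
    abs_of_nonneg (by positivity)] at h3
  have hs : (x ^ (1 / 2 : ℝ)) ^ (3 / 4 : ℝ) = x ^ (3 / 8 : ℝ) := by
    rw [← Real.rpow_mul hx0.le]; norm_num
  rw [Real.sqrt_eq_rpow]
  simp only [hs] at h2
  have hx34 : x ^ (3 / 4 : ℝ) = x ^ (3 / 8 : ℝ) * x ^ (3 / 8 : ℝ) := by
    rw [← Real.rpow_add hx0]; norm_num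
  have h38 : (0 : ℝ) ≤ x ^ (3 / 8 : ℝ) := by positivity
  have hA' : fiCountSq (x ^ (1 / 2 : ℝ)) ≤ 6 * friedlanderIwaniecKappa * x ^ (3 / 8 : ℝ) :=
    (fiCountSq_le_fiCount _).trans h2.2
  have hA'0 : 0 ≤ fiCountSq (x ^ (1 / 2 : ℝ)) := fiCountSq_nonneg _
  calc 1 * fiCountSq (x ^ (1 / 2 : ℝ)) * Real.log x ^ 2
      ≤ (6 * friedlanderIwaniecKappa * x ^ (3 / 8 : ℝ)) * (Real.exp (-7) / 3 * x ^ (3 / 8 : ℝ)) := by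
        rw [one_mul]
        exact mul_le_mul hA' h3 (by positivity) (by positivity)
    _ = Real.exp (-7) * (2 * friedlanderIwaniecKappa * x ^ (3 / 4 : ℝ)) := by rw [hx34]; ring
    _ ≤ Real.exp (-7) * fiCount x := mul_le_mul_of_nonneg_left h1.2.2.1 (Real.exp_pos _).le
    _ ≤ fiCountSq x := h1.1

/-- **(2.2) for `a'`** from (2.2) for `a` (`FriedlanderIwaniec1998_hyp22_holds`) and
`A(x) ≤ e⁷ A'(x)`. [cite: FriedlanderIwaniecAnnals1998, (2.2)] -/
theorem hyp22_sq (h35 : FriedlanderIwaniec1998_prop35) :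
    ∃ c : ℝ, 0 < c ∧ ∀ᶠ x : ℝ in atTop,
      c * x ^ (1 / 3 : ℝ) * Real.sqrt (∑ n ∈ Icc 1 ⌊x⌋₊, fiSieveSeqSq.a n ^ 2) ≤ fiSieveSeqSq.size x := by
  obtain ⟨c, hc, h22⟩ := FriedlanderIwaniec1998_hyp22_holds
  refine ⟨c * Real.exp (-7), by positivity, ?_⟩
  filter_upwards [h22, fiCountSq_bounds h35, eventually_ge_atTop (0 : ℝ)] with x hx hb hx0
  change _ ≤ fiCountSq x
  have hsq : Real.sqrt (∑ n ∈ Icc 1 ⌊x⌋₊, fiSieveSeqSq.a n ^ 2) ≤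
      Real.sqrt (∑ n ∈ Icc 1 ⌊x⌋₊, (fiRepCount n : ℝ) ^ 2) := by
    refine Real.sqrt_le_sqrt (Finset.sum_le_sum fun n _ => ?_)
    exact pow_le_pow_left₀ (fiSieveSeqSq.a_nonneg n) (fiSieveSeqSq_a_le n) 2
  calc c * Real.exp (-7) * x ^ (1 / 3 : ℝ) * Real.sqrt (∑ n ∈ Icc 1 ⌊x⌋₊, fiSieveSeqSq.a n ^ 2)
      ≤ c * Real.exp (-7) * x ^ (1 / 3 : ℝ) * Real.sqrt (∑ n ∈ Icc 1 ⌊x⌋₊, (fiRepCount n : ℝ) ^ 2) := by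
        gcongr
    _ = Real.exp (-7) * (c * x ^ (1 / 3 : ℝ) * Real.sqrt (∑ n ∈ Icc 1 ⌊x⌋₊, (fiRepCount n : ℝ) ^ 2)) := by
        ring
    _ ≤ Real.exp (-7) * fiCount x := mul_le_mul_of_nonneg_left hx (Real.exp_pos _).le
    _ ≤ fiCountSq x := hb.1

/-- **(2.8) for `a'`, as printed**: `A'_d(x) ≤ K τ(d)⁸ d⁻¹ A'(x)` uniformly in `1 ≤ d ≤ x^{1/3}`,
`x` large (`A'_d = 0` for non-squarefree `d`; `congrSum_le_sigma_mul` for squarefree `d`).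
[cite: FriedlanderIwaniecAnnals1998, (2.8)] -/
theorem hyp28_sq (h35 : FriedlanderIwaniec1998_prop35) :
    ∃ K : ℝ, ∀ᶠ x : ℝ in atTop, ∀ d : ℕ, 1 ≤ d → (d : ℝ) ≤ x ^ (1 / 3 : ℝ) →
      fiSieveSeqSq.congrSum d x ≤ K * (σ 0 d : ℝ) ^ 8 / d * fiSieveSeqSq.size x := by
  have hκ := friedlanderIwaniecKappa_pos
  refine ⟨9 * Real.exp 7 / (2 * friedlanderIwaniecKappa), ?_⟩
  filter_upwards [fiCountSq_bounds h35, eventually_ge_atTop (1 : ℝ)] with x hb hx1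
  intro d hd hdx
  change _ ≤ _ * fiCountSq x
  have hd0 : (0 : ℝ) < d := by exact_mod_cast hd
  have hx0 : 0 < x := by linarith
  have hA'0 : 0 ≤ fiCountSq x := fiCountSq_nonneg x
  by_cases hsq : Squarefree d
  · have hdx2 : (d : ℝ) ≤ x ^ (1 / 2 : ℝ) :=
      hdx.trans (Real.rpow_le_rpow_of_exponent_le hx1 (by norm_num))
    have h1 := (fiSieveSeqSq_congrSum_le d x).trans (congrSum_le_sigma_mul hsq hx1 hdx2)
    refine h1.trans ?_
    have hσ1 : (1 : ℝ) ≤ (σ 0 d : ℝ) := by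
      have : 1 ≤ σ 0 d := by
        rw [ArithmeticFunction.sigma_zero_apply]
        exact Finset.card_pos.mpr ⟨1, Nat.one_mem_divisors.mpr (by omega)⟩
      exact_mod_cast this
    have hσ8 : (σ 0 d : ℝ) ≤ (σ 0 d : ℝ) ^ 8 := le_self_pow₀ hσ1 (by norm_num)
    -- `x^{3/4} ≤ A(x)/(2κ) ≤ e⁷ A'(x)/(2κ)`
    have hx34 : x ^ (3 / 4 : ℝ) ≤ Real.exp 7 / (2 * friedlanderIwaniecKappa) * fiCountSq x := by
      rw [div_mul_eq_mul_div, le_div_iff₀ (by positivity)]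
      have h7 : Real.exp 7 * (Real.exp (-7) * fiCount x) = fiCount x := by
        rw [← mul_assoc, ← Real.exp_add]; norm_num
      calc x ^ (3 / 4 : ℝ) * (2 * friedlanderIwaniecKappa) = 2 * friedlanderIwaniecKappa * x ^ (3 / 4 : ℝ) := by ring
        _ ≤ fiCount x := hb.2.2.1
        _ = Real.exp 7 * (Real.exp (-7) * fiCount x) := h7.symm
        _ ≤ Real.exp 7 * fiCountSq x := mul_le_mul_of_nonneg_left hb.1 (Real.exp_pos _).le
    calc 9 * (σ 0 d : ℝ) * x ^ (3 / 4 : ℝ) / d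
        ≤ 9 * (σ 0 d : ℝ) ^ 8 * (Real.exp 7 / (2 * friedlanderIwaniecKappa) * fiCountSq x) / d := by
          gcongr
      _ = 9 * Real.exp 7 / (2 * friedlanderIwaniecKappa) * (σ 0 d : ℝ) ^ 8 / d * fiCountSq x := by
          field_simp
  · rw [fiSieveSeqSq_congrSum_eq_zero hsq]
    positivity

/-! ### (2.11) for `a'`: the bilinear forms of `a'` are those of `a` -/

/-- The inner sums of the bilinear form (2.11) for `a'` vanish unless `m` is squarefree, and then
coincide with those for `a` (`n` runs over squarefree integers coprime to `m`, by the factor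
`μ(n)`). Hence `B'(x; N) ≤ B(x; N)`. [cite: FriedlanderIwaniecAnnals1998, (2.11)-(2.12)] -/
theorem fiBilinearPi_sq_le (x N C P : ℝ) :
    fiSieveSeqSq.fiBilinearPi x N C P ≤ fiSieveSeq.fiBilinearPi x N C P := by
  unfold SieveSequence.fiBilinearPi
  refine Finset.sum_le_sum fun m hm => ?_
  have hm0 : m ≠ 0 := by have := (Finset.mem_Icc.mp hm).1; omega
  by_cases hsq : Squarefree m
  · refine le_of_eq (congrArg _ (Finset.sum_congr rfl fun n hn => ?_))
    have hn' := (Finset.mem_filter.mp hn).2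
    change _ * fiSieveSeqSq.a (m * n) = _ * (fiRepCount (m * n) : ℝ)
    rw [fiSieveSeqSq_a]
    by_cases hns : Squarefree n
    · rw [if_pos ((Nat.squarefree_mul hn'.2.1.symm).mpr ⟨hsq, hns⟩)]
    · rw [ArithmeticFunction.moebius_eq_zero_of_not_squarefree hns]; simp
  · have hzero : ∑ n ∈ (Ioc ⌊N⌋₊ ⌊2 * N⌋₊).filter
        (fun n : ℕ => ((m * n : ℕ) : ℝ) ≤ x ∧ n.Coprime m ∧ ∀ p ∈ n.primeFactors, P ≤ (p : ℝ)),
        (μ n : ℝ) * (SieveSequence.fiGamma C n : ℝ) * fiSieveSeqSq.a (m * n) = 0 := by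
      refine Finset.sum_eq_zero fun n _ => ?_
      rw [fiSieveSeqSq_a, if_neg (fun h => hsq (h.squarefree_of_dvd (dvd_mul_right m n))), mul_zero]
    rw [hzero, abs_zero]
    exact abs_nonneg _

end Literature.NumberTheory.Sieve.FriedlanderIwaniecPrimesSquarefree

/-! ## Part H: Proposition 2.1 applied to `a'`; (4.7) and parity.S17 -/

namespace Literature.NumberTheory.Sieve.FriedlanderIwaniecPrimesSquarefree

open FriedlanderIwaniecPrimes
open scoped ArithmeticFunction.sigma ArithmeticFunction.Moebius ArithmeticFunction.omega

/-- The level `D(x) = x^{17/25}` used for `a'` (`x^{2/3} < D < x^{69/100}`, so that the level sum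
at `D L²` is covered by `levelSq_and_countSq`). [folklore] -/
theorem ranges_sq {α : ℝ} (hα : 0 < α) :
    ∀ᶠ x : ℝ in atTop, x ^ (2 / 3 : ℝ) < x ^ (17 / 25 : ℝ) ∧ x ^ (17 / 25 : ℝ) < x ∧
      2 ≤ Real.log x ^ α ∧ Real.log x ^ α ≤ x ^ fiEps ∧ 2 ≤ fiP x ∧
      fiP x ≤ (x ^ fiEps) ^ (1 / (2 ^ 35 * Real.log (Real.log x))) := by
  filter_upwards [ranges_eventually hα, eventually_gt_atTop (1 : ℝ)] with x h hx1
  refine ⟨Real.rpow_lt_rpow_of_exponent_lt hx1 (by norm_num), ?_, h.2.2⟩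
  calc x ^ (17 / 25 : ℝ) < x ^ (1 : ℝ) := Real.rpow_lt_rpow_of_exponent_lt hx1 (by norm_num)
    _ = x := Real.rpow_one x

/-- **(2.9) for `a'`** with `D = x^{17/25}`, `L = (log x)^{2^{24}}`, from `levelSq_and_countSq`.
[cite: FriedlanderIwaniecAnnals1998, (2.9)-(2.10)] -/
theorem hyp29_sq (h35 : FriedlanderIwaniec1998_prop35) :
    ∀ᶠ x : ℝ in atTop, ∀ t : ℝ, t ≤ x →
      ∑ d ∈ (Icc 1 ⌊x ^ (17 / 25 : ℝ) * (Real.log x ^ (2 ^ 24 : ℕ)) ^ 2⌋₊).filter IsCubefree,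
        |fiSieveSeqSq.remainder d t| ≤ fiSieveSeqSq.size x / (Real.log x ^ (2 ^ 24 : ℕ)) ^ 2 := by
  have hl1 : ∀ᶠ x : ℝ in atTop, ‖(Real.log x ^ (2 ^ 24 : ℕ)) ^ 2‖ ≤ 1 * ‖x ^ (1 / 100 : ℝ)‖ := by
    refine ((isLittleO_log_rpow_rpow_atTop (s := 1 / 100) ((2 ^ 25 : ℕ) : ℝ)
      (by norm_num)).congr_left fun x => ?_).def one_pos
    rw [← pow_mul, ← Real.rpow_natCast]; norm_num
  have hl2 : ∀ᶠ x : ℝ in atTop, ‖(Real.log x ^ (2 ^ 24 : ℕ)) ^ 2‖ ≤ Real.exp (-7) * ‖x ^ (1 / 500 : ℝ)‖ := by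
    refine ((isLittleO_log_rpow_rpow_atTop (s := 1 / 500) ((2 ^ 25 : ℕ) : ℝ)
      (by norm_num)).congr_left fun x => ?_).def (Real.exp_pos _)
    rw [← pow_mul, ← Real.rpow_natCast]; norm_num
  filter_upwards [levelSq_and_countSq h35, fiCountSq_bounds h35, hl1, hl2, eventually_ge_atTop (3 : ℝ)]
    with x hlev hb hl1 hl2 hx3
  intro t htx
  have hx0 : 0 < x := by linarith
  have hx1 : 1 < x := by linarith
  have hlog1 : 1 ≤ Real.log x := by
    rw [Real.le_log_iff_exp_le hx0]; linarith [Real.exp_one_lt_d9]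
  set L : ℝ := Real.log x ^ (2 ^ 24 : ℕ) with hL
  have hL1 : 1 ≤ L := one_le_pow₀ hlog1
  have hL2 : 1 ≤ L ^ 2 := one_le_pow₀ hL1
  rw [Real.norm_eq_abs, Real.norm_eq_abs, abs_of_nonneg (by positivity), abs_of_nonneg (by positivity)] at hl1 hl2
  set D₀ : ℕ := ⌊x ^ (17 / 25 : ℝ) * L ^ 2⌋₊ with hD₀
  have hxD : 1 ≤ x ^ (17 / 25 : ℝ) * L ^ 2 :=
    one_le_mul_of_one_le_of_one_le (Real.one_le_rpow hx1.le (by norm_num)) hL2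
  have hD₀1 : 1 ≤ D₀ := Nat.le_floor (by simpa using hxD)
  have hD₀x : (D₀ : ℝ) ≤ x ^ (69 / 100 : ℝ) := by
    refine (Nat.floor_le (by positivity)).trans ?_
    calc x ^ (17 / 25 : ℝ) * L ^ 2 ≤ x ^ (17 / 25 : ℝ) * (1 * x ^ (1 / 100 : ℝ)) := by gcongr
      _ = x ^ (69 / 100 : ℝ) := by rw [one_mul, ← Real.rpow_add hx0]; norm_num
  refine (hlev.1 t htx D₀ hD₀1 hD₀x).trans ?_
  change _ ≤ fiCountSq x / L ^ 2
  rw [le_div_iff₀ (by positivity)]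
  -- `A(x) x^{-1/500} L² ≤ e^{-7} A(x) ≤ A'(x)`
  have hA := fiCount_nonneg x
  calc fiCount x * x ^ (-(1 / 500 : ℝ)) * L ^ 2 = fiCount x * (x ^ (-(1 / 500 : ℝ)) * L ^ 2) := by ring
    _ ≤ fiCount x * Real.exp (-7) := by
        refine mul_le_mul_of_nonneg_left ?_ hA
        rw [Real.rpow_neg hx0.le, inv_mul_le_iff₀ (by positivity)]
        linarith
    _ = Real.exp (-7) * fiCount x := mul_comm _ _
    _ ≤ fiCountSq x := hb.1

/-- **(2.11) for `a'`** from Proposition 4.1 (`η = 1/25`, `A = 2^{26} + 5`) and `B' ≤ B`, in the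
ranges (2.13)–(2.14) for the level `D = x^{17/25}`, `Δ = x^{1/200}`, `δ = (log x)^B`.
[cite: FriedlanderIwaniecAnnals1998, Proposition 4.1 and (2.11)-(2.15)] -/
theorem hyp211_sq (h41 : FriedlanderIwaniec1998_prop41) (h35 : FriedlanderIwaniec1998_prop35) :
    ∃ B : ℝ, 0 < B ∧ ∀ᶠ x : ℝ in atTop, ∀ C : ℝ, 1 ≤ C → C ≤ x / x ^ (17 / 25 : ℝ) →
      ∀ N : ℝ, Real.sqrt (x ^ (17 / 25 : ℝ)) / x ^ fiEps < N → N < Real.sqrt x / Real.log x ^ B →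
        fiSieveSeqSq.fiBilinearPi x N C (fiP x) ≤ fiSieveSeqSq.size x / Real.log x ^ (2 ^ 26 : ℕ) := by
  obtain ⟨B, hB, K, hev⟩ := h41 (1 / 25) (by norm_num) (2 ^ 26 + 5) (by norm_num)
  refine ⟨B, hB, ?_⟩
  have hll : Tendsto (fun x : ℝ => Real.log (Real.log x)) atTop atTop :=
    Real.tendsto_log_atTop.comp Real.tendsto_log_atTop
  have h44 : ∀ᶠ x : ℝ in atTop, ‖Real.log (Real.log x) ^ 4‖ ≤ 1 * ‖Real.log x‖ :=
    ((Real.isLittleO_pow_log_id_atTop (n := 4)).comp_tendsto Real.tendsto_log_atTop).def one_pos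
  filter_upwards [hev, eventually_gt_atTop 1, h44, hll.eventually_ge_atTop 1,
    Real.tendsto_log_atTop.eventually_ge_atTop (max K 1 * Real.exp 7), fiCountSq_bounds h35]
    with x hx hx1 h3 h4 h5 hb
  intro C hC1 hC2 N hN1 hN2
  have hx0 : 0 < x := zero_lt_one.trans hx1
  have hlog0 : 0 < Real.log x := Real.log_pos hx1
  have hll0 : 0 < Real.log (Real.log x) := zero_lt_one.trans_le h4
  -- the range (4.4) for `P = exp((log log x)²)`
  have hP1 : Real.log (Real.log x) ^ 2 ≤ Real.log (fiP x) := by rw [fiP, Real.log_exp]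
  have hP2 : Real.log (fiP x) ≤ Real.log x * (Real.log (Real.log x))⁻¹ ^ 2 := by
    rw [fiP, Real.log_exp, Real.norm_eq_abs, Real.norm_eq_abs, abs_of_nonneg (by positivity),
      abs_of_pos hlog0, one_mul] at *
    rw [inv_pow, ← div_eq_mul_inv, le_div_iff₀ (by positivity)]
    calc Real.log (Real.log x) ^ 2 * Real.log (Real.log x) ^ 2 = Real.log (Real.log x) ^ 4 := by ring
      _ ≤ Real.log x := h3
  -- the range (4.6) for `N`
  have hlow : Real.sqrt (x ^ (17 / 25 : ℝ)) / x ^ fiEps = x ^ ((17 / 25 : ℝ) / 2 - fiEps) := by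
    rw [Real.sqrt_eq_rpow, ← Real.rpow_mul hx0.le, ← Real.rpow_sub hx0]
    congr 1; ring
  rw [hlow] at hN1
  have hN0 : 0 < N := (Real.rpow_pos_of_pos hx0 _).trans hN1
  have hN1' : x ^ (1 / 4 + 1 / 25 : ℝ) < N :=
    (Real.rpow_le_rpow_of_exponent_le hx1.le (by norm_num [fiEps])).trans_lt hN1
  have hN2' : N < x ^ (1 / 2 : ℝ) / Real.log x ^ B := by rwa [Real.sqrt_eq_rpow] at hN2
  -- the range `1 ≤ C ≤ N^{1 - η}`
  have hC2' : C ≤ N ^ (1 - 1 / 25 : ℝ) := by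
    refine hC2.trans ?_
    have hxD : x / x ^ (17 / 25 : ℝ) = x ^ (8 / 25 : ℝ) := by
      rw [div_eq_iff (Real.rpow_pos_of_pos hx0 _).ne', ← Real.rpow_add hx0]
      conv_lhs => rw [← Real.rpow_one x]
      norm_num
    rw [hxD]
    calc x ^ (8 / 25 : ℝ)
        ≤ x ^ (((17 / 25 : ℝ) / 2 - fiEps) * (1 - 1 / 25) : ℝ) :=
          Real.rpow_le_rpow_of_exponent_le hx1.le (by norm_num [fiEps])
      _ = (x ^ ((17 / 25 : ℝ) / 2 - fiEps : ℝ)) ^ (1 - 1 / 25 : ℝ) := Real.rpow_mul hx0.le _ _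
      _ ≤ N ^ (1 - 1 / 25 : ℝ) := Real.rpow_le_rpow (by positivity) hN1.le (by norm_num)
  refine ((fiBilinearPi_sq_le x N C (fiP x)).trans (hx (fiP x) hP1 hP2 N hN1' hN2' C hC1 hC2')).trans ?_
  -- `K A(x) (log x)^{4 - A} ≤ A'(x) (log x)^{-2^26}` once `log x ≥ K e⁷`
  change K * fiCount x * Real.log x ^ (4 - (2 ^ 26 + 5) : ℝ) ≤ fiCountSq x / Real.log x ^ (2 ^ 26 : ℕ)
  have hA0 : 0 ≤ fiCount x := fiCount_nonneg x
  have hpow : Real.log x ^ (4 - (2 ^ 26 + 5) : ℝ) = (Real.log x ^ (2 ^ 26 : ℕ))⁻¹ * (Real.log x)⁻¹ := by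
    rw [show (4 - (2 ^ 26 + 5) : ℝ) = -((2 ^ 26 + 1 : ℕ) : ℝ) by push_cast; ring,
      Real.rpow_neg hlog0.le, Real.rpow_natCast, pow_succ, mul_inv]
  rw [hpow, div_eq_mul_inv]
  have hK : max K 1 * Real.exp 7 ≤ Real.log x := h5
  have hK7 : K * fiCount x ≤ Real.log x * fiCountSq x := by
    calc K * fiCount x ≤ max K 1 * fiCount x := mul_le_mul_of_nonneg_right (le_max_left _ _) hA0
      _ = max K 1 * Real.exp 7 * (Real.exp (-7) * fiCount x) := by
          rw [mul_assoc, ← mul_assoc (Real.exp 7), ← Real.exp_add]; norm_num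
      _ ≤ Real.log x * fiCountSq x :=
          mul_le_mul hK hb.1 (by positivity) hlog0.le
  calc K * fiCount x * ((Real.log x ^ (2 ^ 26 : ℕ))⁻¹ * (Real.log x)⁻¹)
      = (K * fiCount x) * (Real.log x)⁻¹ * (Real.log x ^ (2 ^ 26 : ℕ))⁻¹ := by ring
    _ ≤ (Real.log x * fiCountSq x) * (Real.log x)⁻¹ * (Real.log x ^ (2 ^ 26 : ℕ))⁻¹ := by
        gcongr
    _ = fiCountSq x * (Real.log x ^ (2 ^ 26 : ℕ))⁻¹ := by field_simp

/-- **The hypotheses (2.1)–(2.15) of Proposition 2.1 hold for `a'`** (with `D = x^{17/25}`,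
`δ = (log x)^B`, `Δ = x^{1/200}`, `P = exp((log log x)²)`), given Propositions 3.5 and 4.1 and (2.7)
for `g`. [cite: FriedlanderIwaniecAnnals1998, §§2-4] -/
theorem sieveHypotheses_sq (h35 : FriedlanderIwaniec1998_prop35) (h41 : FriedlanderIwaniec1998_prop41)
    (h27 : FriedlanderIwaniec1998_hyp27) :
    ∃ B : ℝ, 0 < B ∧ fiSieveSeqSq.FI1998SieveHypotheses (fun x => x ^ (17 / 25 : ℝ))
      (fun x => Real.log x ^ B) (fun x => x ^ fiEps) fiP := by
  obtain ⟨B, hB, h211⟩ := hyp211_sq h41 h35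
  refine ⟨B, hB, fiSieveSeqSq_size_eq, hyp21_sq h35, hyp22_sq h35, fun p hp => fiDensitySq_hyp24 hp,
    ?_, hyp27_sq h27, hyp28_sq h35, ranges_sq hB, hyp29_sq h35, h211⟩
  refine ⟨3, fun p hp => ?_⟩
  obtain ⟨h1, h2⟩ := fiDensitySq_hyp2526 hp
  refine ⟨h1.trans ?_, h2⟩
  have : (0 : ℝ) < p := by exact_mod_cast hp.pos
  change fiDensitySq p ≤ 2 / p at h1
  gcongr; norm_num

/-- **(4.7) with (4.8) for `a_n` from Proposition 2.1 applied to `a'`.** Proposition 2.1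
(`FriedlanderIwaniec1998_prop21`, as printed) applied to the squarefree-supported sequence gives
`S(x) = H' A'(x) (1 + O(log log x / log x))`, `H' = (4/π)/P_∞`; and
`A'(x) = P_∞ A(x) (1 + O(x^{-1/500} + 1/x))`, whence (4.7): `S(x) = (4/π) A(x)(1 + O(log log x/log x))`.
Inputs: Propositions 2.1, 3.5, 4.1 and (2.7) for `g` as named facts; (2.2), (4.2), (4.8) proved in
the tree. [cite: FriedlanderIwaniecAnnals1998, §4, (4.7)-(4.8)] -/
theorem primeSum_asymp_of_sq_inputs (h21 : FriedlanderIwaniec1998_prop21)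
    (h35 : FriedlanderIwaniec1998_prop35) (h41 : FriedlanderIwaniec1998_prop41)
    (h27 : FriedlanderIwaniec1998_hyp27) : FriedlanderIwaniec1998_primeSum_asymp := by
  obtain ⟨B, hB, hhyp⟩ := sieveHypotheses_sq h35 h41 h27
  set H' : ℝ := 4 / Real.pi / fiSqConst with hH'
  have hP := fiSqConst_pos
  have hH'0 : 0 < H' := by rw [hH']; positivity
  have hHP : H' * fiSqConst = 4 / Real.pi := by rw [hH']; field_simp
  have h := h21 fiSieveSeqSq (fun x => x ^ (17 / 25 : ℝ)) fiP B fiEps H' hB (by norm_num [fiEps])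
    (by norm_num [fiEps]) hhyp (hasDensityConstant_fiSieveSeqSq_of_densityConstant
      FriedlanderIwaniec1998_densityConstant_holds)
  simp only [fiSieveSeqSq_primeSum] at h
  change (fun x => fiPrimeSum x - H' * fiCountSq x) =O[atTop]
    (fun x => H' * fiCountSq x * (Real.log (Real.log x) / Real.log x)) at h
  -- Step 1: `H' A'(x) ≤ (1/P_∞) (4/π) A(x)`
  have h1 : (fun x => fiPrimeSum x - H' * fiCountSq x) =O[atTop]
      (fun x => 4 / Real.pi * fiCount x * (Real.log (Real.log x) / Real.log x)) := by
    refine h.trans (Asymptotics.IsBigO.of_bound (1 / fiSqConst) (Filter.Eventually.of_forall fun x => ?_))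
    have hA' := fiCountSq_le_fiCount x
    have hA'0 := fiCountSq_nonneg x
    have hA0 := fiCount_nonneg x
    rw [Real.norm_eq_abs, Real.norm_eq_abs, abs_mul (H' * fiCountSq x), abs_mul (4 / Real.pi * fiCount x),
      abs_of_nonneg (mul_nonneg hH'0.le hA'0), abs_of_nonneg (mul_nonneg (by positivity) hA0)]
    calc H' * fiCountSq x * |Real.log (Real.log x) / Real.log x|
        ≤ H' * fiCount x * |Real.log (Real.log x) / Real.log x| := by gcongr
      _ = 1 / fiSqConst * (4 / Real.pi * fiCount x * |Real.log (Real.log x) / Real.log x|) := by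
          rw [hH']; field_simp
  -- Step 2: `H' A'(x) - (4/π) A(x) = H' (A'(x) - P_∞ A(x))` is `O(A(x) (x^{-1/500} + 1/x))`
  have h2 : (fun x => H' * fiCountSq x - 4 / Real.pi * fiCount x) =O[atTop]
      (fun x => 4 / Real.pi * fiCount x * (Real.log (Real.log x) / Real.log x)) := by
    have hll : Tendsto (fun x : ℝ => Real.log (Real.log x)) atTop atTop :=
      Real.tendsto_log_atTop.comp Real.tendsto_log_atTop
    have hl1 : ∀ᶠ x : ℝ in atTop, ‖Real.log x‖ ≤ 1 * ‖x ^ (1 / 500 : ℝ)‖ :=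
      (isLittleO_log_rpow_atTop (by norm_num : (0 : ℝ) < 1 / 500)).def one_pos
    have hl2 : ∀ᶠ x : ℝ in atTop, ‖Real.log x‖ ≤ 1 / 6 * ‖x ^ (1 : ℝ)‖ :=
      (isLittleO_log_rpow_atTop (by norm_num : (0 : ℝ) < 1)).def (by norm_num)
    refine Asymptotics.IsBigO.of_bound (2 / fiSqConst) ?_
    filter_upwards [levelSq_and_countSq h35, hl1, hl2, hll.eventually_ge_atTop 1,
      eventually_ge_atTop (2 : ℝ)] with x hlev hl1 hl2 hll1 hx2
    have hx0 : 0 < x := by linarith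
    have hx1 : 1 < x := by linarith
    have hlog0 : 0 < Real.log x := Real.log_pos hx1
    rw [Real.rpow_one] at hl2
    rw [Real.norm_eq_abs, Real.norm_eq_abs, abs_of_pos hlog0] at hl1 hl2
    rw [abs_of_nonneg (by positivity)] at hl1
    rw [abs_of_nonneg hx0.le] at hl2
    obtain ⟨hX1, hXle, hXge⟩ := floor_facts hx2
    have hA := fiCount_nonneg x
    -- `|A'(x) - P_∞ A(x)| ≤ A(x) (x^{-1/500} + 3/⌊x⌋)`
    have hd : |fiCountSq x - fiSqConst * fiCount x| ≤ fiCount x * (x ^ (-(1 / 500 : ℝ)) + 3 / ⌊x⌋₊) := by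
      have e : fiCountSq x - fiSqConst * fiCount x =
          (fiCountSq x - fiSqProd ⌊x⌋₊ * fiCount x) + (fiSqProd ⌊x⌋₊ - fiSqConst) * fiCount x := by ring
      rw [e, mul_add]
      refine (abs_add_le _ _).trans (add_le_add (hlev.2 x le_rfl) ?_)
      rw [abs_mul, abs_of_nonneg hA, abs_of_nonneg (fiSqProd_sub_fiSqConst_le hX1).1, mul_comm]
      exact mul_le_mul_of_nonneg_left (fiSqProd_sub_fiSqConst_le hX1).2 hA
    -- `x^{-1/500} + 3/⌊x⌋ ≤ 2 / log x ≤ 2 log log x / log x`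
    have hsmall : x ^ (-(1 / 500 : ℝ)) + 3 / ⌊x⌋₊ ≤ 2 * (Real.log (Real.log x) / Real.log x) := by
      have e1 : x ^ (-(1 / 500 : ℝ)) ≤ 1 / Real.log x := by
        rw [Real.rpow_neg hx0.le, ← one_div, div_le_div_iff₀ (by positivity) hlog0]; linarith
      have e2 : 3 / (⌊x⌋₊ : ℝ) ≤ 1 / Real.log x := by
        rw [div_le_div_iff₀ (by exact_mod_cast hX1) hlog0]; linarith
      have e3 : 1 / Real.log x ≤ Real.log (Real.log x) / Real.log x :=
        div_le_div_of_nonneg_right hll1 hlog0.le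
      linarith
    have hr0 : 0 ≤ Real.log (Real.log x) / Real.log x := div_nonneg (by linarith) hlog0.le
    rw [Real.norm_eq_abs, Real.norm_eq_abs, abs_of_nonneg (mul_nonneg (mul_nonneg (by positivity) hA) hr0)]
    have e : H' * fiCountSq x - 4 / Real.pi * fiCount x = H' * (fiCountSq x - fiSqConst * fiCount x) := by
      rw [← hHP]; ring
    rw [e, abs_mul, abs_of_pos hH'0]
    calc H' * |fiCountSq x - fiSqConst * fiCount x| ≤ H' * (fiCount x * (x ^ (-(1 / 500 : ℝ)) + 3 / ⌊x⌋₊)) :=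
          mul_le_mul_of_nonneg_left hd hH'0.le
      _ ≤ H' * (fiCount x * (2 * (Real.log (Real.log x) / Real.log x))) := by gcongr
      _ = 2 / fiSqConst * (4 / Real.pi * fiCount x * (Real.log (Real.log x) / Real.log x)) := by
          rw [hH']; field_simp
  -- Step 3: add
  refine (h1.add h2).congr_left fun x => ?_
  ring

end Literature.NumberTheory.Sieve.FriedlanderIwaniecPrimesSquarefree

namespace Literature.NumberTheory.Sieve

open FriedlanderIwaniecPrimesSquarefree

/-- **FI (4.7)–(4.8) from the printed architecture, honest form.** The named fact
`FriedlanderIwaniec1998_primeSum_asymp` (`S(x) = (4/π) A(x)(1 + O(log log x/log x))`) follows from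
FI Proposition 2.1 (`FriedlanderIwaniec1998_prop21`, the asymptotic sieve for primes AS PRINTED),
Proposition 3.5 (`_prop35`, level of distribution), Proposition 4.1 (`_prop41`, the bilinear form
bound) and (2.7) for `g` (`_hyp27`, Mertens' theorem for `χ₄` with a PNT error term) — Proposition
2.1 being applied to the squarefree-supported sequence `a'_n = μ(n)² a_n`, for which its hypothesis
(2.8) holds as printed (it fails for `a_n` itself: `FriedlanderIwaniec1998_hyp28_false`). The other
printed inputs — (2.2) (`FriedlanderIwaniec1998_hyp22_holds`), (4.2)
(`FriedlanderIwaniec1998_count_asymp_holds`), (4.8) (`FriedlanderIwaniec1998_densityConstant_holds`)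
— are theorems of the tree. This supersedes `FriedlanderIwaniec1998_primeSum_asymp_of_inputs`, whose
hypothesis `FriedlanderIwaniec1998_hyp28` is refuted.
[cite: FriedlanderIwaniecAnnals1998, §4, (4.7)-(4.8) from Propositions 2.1, 3.5, 4.1] -/
theorem FriedlanderIwaniec1998_primeSum_asymp_of_sq_inputs (h21 : FriedlanderIwaniec1998_prop21)
    (h35 : FriedlanderIwaniec1998_prop35) (h41 : FriedlanderIwaniec1998_prop41)
    (h27 : FriedlanderIwaniec1998_hyp27) : FriedlanderIwaniec1998_primeSum_asymp :=
  primeSum_asymp_of_sq_inputs h21 h35 h41 h27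

/-- **Friedlander–Iwaniec Theorem 1 (parity.S17, quantitative form) from the four printed named
facts** Prop. 2.1, Prop. 3.5, Prop. 4.1, (2.7).
[cite: FriedlanderIwaniecAnnals1998, Theorem 1 via §4] -/
theorem friedlanderIwaniecSum_isEquivalent_of_sq_inputs (h21 : FriedlanderIwaniec1998_prop21)
    (h35 : FriedlanderIwaniec1998_prop35) (h41 : FriedlanderIwaniec1998_prop41)
    (h27 : FriedlanderIwaniec1998_hyp27) : friedlanderIwaniecSum_isEquivalent :=
  friedlanderIwaniecSum_isEquivalent_of_primeSum
    (FriedlanderIwaniec1998_primeSum_asymp_of_sq_inputs h21 h35 h41 h27)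

/-- **parity.S17, qualitative clause (`setOf_prime_sq_add_pow_four_infinite`: infinitely many primes
`p = a² + b⁴`) from the four printed named facts** Prop. 2.1, Prop. 3.5, Prop. 4.1, (2.7) of
[FriedlanderIwaniecAnnals1998]; the discharge `setOf_prime_sq_add_pow_four_infinite_holds` is this
theorem applied to their future proofs. [cite: FriedlanderIwaniecAnnals1998, Theorem 1] -/
theorem setOf_prime_sq_add_pow_four_infinite_of_sq_inputs (h21 : FriedlanderIwaniec1998_prop21)
    (h35 : FriedlanderIwaniec1998_prop35) (h41 : FriedlanderIwaniec1998_prop41)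
    (h27 : FriedlanderIwaniec1998_hyp27) : setOf_prime_sq_add_pow_four_infinite :=
  setOf_prime_sq_add_pow_four_infinite_of_primeSum
    (FriedlanderIwaniec1998_primeSum_asymp_of_sq_inputs h21 h35 h41 h27)

end Literature.NumberTheory.Sieve
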